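import Literature.NumberTheory.LFunctions.KeiperLiAsymptoticCriteria
import Literature.NumberTheory.LFunctions.FordZetaZeroRecipSqSum
import Mathlib.RingTheory.PowerSeries.Derivative
import Mathlib.RingTheory.PowerSeries.Inverse
import Mathlib.LinearAlgebra.Lagrange
import HarnessLib

/-!
# RH-FREE discharges for `KeiperLiAsymptoticCriteria.lean` (cell `rh-crit/dbl`, seat t13)

LINE 1 — LABEL: RH-FREE.  Proofs (`_holds`) of named facts of the sibling statements module
`KeiperLiAsymptoticCriteria.lean` (Voros 2006, Coffey 2008, Voros 2018); no definitions, no new named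
facts.  bears_on: LADDER-RH L-C/L-P (COLUMN 4 LI).  WHAT THIS IS NOT: discharging a printed RH-free lemma,
or the RH-free half of a criterion, is bookkeeping of the literature — it does not move RH; nothing here
bears on the truth of RH.

## Contents

* `Voros2006_thm_if_holds` — the `⇐` half of Voros's asymptotic criterion ([Voros2006] §3 Theorem p.6):
  `λ_n = ½ n (log n − 1 + γ − log 2π) + o(n) ⟹ RH`.  Printed route («implied by [BL]», p.6): the
  asymptotic makes `λ_n → +∞`, so `λ_n` is bounded below, and Bombieri–Lagarias' Theorem 1 in the
  bounded-below form (tree: `bombieriLagarias1999_theorem1_pos_of_bddBelow`, with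
  `keiperLiCoeff_eq_tsum_zeros`, `summable_weight_zetaZeros`) forces `Re ρ ≥ ½` for every non-trivial
  zero, i.e. RH by the symmetry `ρ ↦ 1 − ρ̄`.  With it `Voros2006_thm_iff'`: the criterion modulo the
  RH-CONSEQUENCE half `Voros2006_thm_onlyif` only.
* `Coffey2008_eq34_holds` — [Coffey2008] eq. (3.4): the symmetric power sums over the zeros are the Taylor
  coefficients of `log ξ` at `1`, `σ_k = (−1)^{k+1} k a_k` (`k ≥ 1`).  Route = the tree's proof of Li's
  zero-sum formula (`keiperLiCoeff_eq_zero_sum_holds`): termwise differentiation of the Hadamard series of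
  `ξ'/ξ` at `s = 1` (`IsHadamardSeq.hasSum_iteratedDeriv_term_one`, `iteratedDeriv_term_one`), double
  counting (`finsum_liZeroBox_eq_sum`), cofinal truncations (`tendsto_sum_truncation`), then passage from
  the box limit to the absolutely convergent `tsum` over the zero set (`tendsto_weilZeroFinset`).  Hence
  (3.5) and (3.6) unconditionally: `keiperLiCoeff_eq_sum_zetaZeroPowerSum'`, `re_zetaZeroPowerSum_eq'`.
* `Voros2006_eqDA_holds` — [Voros2006] eq. (DA) p.4 / (RS) p.6 (sign as corrected in [Voros2018] fn. 1,
  eq. (ASF)): for every `0 < r < 1`, `λ_n + Σ_{‖1−1/ρ‖ ≤ r} m(ρ) Re(1−1/ρ)^{−n} = o(r^{−n})`, unconditionally.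
  The printed route is Darboux's method (Cauchy estimates for the meromorphic generating function
  `(log 2ξ(1/(1−z)))'` on `|z| = r`); here the SAME bookkeeping is done on the absolutely convergent zero
  sum of the tree (`keiperLiCoeff_eq_tsum_zeros`, reflected to Bombieri–Lagarias' `(1 − 1/ρ)^{−n}` form,
  `keiperLiCoeff_eq_tsum_zeros_inv`): the finitely many zeros with `‖1−1/ρ‖ ≤ r` are split off, every
  other zero has `‖1−1/ρ‖ ≥ r₂ > r` (no accumulation of the moduli below `1`), and its term is bounded by
  `n²(8 + 2r₂^{−n}) m(ρ)/(1+γ²)` (second-order Taylor bound for `|ρ−1| ≥ n` as in Bombieri–Lagarias,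
  trivial bound and a count otherwise), whence `O(n² r₂^{−n}) = o(r^{−n})` against `Σ m(ρ)/(1+γ²) < ∞`.
* `Coffey2008_prop42_holds` — [Coffey2008] Prop. 4.2 p.719: strict sign alternation
  `(−1)^{j+1} η_j > 0` (`j ≥ 0`).  Printed route: (3.6) + (4.17) `(1−2^{−k})ζ(k) − 1 > 3^{−k}` + the
  smallness of `σ_k`; for the latter the paper cites Matsuoka's first-zero asymptotic (4.16), replaced
  here by the all-zeros bound `|σ_k| ≤ 0.0463·14^{2−k}` (`|ρ|, |1−ρ| > 14`, Ford's Lemma 3.3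
  `tsum_zeroOrder_div_norm_sq_le`), which is `< 3^{−k}` for every `k ≥ 2` (`norm_zetaZeroPowerSum_le`).
* `Coffey2008_eq410_holds` — [Coffey2008] eq. (4.10) p.718: `Σ_{i≥0} C(i+j, j) σ_{i+j+1} =
  (−1)^{j+1} σ_{j+1}` for every `j ≥ 0`.  Printed route (functional equation `ξ'/ξ(s) = −ξ'/ξ(1−s)`
  differentiated `j` times at `s = 1` against the expansion (4.9)), realised as: the Taylor series at `1`
  of the holomorphic `(ξ'/ξ)^{(j)}` on `|s−1| < 2` (no zeros of `ξ` there) converges at `s = 0`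
  (`Complex.hasSum_taylorSeries_on_ball`) to `(ξ'/ξ)^{(j)}(0) = −(−1)^j (ξ'/ξ)^{(j)}(1)`
  (`logDeriv_riemannXi_one_sub`), with `σ_{m+1} = (−1)^m (ξ'/ξ)^{(m)}(1)/m!` from (3.4).
* `Coffey2008_prop41_holds` — [Coffey2008] Prop. 4.1 p.718–719 (the summatory relation for the
  `η_j`, corrected form as typed): real part of (4.10), (3.6) on both sides, minus the odd-zeta sum
  (4.13)–(4.14) `Σ_i C(i+j,j)[1 − (1−2^{−(i+j+1)})ζ(i+j+1)] = −2^{−(j+1)}ζ(j+1)`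
  (`hasSum_choose_mul_oddTail`: interchange of two non-negative series and
  `Σ_i C(i+j,j) x^i = (1−x)^{−(j+1)}`), and the `k = j` term moved across.
* `Voros2006_eqLZS_holds`, `Voros2006_eqZinv_holds` — [Voros2006] §2 eq. (LZS) p.3 and its printed
  inverse: `λ_n = −n Σ_{j=1}^n ((−1)^j/j) C(n+j−1,2j−1) Z(j)` and `Z(j) = Σ_{n=1}^j (−1)^{n+1} C(2j,j−n) λ_n`.
  Printed route («generalized binomial formula» on `log[1 + z/((1−z)² x_k)]`, per pair
  `2 − 2T_n(1 − 1/(2x_k))`); realised on the tree's box-limit zero sum for `λ_n`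
  (`keiperLiCoeff_eq_zero_sum_holds`) written over the Hadamard pairs `{ρ, 1−ρ}`
  (`IsHadamardSeq.finsum_liZeroBox_eq_sum`), with the dilated Chebyshev identity
  `A^n + A^{−n} = Σ_j (−1)^j [C(n+j,2j)+C(n+j−1,2j)] (2−A−A^{−1})^j` (`pow_add_inv_pow_eq_chebSum`,
  two-step induction) and its inverse `(2−A−A^{−1})^j = C(2j,j) + Σ_n (−1)^n C(2j,j−n)(A^n + A^{−n})`
  (`chebArg_pow_eq_sum`, binomial theorem), at `A = 1 − 1/ρ`, `A^{−1} = 1 − 1/(1−ρ)`,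
  `2 − A − A^{−1} = 1/(ρ(1−ρ))`; the box sums of `m(ρ)(ρ(1−ρ))^{−j}` converge to `2Z(j)`
  (`tendsto_finsum_liZeroBox_inv_pow`).
* `Coffey2008_eq31_holds` — [Coffey2008] eq. (3.1) with (3.2) p.714 (Stieltjes 1905, Briggs 1955): the
  Stieltjes constants `γ_k = lim_N (Σ_{m≤N} (log m)^k/m − (log N)^{k+1}/(k+1))` ARE the Laurent
  coefficients of `ζ` at `1`: `u_{n+1} = (−1)^n γ_n/n!` for the Taylor coefficients of `ζ₁ = (s−1)ζ`.
  Route: the Abelian comparison of `BombieriLagariasEtaIdentification.lean` (Abel kernel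
  `w_N(u) = (N+1)^{−u} − (N+2)^{−u}`, a regular summation method as `u → 0⁺`, squeezed against the Gamma
  integral `k!/u^{k+1}`) with the weights `Λ(m)` replaced by `1` (`stieltjesGamma_eq_re_iteratedDeriv`:
  `γ_k = (−1)^k Re ζ₀^{(k)}(1)`), the identity `ζ₀^{(k)}(s) = (−1)^k Σ (log n)^k n^{−s} − (−1)^k k!/(s−1)^{k+1}`
  on `Re s > 1` (`iteratedDeriv_riemannZeta₀_eq`, termwise differentiation of the Dirichlet series),
  `ζ₁^{(n+1)}(1) = (n+1) ζ₀^{(n)}(1)` and the reality of the `u_i`.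
* `Coffey2008_prop32_holds`, `Coffey2008_prop31_holds` — [Coffey2008] Props. 3.2 and 3.1 p.715: the
  `η_j` and `λ_n` in terms of the Stieltjes constants.  Power-series algebra over `ℂ⟦X⟧`: with
  `F = Σ u_i X^i`, `G = F − 1`, `Q = Σ q_m X^m`, the convolution `F·Q = F'`
  (`Xiao2020.sum_zetaOneTaylorCoeff_mul`) identifies `Q` with the derivative of the truncated
  logarithm `Σ_h ((−1)^{h+1}/h) G^h` (`coeff_logDeriv_eq`); coefficients of `G^h` are sums over
  compositions (`coeff_pow_eq_sum_antidiagonalTuple`, `sum_antidiagonalTuple_shift`); then (3.1).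
* `Voros2018_eqAID_holds` — [Voros2018] §2.1 eq. (AID) p.5: `Σ_{m=0}^n (−1)^m A_{nm} = 1/A_{n0}` and
  `2Σ_{m=1}^n (−1)^m m A_{nm} = (−1)^n + 1/A_{n0}`.  Printed route (partial fractions of `f_n` against
  `f_n ∼ 1/x²`) realised as the divided-difference identities of Lagrange interpolation
  (`Lagrange.coeff_eq_sum`) for `P_n(x) = Π_{m=1}^n (x+2m−1)` at the nodes `0, 2, …, 2n, 1`, the weights
  being the residues `(−1)^{n+m} A_{nm}` and `−(−1)^n/A_{n0}` (factorial identities `prod_odd_shift`,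
  `prod_erase_even_diff`, `prod_one_sub_even`).

## References

* [Voros2006] A. Voros, Math. Phys. Anal. Geom. 9 (2006) 53–63, §2 eq. (LZS) and third remark p.3,
  §3 eq. (DA) p.4, Theorem p.6 and the [BL] remark p.6.
* [BombieriLagarias1999] E. Bombieri, J. C. Lagarias, J. Number Theory 77 (1999) 274–287, Thm. 1 (c) ⇒ (a).
* [Coffey2008] M. W. Coffey, Proc. R. Soc. A 464 (2008) 711–731, eqs. (3.4)–(3.6) p.714, (4.9)–(4.15)
  p.718–719, Props. 4.1, 4.2.
* [Li1997] X.-J. Li, J. Number Theory 65 (1997), p. 326 (termwise differentiation of the Hadamard product).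
* [Voros2018] A. Voros, Exp. Math. 29 (2020) = arXiv:1703.02844v3, §1.2 footnote 1 and eq. (ASF).
* [Ford2002Millennium] K. Ford, Number Theory for the Millennium II (2002), Lemma 3.3 (via
  `FordZetaZeroRecipSqSum.lean`).
* [Coffey2010Eta] M. W. Coffey, Analysis 30 (2010) 383–409, eq. (5) (the Abelian route, via
  `BombieriLagariasEtaIdentification.lean`).
-/

noncomputable section

open Filter Topology Asymptotics Finset Complex
open scoped ComplexConjugate Nat

namespace Literature.NumberTheory.LFunctions

open BombieriLagarias

/-! ## Voros 2006, Theorem (asymptotic criterion), the `⇐` half -/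

/-- Numerics: `log 64 − 1 + γ − log(2π) ≥ 1`. [folklore] -/
private theorem one_le_log64_bracket :
    1 ≤ Real.log 64 - 1 + Real.eulerMascheroniConstant - Real.log (2 * Real.pi) := by
  -- `log 64 = 6 log 2 ≥ 6 · 0.6931 = 4.158`
  have h2 : (0.6931471803 : ℝ) < Real.log 2 := Real.log_two_gt_d9
  have h64 : Real.log 64 = 6 * Real.log 2 := by
    rw [show (64 : ℝ) = 2 ^ 6 by norm_num, Real.log_pow]; norm_num
  -- `γ > 1/2`
  have hγ : (1 : ℝ) / 2 < Real.eulerMascheroniConstant := Real.one_half_lt_eulerMascheroniConstant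
  -- `log(2π) < 2`: `2π < 6.3 < e²`
  have hπ : Real.log (2 * Real.pi) < 2 := by
    rw [Real.log_lt_iff_lt_exp (by positivity)]
    have he : (2.7182818283 : ℝ) < Real.exp 1 := Real.exp_one_gt_d9
    have he2 : Real.exp 2 = Real.exp 1 * Real.exp 1 := by rw [← Real.exp_add]; norm_num
    have hpi : Real.pi < 3.15 := Real.pi_lt_d2
    nlinarith [Real.exp_pos 1]
  rw [h64]
  linarith

/-- Multiplicity of a non-trivial zero as a natural number. [folklore] -/
private theorem toNat_cast_eq' (ρ : ZetaZeros.riemannZetaNontrivialZeros) :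
    (((riemannZetaZeroOrder (ρ : ℂ)).toNat : ℕ) : ℝ) = (riemannZetaZeroOrder (ρ : ℂ) : ℝ) := by
  have h := ZetaZeros.riemannZetaNontrivialZeros.one_le_order ρ.2
  have : ((riemannZetaZeroOrder (ρ : ℂ)).toNat : ℤ) = riemannZetaZeroOrder (ρ : ℂ) :=
    Int.toNat_of_nonneg (by omega)
  exact_mod_cast this

/-- Non-trivial zeros are `≠ 0`. [folklore] -/
private theorem coe_ne_zero' (ρ : ZetaZeros.riemannZetaNontrivialZeros) : (ρ : ℂ) ≠ 0 := by
  intro h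
  have := ZetaZeros.riemannZetaNontrivialZeros.re_pos ρ.2
  rw [h] at this
  simp at this

/-- `Re ρ ≥ ½` for all non-trivial zeros implies RH (symmetry `ρ ↦ 1 − ρ̄`). [folklore] -/
private theorem riemannHypothesis_of_forall_half_le_re'
    (h : ∀ ρ ∈ ZetaZeros.riemannZetaNontrivialZeros, 1 / 2 ≤ ρ.re) : RiemannHypothesis := by
  intro s hs htriv h1
  have hmem : s ∈ ZetaZeros.riemannZetaNontrivialZeros := by
    refine ⟨hs, ?_⟩
    rintro ⟨k, hk⟩
    exact htriv ⟨k, hk.symm⟩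
  have hge := h s hmem
  have hle := h (1 - conj s) (ZetaZeros.riemannZetaNontrivialZeros.one_sub_conj_mem hmem)
  simp only [sub_re, one_re, conj_re] at hle
  linarith

/-- **Bombieri–Lagarias, Thm. 1 (c) ⇒ (a), for `ζ`**: if Li's coefficients are bounded below,
`−K ≤ λ_n` for all `n ≥ 1`, then RH.  RH-FREE (an implication). [cite: BombieriLagarias1999, Theorem 1] -/
theorem riemannHypothesis_of_keiperLiCoeff_bddBelow {K : ℝ}
    (hK : ∀ n : ℕ, 1 ≤ n → -K ≤ keiperLiCoeff n) : RiemannHypothesis := by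
  have hBL := bombieriLagarias1999_theorem1_pos_of_bddBelow
    (fun ρ : ZetaZeros.riemannZetaNontrivialZeros ↦ (ρ : ℂ))
    (fun ρ ↦ (riemannZetaZeroOrder (ρ : ℂ)).toNat)
    (fun ρ ↦ by have := ZetaZeros.riemannZetaNontrivialZeros.one_le_order ρ.2; omega)
    (fun ρ ↦ coe_ne_zero' ρ) (fun ρ ↦ ZetaZeros.riemannZetaNontrivialZeros.ne_one ρ.2)
    summable_weight_zetaZeros (K := K) ?_
  · exact riemannHypothesis_of_forall_half_le_re' fun ρ hρ ↦ hBL ⟨ρ, hρ⟩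
  · intro n hn
    have h := hK n hn
    rw [keiperLiCoeff_eq_tsum_zeros hn] at h
    rwa [tsum_congr fun ρ ↦ by rw [toNat_cast_eq']]

/-- **Discharge of `Voros2006_thm_if`** ([Voros2006] §3 Theorem p.6, `⇐` of the `[RH true]` line):
`λ_n = ½ n (log n − 1 + γ − log 2π) + o(n)` implies RH.  Proof as indicated in print («implied by [BL]»):
for `n ≥ 64` the main term is `≥ n/2` (`log 64 − 1 + γ − log 2π ≥ 1`), so with the `o(n)` bound at
`ε = 1/4` eventually `λ_n ≥ n/4 ≥ 0`; the finitely many earlier `λ_n` are bounded below trivially; then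
`riemannHypothesis_of_keiperLiCoeff_bddBelow`. [cite: Voros2006, §3 Theorem p.6] -/
theorem Voros2006_thm_if_holds : Voros2006_thm_if := by
  intro h
  -- eventually `λ_n ≥ 0`
  have hev : ∀ᶠ n : ℕ in atTop, 0 ≤ keiperLiCoeff n := by
    have h1 := h.def (show (0 : ℝ) < 1 / 4 by norm_num)
    filter_upwards [h1, eventually_ge_atTop 64] with n hn hn64
    have hn0 : (64 : ℝ) ≤ n := by exact_mod_cast hn64
    have hlog : Real.log 64 ≤ Real.log n := Real.log_le_log (by norm_num) hn0
    have hbr : 1 ≤ Real.log n - 1 + Real.eulerMascheroniConstant - Real.log (2 * Real.pi) := by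
      linarith [one_le_log64_bracket]
    have hmain : (n : ℝ) / 2 ≤
        (n : ℝ) / 2 * (Real.log n - 1 + Real.eulerMascheroniConstant - Real.log (2 * Real.pi)) := by
      have : (0 : ℝ) ≤ (n : ℝ) / 2 := by positivity
      nlinarith
    rw [Real.norm_eq_abs, Real.norm_eq_abs, Nat.abs_cast] at hn
    have := (abs_le.1 hn).1
    linarith
  -- hence bounded below for all `n ≥ 1`
  obtain ⟨N, hN⟩ := eventually_atTop.1 hev
  set K : ℝ := ∑ m ∈ Finset.range N, |keiperLiCoeff m| with hKdef
  have hK0 : 0 ≤ K := Finset.sum_nonneg fun m _ ↦ abs_nonneg _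
  refine riemannHypothesis_of_keiperLiCoeff_bddBelow (K := K) fun n _ ↦ ?_
  by_cases hn : N ≤ n
  · linarith [hN n hn]
  · have hmem : n ∈ Finset.range N := Finset.mem_range.2 (by omega)
    have hle : |keiperLiCoeff n| ≤ K :=
      Finset.single_le_sum (f := fun m ↦ |keiperLiCoeff m|) (fun m _ ↦ abs_nonneg _) hmem
    linarith [neg_abs_le (keiperLiCoeff n)]

/-- RH-EQUIVALENT (l.1) with the `⇐` half now PROVED: modulo the RH-CONSEQUENCE fact
`Voros2006_thm_onlyif` (Oesterlé–Voros), `RH ⇔ λ_n = ½ n (log n − 1 + γ − log 2π) + o(n)`.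
[cite: Voros2006, §3 Theorem, eq. (RER) p.6] -/
theorem Voros2006_thm_iff' (h : Voros2006_thm_onlyif) :
    RiemannHypothesis ↔
      (fun n : ℕ ↦ keiperLiCoeff n -
          (n : ℝ) / 2 * (Real.log n - 1 + Real.eulerMascheroniConstant - Real.log (2 * Real.pi)))
        =o[atTop] (fun n : ℕ ↦ (n : ℝ)) :=
  Voros2006_thm_iff h Voros2006_thm_if_holds

/-! ## Coffey 2008, eq. (3.4): the power sums over the zeros from the Hadamard product -/

/-- `liZeroBox T = weilZeroIndex T`. [folklore] -/
private theorem liZeroBox_eq_weilZeroIndex' (T : ℝ) : liZeroBox T = weilZeroIndex T := by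
  ext ρ
  simp only [liZeroBox, weilZeroIndex, Set.mem_setOf_eq, abs_pos]

/-- RH-FREE, PROVED — the BOX-LIMIT form of [Coffey2008] (3.4): for `k ≥ 1`,
`Σ_{ρ ∈ liZeroBox T} m(ρ) (ρ^{−k} + (1−ρ)^{−k}) → 2 (−1)^{k+1} k a_k` (`T → ∞`), `a_k = (log ξ)^{(k)}(1)/k!`.
Proof (Li 1997 p.326 / the tree's `keiperLiCoeff_eq_zero_sum_holds` pattern): the partial-fraction
series `ξ'/ξ(s) = Σₙ [1/(s−ρₙ) + 1/(s−(1−ρₙ))]` over the Hadamard pairs may be differentiated termwise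
at `s = 1` (`IsHadamardSeq.hasSum_iteratedDeriv_term_one`, `iteratedDeriv_term_one`), its truncations
are the box sums with multiplicity (`finsum_liZeroBox_eq_sum`, `tendsto_sum_truncation`), and
`(log ξ)^{(k)}(1) = (ξ'/ξ)^{(k−1)}(1)`. [cite: Coffey2008, eq. (3.4) p.714] -/
theorem tendsto_finsum_liZeroBox_powerSum {k : ℕ} (hk : 1 ≤ k) :
    Tendsto (fun T : ℝ ↦ ∑ᶠ ρ ∈ liZeroBox T,
        (riemannZetaZeroOrder ρ : ℂ) * (((ρ : ℂ)⁻¹) ^ k + ((1 - ρ)⁻¹) ^ k))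
      atTop (𝓝 (2 * ((-1) ^ (k + 1) * (k : ℂ) * Xiao2020.logXiTaylorCoeff k))) := by
  classical
  obtain ⟨b, hb⟩ := exists_isHadamardSeq 0
  obtain ⟨j, rfl⟩ : ∃ j, k = j + 1 := ⟨k - 1, by omega⟩
  set F : ℂ → ℂ := fun ρ ↦ (ρ⁻¹) ^ (j + 1) + ((1 - ρ)⁻¹) ^ (j + 1) with hF
  set c : ℂ := 2 * ((-1) ^ j / (j ! : ℂ)) with hc
  set D : ℂ := c * iteratedDeriv j (logDeriv riemannXi) 1 with hD
  set G : ℕ → ℂ := fun n ↦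
    if b n = 0 then 0 else F (IsHadamardSeq.xiZero b n) + F (1 - IsHadamardSeq.xiZero b n) with hG
  have hj0 : (j ! : ℂ) ≠ 0 := by exact_mod_cast (Nat.factorial_pos j).ne'
  have e2 : ((-1 : ℂ) ^ j) * (-1) ^ j = 1 := by
    rw [← pow_add, ← two_mul, pow_mul]; norm_num
  -- the termwise-differentiated Hadamard series, rescaled by `c`
  have hGD : HasSum G D := by
    have h1 := (hb.hasSum_iteratedDeriv_term_one j).mul_left c
    refine h1.congr_fun fun n ↦ ?_
    by_cases hn : b n = 0
    · simp [hG, hn]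
    · simp only [hG, hn, if_false, hb.iteratedDeriv_term_one hn j, hF, sub_sub_cancel, hc]
      have e3 : 2 * ((-1) ^ j / (j ! : ℂ)) * ((-1) ^ j * (j ! : ℂ) *
          (((1 - IsHadamardSeq.xiZero b n)⁻¹) ^ (j + 1) + ((IsHadamardSeq.xiZero b n)⁻¹) ^ (j + 1))) =
          2 * (((1 - IsHadamardSeq.xiZero b n)⁻¹) ^ (j + 1) + ((IsHadamardSeq.xiZero b n)⁻¹) ^ (j + 1)) *
            ((((-1 : ℂ) ^ j) * (-1) ^ j) * ((j ! : ℂ) / (j ! : ℂ))) := by ring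
      rw [e3, e2, div_self hj0]
      ring
  set K : ℝ → Finset ℕ := fun T ↦ (hb.finite_setOf_abs_im_xiZero_le T).toFinset with hKdef
  have hK : ∀ T n, n ∈ K T ↔ b n ≠ 0 ∧ |(IsHadamardSeq.xiZero b n).im| ≤ T := fun T n ↦ by
    simp [hKdef, Set.Finite.mem_toFinset]
  have hlim : Tendsto (fun T ↦ ∑ n ∈ K T, G n) atTop (𝓝 D) :=
    IsHadamardSeq.tendsto_sum_truncation hGD (fun n hn ↦ by simp [hG, hn]) K hK
  have heq : ∀ T, ∑ᶠ ρ ∈ liZeroBox T, (riemannZetaZeroOrder ρ : ℂ) * F ρ = ∑ n ∈ K T, G n := by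
    intro T
    rw [hb.finsum_liZeroBox_eq_sum F T (K T) (hK T)]
    refine Finset.sum_congr rfl fun n hn ↦ ?_
    simp [hG, ((hK T n).1 hn).1]
  have hlim' : Tendsto (fun T ↦ ∑ᶠ ρ ∈ liZeroBox T, (riemannZetaZeroOrder ρ : ℂ) * F ρ)
      atTop (𝓝 D) := by
    simpa only [heq] using hlim
  -- `D = 2 (−1)^{j+2} (j+1) a_{j+1}`
  have hDval : D = 2 * ((-1) ^ (j + 1 + 1) * ((j + 1 : ℕ) : ℂ) * Xiao2020.logXiTaylorCoeff (j + 1)) := by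
    have ha : Xiao2020.logXiTaylorCoeff (j + 1) =
        iteratedDeriv j (logDeriv riemannXi) 1 / ((j + 1) ! : ℂ) := by
      rw [Xiao2020.logXiTaylorCoeff, iteratedDeriv_succ_log_riemannXi_one]
    have hj1 : ((j + 1) ! : ℂ) ≠ 0 := by exact_mod_cast (Nat.factorial_pos _).ne'
    rw [hD, hc, ha, pow_succ, pow_succ, Nat.factorial_succ]
    push_cast
    field_simp
  rw [← hDval]
  exact hlim'

/-- Summability of `m(ρ)/|ρ|^k` over the non-trivial zeros for `k ≥ 2` (from the tree's
`Σ m/|ρ|² < ∞` and `|ρ| > 14`). [folklore] -/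
private theorem summable_order_div_norm_pow {k : ℕ} (hk : 2 ≤ k) :
    Summable fun ρ : RHWave0.riemannZetaNontrivialZeros ↦
      (riemannZetaZeroOrder (ρ : ℂ) : ℝ) / ‖(ρ : ℂ)‖ ^ k := by
  have hS := FordL33.summable_order_div_norm_sq
  refine hS.of_nonneg_of_le (fun ρ ↦ div_nonneg (FordL33.order_pos ρ).le (pow_nonneg (norm_nonneg _) _))
    fun ρ ↦ ?_
  have h14 := FordL33.fourteen_lt_norm ρ
  have h1 : (1 : ℝ) ≤ ‖(ρ : ℂ)‖ := by linarith
  exact div_le_div_of_nonneg_left (FordL33.order_pos ρ).le (by positivity)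
    (pow_le_pow_right₀ h1 hk)

/-- Summability of `m(ρ)/|1 − ρ|^k` for `k ≥ 2` (`|1 − ρ| ≥ |ρ| − 1 ≥ |ρ|/2` as `|ρ| > 14`).
[folklore] -/
private theorem summable_order_div_norm_one_sub_pow {k : ℕ} (hk : 2 ≤ k) :
    Summable fun ρ : RHWave0.riemannZetaNontrivialZeros ↦
      (riemannZetaZeroOrder (ρ : ℂ) : ℝ) / ‖1 - (ρ : ℂ)‖ ^ k := by
  have hS := FordL33.summable_order_div_norm_sq.mul_left 4
  refine hS.of_nonneg_of_le (fun ρ ↦ div_nonneg (FordL33.order_pos ρ).le (pow_nonneg (norm_nonneg _) _))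
    fun ρ ↦ ?_
  have h14 := FordL33.fourteen_lt_norm ρ
  have hm := FordL33.order_pos ρ
  have hsub : ‖(ρ : ℂ)‖ / 2 ≤ ‖1 - (ρ : ℂ)‖ := by
    have := norm_sub_norm_le (ρ : ℂ) 1
    have e : ‖(ρ : ℂ) - 1‖ = ‖1 - (ρ : ℂ)‖ := norm_sub_rev _ _
    rw [norm_one, e] at this
    linarith
  have h1 : (1 : ℝ) ≤ ‖1 - (ρ : ℂ)‖ := by linarith
  have hpos : 0 < ‖1 - (ρ : ℂ)‖ := by linarith
  calc (riemannZetaZeroOrder (ρ : ℂ) : ℝ) / ‖1 - (ρ : ℂ)‖ ^ k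
      ≤ (riemannZetaZeroOrder (ρ : ℂ) : ℝ) / ‖1 - (ρ : ℂ)‖ ^ 2 :=
        div_le_div_of_nonneg_left hm.le (by positivity) (pow_le_pow_right₀ h1 hk)
    _ ≤ (riemannZetaZeroOrder (ρ : ℂ) : ℝ) / ((‖(ρ : ℂ)‖ / 2) ^ 2) :=
        div_le_div_of_nonneg_left hm.le (by positivity) (by gcongr)
    _ = 4 * ((riemannZetaZeroOrder (ρ : ℂ) : ℝ) / ‖(ρ : ℂ)‖ ^ 2) := by
        field_simp
        ring

/-- Absolute summability of `m(ρ)(ρ^{−k} + (1−ρ)^{−k})` over the zeros for `k ≥ 1` (`k = 1`: the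
summand is `m(ρ)/(ρ(1−ρ))`, the tree's `summable_norm_zeroOrder_mul_recipWeight`): the power sums
`σ_k = Σ_ρ ρ^{−k}` «over all the complex zeros» converge absolutely in the symmetric grouping.
[cite: Coffey2008, eq. (3.3) p.714] -/
theorem summable_zetaZeroPowerSum_term {k : ℕ} (hk : 1 ≤ k) :
    Summable fun ρ : RHWave0.riemannZetaNontrivialZeros ↦
      (riemannZetaZeroOrder (ρ : ℂ) : ℂ) * ((((ρ : ℂ))⁻¹) ^ k + ((1 - (ρ : ℂ))⁻¹) ^ k) := by
  rcases Nat.lt_or_ge k 2 with hk1 | hk2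
  · have hk' : k = 1 := by omega
    subst hk'
    have hS := ZetaZeroSum.summable_norm_zeroOrder_mul_recipWeight
    refine Summable.of_norm (hS.congr fun ρ ↦ ?_)
    have h0 : (ρ : ℂ) ≠ 0 := FordL33.coe_ne_zero ρ
    have h1 : (1 : ℂ) - ρ ≠ 0 := FordL33.one_sub_coe_ne_zero ρ
    have h1' : (ρ : ℂ) - 1 ≠ 0 := fun e ↦ h1 (by linear_combination -e)
    have e : (riemannZetaZeroOrder (ρ : ℂ) : ℂ) * ((((ρ : ℂ))⁻¹) ^ 1 + ((1 - (ρ : ℂ))⁻¹) ^ 1) =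
        -((riemannZetaZeroOrder (ρ : ℂ) : ℂ) * ZetaZeroSum.recipWeight ρ) := by
      rw [ZetaZeroSum.recipWeight, pow_one, pow_one]
      field_simp
      ring
    rw [e, norm_neg]
  · refine Summable.of_norm_bounded (g := fun ρ : RHWave0.riemannZetaNontrivialZeros ↦
        (riemannZetaZeroOrder (ρ : ℂ) : ℝ) / ‖(ρ : ℂ)‖ ^ k +
          (riemannZetaZeroOrder (ρ : ℂ) : ℝ) / ‖1 - (ρ : ℂ)‖ ^ k)
      ((summable_order_div_norm_pow hk2).add (summable_order_div_norm_one_sub_pow hk2)) fun ρ ↦ ?_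
    have hm := FordL33.order_pos ρ
    rw [norm_mul, Complex.norm_intCast, abs_of_pos hm]
    calc (riemannZetaZeroOrder (ρ : ℂ) : ℝ) * ‖(((ρ : ℂ))⁻¹) ^ k + ((1 - (ρ : ℂ))⁻¹) ^ k‖
        ≤ (riemannZetaZeroOrder (ρ : ℂ) : ℝ) * (‖(((ρ : ℂ))⁻¹) ^ k‖ + ‖((1 - (ρ : ℂ))⁻¹) ^ k‖) :=
          mul_le_mul_of_nonneg_left (norm_add_le _ _) hm.le
      _ = _ := by rw [norm_pow, norm_pow, norm_inv, norm_inv, inv_pow, inv_pow]; ring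

/-- **Discharge of `Coffey2008_eq34`** ([Coffey2008] eq. (3.4) p.714: `log ξ(s) = −log 2 −
Σ_k (−1)^k (σ_k/k)(s−1)^k`, i.e. `σ_k = (−1)^{k+1} k a_k`): the symmetric zero power sums are the
Taylor coefficients of `log ξ` at `1`, from the Hadamard product.  With it, (3.5) and (3.6)
(`keiperLiCoeff_eq_sum_zetaZeroPowerSum`, `re_zetaZeroPowerSum_eq`) hold unconditionally.
[cite: Coffey2008, eq. (3.4) p.714] -/
theorem Coffey2008_eq34_holds : Coffey2008_eq34 := by
  intro k hk
  have hlim := tendsto_finsum_liZeroBox_powerSum hk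
  set f : ZetaZeros.riemannZetaNontrivialZeros → ℂ := fun ρ ↦
    (riemannZetaZeroOrder (ρ : ℂ) : ℂ) * ((((ρ : ℂ))⁻¹) ^ k + ((1 - (ρ : ℂ))⁻¹) ^ k) with hf
  have hs : Summable f := summable_zetaZeroPowerSum_term hk
  have h2 : Tendsto (fun T ↦ ∑ ρ ∈ weilZeroFinset T, f ρ) atTop (𝓝 (∑' ρ, f ρ)) :=
    hs.hasSum.comp tendsto_weilZeroFinset
  have h3 : ∀ T, ∑ᶠ ρ ∈ liZeroBox T,
      (riemannZetaZeroOrder ρ : ℂ) * (((ρ : ℂ)⁻¹) ^ k + ((1 - ρ)⁻¹) ^ k) =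
        ∑ ρ ∈ weilZeroFinset T, f ρ := by
    intro T
    rw [liZeroBox_eq_weilZeroIndex',
      ZetaZeroSum.finsum_mem_weilZeroIndex_eq_sum
        (fun ρ : ℂ ↦ (riemannZetaZeroOrder ρ : ℂ) * (((ρ : ℂ)⁻¹) ^ k + ((1 - ρ)⁻¹) ^ k)) T]
  have h4 := tendsto_nhds_unique (hlim.congr h3) h2
  show 1 / 2 * ∑' ρ, f ρ = _
  rw [← h4]
  ring

/-- RH-FREE, PROVED unconditionally — **[Coffey2008] eq. (3.5)** = Keiper's formula:
`λ_n = −Σ_{j=1}^n (−1)^j C(n,j) σ_j`. [cite: Coffey2008, eq. (3.5) p.714] -/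
theorem keiperLiCoeff_eq_sum_zetaZeroPowerSum' {n : ℕ} (hn : 1 ≤ n) :
    keiperLiCoeff n =
      -∑ j ∈ Finset.Icc 1 n, (-1 : ℝ) ^ j * (n.choose j : ℝ) * (zetaZeroPowerSum j).re :=
  keiperLiCoeff_eq_sum_zetaZeroPowerSum Coffey2008_eq34_holds hn

/-- RH-FREE, PROVED unconditionally — **[Coffey2008] eq. (3.6)**: for `k ≥ 2`,
`σ_k = (−1)^k η_{k−1} − (1 − 2^{−k}) ζ(k) + 1`. [cite: Coffey2008, eq. (3.6) p.714] -/
theorem re_zetaZeroPowerSum_eq' {k : ℕ} (hk : 2 ≤ k) :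
    (zetaZeroPowerSum k).re =
      (-1) ^ k * liEta (k - 1) - (1 - ((2 : ℝ) ^ k)⁻¹) * (riemannZeta k).re + 1 :=
  re_zetaZeroPowerSum_eq Coffey2008_eq34_holds hk

/-! ## Voros 2006 (DA): Darboux's asymptotic, by the zero-sum route -/

section Darboux

/-- `(1 − 1/ρ)⁻¹ = 1 + (ρ − 1)⁻¹` for `ρ ≠ 0, 1`. [folklore] -/
private theorem inv_one_sub_inv_eq_one_add' {ρ : ℂ} (h0 : ρ ≠ 0) (h1 : ρ ≠ 1) :
    (1 - 1 / ρ)⁻¹ = 1 + (ρ - 1)⁻¹ := by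
  have h1' : ρ - 1 ≠ 0 := sub_ne_zero.2 h1
  field_simp
  ring

/-- Binomial remainder: `‖(1+u)ⁿ − 1 − n u‖ ≤ (n²/2) ‖u‖² (1+‖u‖)ⁿ`. [folklore] -/
private theorem norm_one_add_pow_sub_le' (u : ℂ) (n : ℕ) :
    ‖(1 + u) ^ n - 1 - n * u‖ ≤ (n : ℝ) ^ 2 / 2 * ‖u‖ ^ 2 * (1 + ‖u‖) ^ n := by
  induction n with
  | zero => simp
  | succ k ih =>
    have e : (1 + u) ^ (k + 1) - 1 - ((k + 1 : ℕ) : ℂ) * u =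
        (1 + u) * ((1 + u) ^ k - 1 - (k : ℂ) * u) + (k : ℂ) * u ^ 2 := by
      push_cast; ring
    rw [e]
    have h1 : ‖(1 + u) * ((1 + u) ^ k - 1 - (k : ℂ) * u)‖ ≤
        (1 + ‖u‖) * ((k : ℝ) ^ 2 / 2 * ‖u‖ ^ 2 * (1 + ‖u‖) ^ k) := by
      rw [norm_mul]
      gcongr
      calc ‖1 + u‖ ≤ ‖(1 : ℂ)‖ + ‖u‖ := norm_add_le _ _
        _ = 1 + ‖u‖ := by rw [norm_one]
    have h2 : ‖(k : ℂ) * u ^ 2‖ = (k : ℝ) * ‖u‖ ^ 2 := by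
      rw [norm_mul, norm_pow, Complex.norm_natCast]
    have h3 : (k : ℝ) * ‖u‖ ^ 2 ≤ (k : ℝ) * ‖u‖ ^ 2 * (1 + ‖u‖) ^ (k + 1) := by
      have : (1 : ℝ) ≤ (1 + ‖u‖) ^ (k + 1) := one_le_pow₀ (by linarith [norm_nonneg u])
      have h0 : 0 ≤ (k : ℝ) * ‖u‖ ^ 2 := by positivity
      nlinarith
    calc ‖(1 + u) * ((1 + u) ^ k - 1 - (k : ℂ) * u) + (k : ℂ) * u ^ 2‖
        ≤ ‖(1 + u) * ((1 + u) ^ k - 1 - (k : ℂ) * u)‖ + ‖(k : ℂ) * u ^ 2‖ := norm_add_le _ _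
      _ ≤ (1 + ‖u‖) * ((k : ℝ) ^ 2 / 2 * ‖u‖ ^ 2 * (1 + ‖u‖) ^ k) +
            (k : ℝ) * ‖u‖ ^ 2 * (1 + ‖u‖) ^ (k + 1) := by rw [h2] at *; linarith
      _ = ((k : ℝ) ^ 2 / 2 + k) * ‖u‖ ^ 2 * (1 + ‖u‖) ^ (k + 1) := by ring
      _ ≤ (((k + 1 : ℕ) : ℝ)) ^ 2 / 2 * ‖u‖ ^ 2 * (1 + ‖u‖) ^ (k + 1) := by
          have hpos : 0 ≤ ‖u‖ ^ 2 * (1 + ‖u‖) ^ (k + 1) := by positivity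
          have : (k : ℝ) ^ 2 / 2 + k ≤ (((k + 1 : ℕ) : ℝ)) ^ 2 / 2 := by push_cast; nlinarith
          nlinarith

/-- For `n‖u‖ ≤ 1`: `‖(1+u)ⁿ − 1 − n u‖ ≤ 2 n² ‖u‖²` (`(1+‖u‖)ⁿ ≤ e^{n‖u‖} ≤ e < 3`). [folklore] -/
private theorem norm_one_add_pow_sub_le_of_mul_le {u : ℂ} {n : ℕ} (h : (n : ℝ) * ‖u‖ ≤ 1) :
    ‖(1 + u) ^ n - 1 - n * u‖ ≤ 2 * (n : ℝ) ^ 2 * ‖u‖ ^ 2 := by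
  have h1 := norm_one_add_pow_sub_le' u n
  have hexp : (1 + ‖u‖) ^ n ≤ 3 := by
    have h2 : (1 + ‖u‖) ≤ Real.exp ‖u‖ := by
      have := Real.add_one_le_exp ‖u‖; linarith
    have h3 : (1 + ‖u‖) ^ n ≤ Real.exp ‖u‖ ^ n :=
      pow_le_pow_left₀ (by positivity) h2 n
    have h4 : Real.exp ‖u‖ ^ n = Real.exp (n * ‖u‖) := by rw [← Real.exp_nat_mul]
    have h5 : Real.exp (n * ‖u‖) ≤ Real.exp 1 := Real.exp_le_exp.2 h
    have h6 : Real.exp 1 < 3 := by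
      have := Real.exp_one_lt_d9; linarith
    linarith [h4 ▸ h3]
  have hpos : 0 ≤ (n : ℝ) ^ 2 / 2 * ‖u‖ ^ 2 := by positivity
  nlinarith

/-- **Tail bound** (cf. Bombieri–Lagarias): for a non-trivial zero `ρ` and `1 ≤ n ≤ |ρ − 1|`,
`|Re[1 − (1 − 1/ρ)^{−n}]| ≤ 6 n²/(1 + (Im ρ)²)`. [folklore] -/
private theorem abs_re_one_sub_pow_le_tail (ρ : RHWave0.riemannZetaNontrivialZeros) {n : ℕ}
    (hn : 1 ≤ n) (hρ : (n : ℝ) ≤ ‖(ρ : ℂ) - 1‖) :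
    |(1 - ((1 - 1 / (ρ : ℂ))⁻¹) ^ n).re| ≤
      6 * (n : ℝ) ^ 2 / (1 + ((ρ : ℂ).im) ^ 2) := by
  have h0 : (ρ : ℂ) ≠ 0 := FordL33.coe_ne_zero ρ
  have h1 : (ρ : ℂ) ≠ 1 := ZetaZeros.riemannZetaNontrivialZeros.ne_one ρ.2
  have h1' : (ρ : ℂ) - 1 ≠ 0 := sub_ne_zero.2 h1
  have hre0 := ZetaZeros.riemannZetaNontrivialZeros.re_pos ρ.2
  have hre1 := ZetaZeros.riemannZetaNontrivialZeros.re_lt_one ρ.2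
  have him : 14 < |(ρ : ℂ).im| := FordL33.fourteen_lt_abs_im ρ
  set u : ℂ := ((ρ : ℂ) - 1)⁻¹ with hu
  have hw : (1 - 1 / (ρ : ℂ))⁻¹ = 1 + u := inv_one_sub_inv_eq_one_add' h0 h1
  have hn1 : (1 : ℝ) ≤ n := by exact_mod_cast hn
  have hρ1 : 1 ≤ ‖(ρ : ℂ) - 1‖ := hn1.trans hρ
  have hpos : 0 < ‖(ρ : ℂ) - 1‖ := by linarith
  have hnu : ‖u‖ = ‖(ρ : ℂ) - 1‖⁻¹ := by rw [hu, norm_inv]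
  have hua : (n : ℝ) * ‖u‖ ≤ 1 := by
    rw [hnu, ← div_eq_mul_inv, div_le_one hpos]; exact hρ
  -- decomposition
  set E : ℂ := (1 + u) ^ n - 1 - n * u with hE
  have hdec : 1 - ((1 - 1 / (ρ : ℂ))⁻¹) ^ n = -(n * u) - E := by rw [hw, hE]; ring
  have hEn : ‖E‖ ≤ 2 * (n : ℝ) ^ 2 * ‖u‖ ^ 2 := norm_one_add_pow_sub_le_of_mul_le hua
  have hure : u.re = ((ρ : ℂ).re - 1) / ‖(ρ : ℂ) - 1‖ ^ 2 := by
    rw [hu, Complex.inv_re, Complex.normSq_eq_norm_sq]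
    simp
  -- `|Re u| ≤ 1/|ρ−1|²`, `‖u‖² = 1/|ρ−1|²`
  have hsq : ‖u‖ ^ 2 = 1 / ‖(ρ : ℂ) - 1‖ ^ 2 := by rw [hnu, inv_pow, one_div]
  have hure' : |u.re| ≤ 1 / ‖(ρ : ℂ) - 1‖ ^ 2 := by
    rw [hure, abs_div, abs_of_pos (by positivity : (0 : ℝ) < ‖(ρ : ℂ) - 1‖ ^ 2)]
    gcongr
    rw [abs_le]; constructor <;> linarith
  -- `1/|ρ−1|² ≤ 2/(1+Im²)` since `|ρ−1| ≥ |Im ρ| > 14`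
  have himle : |(ρ : ℂ).im| ≤ ‖(ρ : ℂ) - 1‖ := by
    have := Complex.abs_im_le_norm ((ρ : ℂ) - 1)
    simpa using this
  have hkey : 1 / ‖(ρ : ℂ) - 1‖ ^ 2 ≤ 2 / (1 + ((ρ : ℂ).im) ^ 2) := by
    rw [div_le_div_iff₀ (by positivity) (by positivity)]
    have h2 : ((ρ : ℂ).im) ^ 2 ≤ ‖(ρ : ℂ) - 1‖ ^ 2 := by
      have := pow_le_pow_left₀ (abs_nonneg _) himle 2
      rwa [sq_abs] at this
    have h3 : (196 : ℝ) < ((ρ : ℂ).im) ^ 2 := by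
      have := pow_lt_pow_left₀ him (by norm_num) (two_ne_zero)
      rw [sq_abs] at this; norm_num at this; linarith
    nlinarith
  rw [hdec]
  calc |(-(↑n * u) - E).re| = |-(n * u.re) - E.re| := by
        simp [Complex.sub_re, Complex.neg_re, Complex.mul_re]
    _ ≤ |n * u.re| + |E.re| := by
        have := abs_sub (-(↑n * u.re)) E.re; rwa [abs_neg] at this
    _ ≤ n * (1 / ‖(ρ : ℂ) - 1‖ ^ 2) + 2 * (n : ℝ) ^ 2 * (1 / ‖(ρ : ℂ) - 1‖ ^ 2) := by
        gcongr
        · rw [abs_mul, abs_of_nonneg (by positivity : (0 : ℝ) ≤ n)]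
          gcongr
        · exact (Complex.abs_re_le_norm E).trans (hsq ▸ hEn)
    _ ≤ 3 * (n : ℝ) ^ 2 * (1 / ‖(ρ : ℂ) - 1‖ ^ 2) := by
        have : (n : ℝ) ≤ (n : ℝ) ^ 2 := by nlinarith
        have h0' : 0 ≤ 1 / ‖(ρ : ℂ) - 1‖ ^ 2 := by positivity
        nlinarith
    _ ≤ 3 * (n : ℝ) ^ 2 * (2 / (1 + ((ρ : ℂ).im) ^ 2)) := by gcongr
    _ = 6 * (n : ℝ) ^ 2 / (1 + ((ρ : ℂ).im) ^ 2) := by ring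

/-- If `‖1 − 1/ρ‖ ≤ r < 1` then `|Im ρ| ≤ |ρ − 1| ≤ r/(1−r)`. [folklore] -/
private theorem norm_sub_one_le_of_normZ_le {ρ : ℂ} (h0 : ρ ≠ 0) {r : ℝ} (hr : r < 1)
    (h : ‖1 - 1 / ρ‖ ≤ r) : ‖ρ - 1‖ ≤ r / (1 - r) := by
  have hr0 : 0 ≤ r := (norm_nonneg _).trans h
  have e : 1 - 1 / ρ = (ρ - 1) / ρ := by field_simp
  rw [e, norm_div, div_le_iff₀ (norm_pos_iff.2 h0)] at h
  have h2 : ‖ρ‖ ≤ ‖ρ - 1‖ + 1 := by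
    calc ‖ρ‖ = ‖(ρ - 1) + 1‖ := by ring_nf
      _ ≤ ‖ρ - 1‖ + ‖(1 : ℂ)‖ := norm_add_le _ _
      _ = ‖ρ - 1‖ + 1 := by rw [norm_one]
  have h3 : ‖ρ - 1‖ * (1 - r) ≤ r := by nlinarith [norm_nonneg (ρ - 1)]
  rwa [le_div_iff₀ (by linarith)]

/-- The set `{ρ ∈ Z : ‖1 − 1/ρ‖ ≤ r}` is finite for `r < 1` (it lies in the box `|Im ρ| ≤ r/(1−r)`).
[folklore] -/
private theorem finite_normZ_le {r : ℝ} (hr : r < 1) :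
    {ρ : ℂ | ρ ∈ ZetaZeros.riemannZetaNontrivialZeros ∧ ‖1 - 1 / ρ‖ ≤ r}.Finite := by
  refine (liZeroBox_finite (r / (1 - r))).subset ?_
  rintro ρ ⟨hρ, hle⟩
  have h0 : ρ ≠ 0 := FordL33.coe_ne_zero ⟨ρ, hρ⟩
  refine ⟨ZetaZeros.riemannZetaNontrivialZeros.zeta_eq_zero hρ,
    (ZetaZeros.riemannZetaNontrivialZeros.re_pos hρ).le,
    (ZetaZeros.riemannZetaNontrivialZeros.re_lt_one hρ).le,
    abs_pos.2 (ZetaZeros.riemannZetaNontrivialZeros.im_ne_zero hρ), ?_⟩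
  calc |ρ.im| = |(ρ - 1).im| := by simp
    _ ≤ ‖ρ - 1‖ := Complex.abs_im_le_norm _
    _ ≤ r / (1 - r) := norm_sub_one_le_of_normZ_le h0 hr hle

/-- `finsum` over the set = `Finset` sum over the subtype. [folklore] -/
private theorem finsum_normZ_eq_sum {r : ℝ} (hr : r < 1)
    (S : Finset RHWave0.riemannZetaNontrivialZeros) (hS : ∀ ρ, ρ ∈ S ↔ ‖1 - 1 / (ρ : ℂ)‖ ≤ r)
    (a : ℂ → ℝ) :
    ∑ᶠ ρ ∈ {ρ : ℂ | ρ ∈ ZetaZeros.riemannZetaNontrivialZeros ∧ ‖1 - 1 / ρ‖ ≤ r}, a ρ =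
      ∑ ρ ∈ S, a ρ := by
  classical
  have e : ∑ ρ ∈ S, a ρ = ∑ z ∈ S.map (Function.Embedding.subtype _), a z := by
    rw [Finset.sum_map]
    rfl
  rw [e, finsum_mem_eq_finite_toFinset_sum _ (finite_normZ_le hr)]
  refine Finset.sum_congr ?_ fun _ _ ↦ rfl
  ext z
  simp only [Set.Finite.mem_toFinset, Finset.mem_map, Function.Embedding.subtype_apply,
    Set.mem_setOf_eq]
  constructor
  · rintro ⟨hz, hle⟩
    exact ⟨⟨z, hz⟩, (hS _).2 hle, rfl⟩
  · rintro ⟨ρ, hρ, rfl⟩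
    exact ⟨ρ.2, (hS ρ).1 hρ⟩

/-- `λ_n` in the `−n` form: `λ_n = Σ_ρ m(ρ) Re[1 − (1 − 1/ρ)^{−n}]` (reflection `ρ ↦ 1 − ρ̄`).
[cite: BombieriLagarias1999, Theorem 1 (the family form of Li's sum)] -/
theorem keiperLiCoeff_eq_tsum_zeros_inv {n : ℕ} (hn : 1 ≤ n) :
    keiperLiCoeff n = ∑' ρ : RHWave0.riemannZetaNontrivialZeros,
      (riemannZetaZeroOrder (ρ : ℂ) : ℝ) * (1 - ((1 - 1 / (ρ : ℂ))⁻¹) ^ n).re := by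
  have h := keiperLiCoeff_eq_tsum_zeros hn
  rw [h, ← FordL33.reflEquiv.tsum_eq (fun ρ : RHWave0.riemannZetaNontrivialZeros ↦
      (riemannZetaZeroOrder (ρ : ℂ) : ℝ) * (1 - ((1 - 1 / (ρ : ℂ))⁻¹) ^ n).re)]
  refine tsum_congr fun ρ ↦ ?_
  have hco : (FordL33.reflEquiv ρ : RHWave0.riemannZetaNontrivialZeros) = FordL33.refl ρ := rfl
  rw [hco, FordL33.order_refl]
  have h0 : (ρ : ℂ) ≠ 0 := FordL33.coe_ne_zero ρ
  have h1 : (ρ : ℂ) ≠ 1 := ZetaZeros.riemannZetaNontrivialZeros.ne_one ρ.2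
  have hval : ((FordL33.refl ρ : RHWave0.riemannZetaNontrivialZeros) : ℂ) = 1 - conj (ρ : ℂ) := rfl
  rw [hval, re_term_one_sub_conj h0 h1 n]

/-- Summability of the `−n` form (reflection of `summable_keiperLiTerm`). [folklore] -/
private theorem summable_keiperLiTerm_inv (n : ℕ) :
    Summable fun ρ : RHWave0.riemannZetaNontrivialZeros ↦
      (riemannZetaZeroOrder (ρ : ℂ) : ℝ) * (1 - ((1 - 1 / (ρ : ℂ))⁻¹) ^ n).re := by
  have hs : Summable fun ρ : RHWave0.riemannZetaNontrivialZeros ↦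
      (riemannZetaZeroOrder (ρ : ℂ) : ℝ) * (1 - (1 - 1 / (ρ : ℂ)) ^ n).re := summable_keiperLiTerm n
  refine (FordL33.reflEquiv.summable_iff (f := fun ρ : RHWave0.riemannZetaNontrivialZeros ↦
      (riemannZetaZeroOrder (ρ : ℂ) : ℝ) * (1 - ((1 - 1 / (ρ : ℂ))⁻¹) ^ n).re)).1 (hs.congr fun ρ ↦ ?_)
  have hco : (FordL33.reflEquiv ρ : RHWave0.riemannZetaNontrivialZeros) = FordL33.refl ρ := rfl
  simp only [Function.comp_apply]
  rw [hco, FordL33.order_refl]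
  have h0 : (ρ : ℂ) ≠ 0 := FordL33.coe_ne_zero ρ
  have h1 : (ρ : ℂ) ≠ 1 := ZetaZeros.riemannZetaNontrivialZeros.ne_one ρ.2
  have hval : ((FordL33.refl ρ : RHWave0.riemannZetaNontrivialZeros) : ℂ) = 1 - conj (ρ : ℂ) := rfl
  rw [hval, re_term_one_sub_conj h0 h1 n]

/-- Pointwise bound off the exceptional set: if `‖(1 − 1/ρ)^{−1}‖ ≤ r₂^{−1}` (`0 < r₂ < 1`) and
`n ≥ 1`, then `|m(ρ) Re[1 − (1−1/ρ)^{−n}]| ≤ n²(8 + 2 r₂^{−n}) · m(ρ)/(1+γ²)` (tail zeros by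
`abs_re_one_sub_pow_le_tail`, the others by `|ρ − 1| < n ⇒ 1 + γ² ≤ 2n²`). [folklore] -/
private theorem abs_term_le_of_norm_inv_le {r₂ : ℝ} (hr₂0 : 0 < r₂) (hr₂1 : r₂ < 1) {n : ℕ}
    (hn : 1 ≤ n) (ρ : RHWave0.riemannZetaNontrivialZeros)
    (hw : ‖(1 - 1 / (ρ : ℂ))⁻¹‖ ≤ r₂⁻¹) :
    |(riemannZetaZeroOrder (ρ : ℂ) : ℝ) * (1 - ((1 - 1 / (ρ : ℂ))⁻¹) ^ n).re| ≤
      (n : ℝ) ^ 2 * (8 + 2 * r₂⁻¹ ^ n) *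
        ((riemannZetaZeroOrder (ρ : ℂ) : ℝ) / (1 + ((ρ : ℂ).im) ^ 2)) := by
  have hm := FordL33.order_pos ρ
  have hn1 : (1 : ℝ) ≤ n := by exact_mod_cast hn
  have hrn : 1 ≤ r₂⁻¹ ^ n := one_le_pow₀ (one_le_inv_iff₀.2 ⟨hr₂0, hr₂1.le⟩)
  have hg0 : 0 ≤ (riemannZetaZeroOrder (ρ : ℂ) : ℝ) / (1 + ((ρ : ℂ).im) ^ 2) := by positivity
  rw [abs_mul, abs_of_pos hm]
  by_cases hcase : (n : ℝ) ≤ ‖(ρ : ℂ) - 1‖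
  · have ht := abs_re_one_sub_pow_le_tail ρ hn hcase
    calc (riemannZetaZeroOrder (ρ : ℂ) : ℝ) * |(1 - ((1 - 1 / (ρ : ℂ))⁻¹) ^ n).re|
        ≤ (riemannZetaZeroOrder (ρ : ℂ) : ℝ) * (6 * (n : ℝ) ^ 2 / (1 + ((ρ : ℂ).im) ^ 2)) :=
          mul_le_mul_of_nonneg_left ht hm.le
      _ = 6 * (n : ℝ) ^ 2 * ((riemannZetaZeroOrder (ρ : ℂ) : ℝ) / (1 + ((ρ : ℂ).im) ^ 2)) := by ring
      _ ≤ (n : ℝ) ^ 2 * (8 + 2 * r₂⁻¹ ^ n) *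
            ((riemannZetaZeroOrder (ρ : ℂ) : ℝ) / (1 + ((ρ : ℂ).im) ^ 2)) := by
          have : 6 * (n : ℝ) ^ 2 ≤ (n : ℝ) ^ 2 * (8 + 2 * r₂⁻¹ ^ n) := by nlinarith
          exact mul_le_mul_of_nonneg_right this hg0
  · have hcase' : ‖(ρ : ℂ) - 1‖ < n := lt_of_not_ge hcase
    have h1 : |(1 - ((1 - 1 / (ρ : ℂ))⁻¹) ^ n).re| ≤ 1 + r₂⁻¹ ^ n := by
      calc |(1 - ((1 - 1 / (ρ : ℂ))⁻¹) ^ n).re| ≤ ‖1 - ((1 - 1 / (ρ : ℂ))⁻¹) ^ n‖ :=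
            Complex.abs_re_le_norm _
        _ ≤ ‖(1 : ℂ)‖ + ‖((1 - 1 / (ρ : ℂ))⁻¹) ^ n‖ := norm_sub_le _ _
        _ ≤ 1 + r₂⁻¹ ^ n := by
            rw [norm_one, norm_pow]
            gcongr
    have h2 : (riemannZetaZeroOrder (ρ : ℂ) : ℝ) ≤
        2 * (n : ℝ) ^ 2 * ((riemannZetaZeroOrder (ρ : ℂ) : ℝ) / (1 + ((ρ : ℂ).im) ^ 2)) := by
      have him2 : |(ρ : ℂ).im| ≤ ‖(ρ : ℂ) - 1‖ := by
        have := Complex.abs_im_le_norm ((ρ : ℂ) - 1)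
        simpa using this
      have h3 : 1 + ((ρ : ℂ).im) ^ 2 ≤ 2 * (n : ℝ) ^ 2 := by
        have h4 : ((ρ : ℂ).im) ^ 2 ≤ ‖(ρ : ℂ) - 1‖ ^ 2 := by
          have := pow_le_pow_left₀ (abs_nonneg _) him2 2
          rwa [sq_abs] at this
        nlinarith [norm_nonneg ((ρ : ℂ) - 1)]
      rw [mul_div_assoc', le_div_iff₀ (by positivity)]
      nlinarith
    calc (riemannZetaZeroOrder (ρ : ℂ) : ℝ) * |(1 - ((1 - 1 / (ρ : ℂ))⁻¹) ^ n).re|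
        ≤ (2 * (n : ℝ) ^ 2 * ((riemannZetaZeroOrder (ρ : ℂ) : ℝ) / (1 + ((ρ : ℂ).im) ^ 2))) *
            (1 + r₂⁻¹ ^ n) := mul_le_mul h2 h1 (abs_nonneg _) (by positivity)
      _ ≤ (n : ℝ) ^ 2 * (8 + 2 * r₂⁻¹ ^ n) *
            ((riemannZetaZeroOrder (ρ : ℂ) : ℝ) / (1 + ((ρ : ℂ).im) ^ 2)) := by
          nlinarith

/-- The bound on the sum over the complement of a finite exceptional set `S` of zeros:
`|Σ'_{ρ ∉ S} m(ρ) Re[1 − (1−1/ρ)^{−n}]| ≤ n²(8 + 2 r₂^{−n}) Σ_ρ m(ρ)/(1+γ²)`. [folklore] -/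
private theorem abs_tsum_compl_le {r₂ : ℝ} (hr₂0 : 0 < r₂) (hr₂1 : r₂ < 1)
    (S : Finset RHWave0.riemannZetaNontrivialZeros)
    (hS : ∀ ρ, ρ ∉ S → ‖(1 - 1 / (ρ : ℂ))⁻¹‖ ≤ r₂⁻¹) {n : ℕ} (hn : 1 ≤ n) :
    |∑' ρ : ↑((S : Set RHWave0.riemannZetaNontrivialZeros)ᶜ),
        (riemannZetaZeroOrder ((ρ : RHWave0.riemannZetaNontrivialZeros) : ℂ) : ℝ) *
          (1 - ((1 - 1 / ((ρ : RHWave0.riemannZetaNontrivialZeros) : ℂ))⁻¹) ^ n).re| ≤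
      (n : ℝ) ^ 2 * (8 + 2 * r₂⁻¹ ^ n) *
        ∑' ρ : RHWave0.riemannZetaNontrivialZeros,
          (riemannZetaZeroOrder (ρ : ℂ) : ℝ) / (1 + ((ρ : ℂ).im) ^ 2) := by
  -- the three summable families on the complement
  have hfs : Summable fun ρ : ↑((S : Set RHWave0.riemannZetaNontrivialZeros)ᶜ) ↦
      (riemannZetaZeroOrder ((ρ : RHWave0.riemannZetaNontrivialZeros) : ℂ) : ℝ) *
        (1 - ((1 - 1 / ((ρ : RHWave0.riemannZetaNontrivialZeros) : ℂ))⁻¹) ^ n).re :=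
    (summable_keiperLiTerm_inv n).subtype _
  have hfsabs : Summable fun ρ : ↑((S : Set RHWave0.riemannZetaNontrivialZeros)ᶜ) ↦
      |(riemannZetaZeroOrder ((ρ : RHWave0.riemannZetaNontrivialZeros) : ℂ) : ℝ) *
        (1 - ((1 - 1 / ((ρ : RHWave0.riemannZetaNontrivialZeros) : ℂ))⁻¹) ^ n).re| := hfs.abs
  have hfsnorm : Summable fun ρ : ↑((S : Set RHWave0.riemannZetaNontrivialZeros)ᶜ) ↦
      ‖(riemannZetaZeroOrder ((ρ : RHWave0.riemannZetaNontrivialZeros) : ℂ) : ℝ) *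
        (1 - ((1 - 1 / ((ρ : RHWave0.riemannZetaNontrivialZeros) : ℂ))⁻¹) ^ n).re‖ := hfs.norm
  have hgs : Summable fun ρ : RHWave0.riemannZetaNontrivialZeros ↦
      (riemannZetaZeroOrder (ρ : ℂ) : ℝ) / (1 + ((ρ : ℂ).im) ^ 2) :=
    ZetaZeroSum.summable_zeroOrder_div_one_add_sq
  have hg0 : ∀ ρ : RHWave0.riemannZetaNontrivialZeros,
      0 ≤ (riemannZetaZeroOrder (ρ : ℂ) : ℝ) / (1 + ((ρ : ℂ).im) ^ 2) := fun ρ ↦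
    div_nonneg (FordL33.order_pos ρ).le (by positivity)
  have hKg : Summable fun ρ : ↑((S : Set RHWave0.riemannZetaNontrivialZeros)ᶜ) ↦
      (n : ℝ) ^ 2 * (8 + 2 * r₂⁻¹ ^ n) *
        ((riemannZetaZeroOrder ((ρ : RHWave0.riemannZetaNontrivialZeros) : ℂ) : ℝ) /
          (1 + (((ρ : RHWave0.riemannZetaNontrivialZeros) : ℂ).im) ^ 2)) :=
    (hgs.mul_left ((n : ℝ) ^ 2 * (8 + 2 * r₂⁻¹ ^ n))).subtype _
  -- `|Σ f| ≤ Σ |f| ≤ Σ K g ≤ K Σ_all g`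
  have h1 := norm_tsum_le_tsum_norm hfsnorm
  simp only [Real.norm_eq_abs] at h1
  refine h1.trans ?_
  have h2 := hfsabs.tsum_le_tsum
    (fun ρ : ↑((S : Set RHWave0.riemannZetaNontrivialZeros)ᶜ) ↦
      abs_term_le_of_norm_inv_le hr₂0 hr₂1 hn (ρ : RHWave0.riemannZetaNontrivialZeros)
        (hS ρ (fun h ↦ absurd (Finset.mem_coe.2 h) ρ.2))) hKg
  refine h2.trans ?_
  have h3 := hgs.tsum_subtype_le (fun ρ : RHWave0.riemannZetaNontrivialZeros ↦
    (riemannZetaZeroOrder (ρ : ℂ) : ℝ) / (1 + ((ρ : ℂ).im) ^ 2))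
    ((S : Set RHWave0.riemannZetaNontrivialZeros)ᶜ) hg0
  rw [tsum_mul_left]
  exact mul_le_mul_of_nonneg_left h3 (by positivity)

/-- The splitting identity: for `n ≥ 1` and `0 < r < 1`, with `S = {‖1 − 1/ρ‖ ≤ r}`,
`λ_n + Σ_{ρ ∈ S} m(ρ) Re(1−1/ρ)^{−n} = Σ_{ρ ∈ S} m(ρ) + Σ'_{ρ ∉ S} m(ρ) Re[1 − (1−1/ρ)^{−n}]`.
[folklore] -/
private theorem lhs_eq_sum_add_tsum_compl {r : ℝ} (hr1 : r < 1)
    (S : Finset RHWave0.riemannZetaNontrivialZeros) (hS : ∀ ρ, ρ ∈ S ↔ ‖1 - 1 / (ρ : ℂ)‖ ≤ r)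
    {n : ℕ} (hn : 1 ≤ n) :
    keiperLiCoeff n + ∑ᶠ ρ ∈ {ρ : ℂ | ρ ∈ ZetaZeros.riemannZetaNontrivialZeros ∧ ‖1 - 1 / ρ‖ ≤ r},
        (riemannZetaZeroOrder ρ : ℝ) * (((1 - 1 / ρ)⁻¹) ^ n).re =
      (∑ ρ ∈ S, (riemannZetaZeroOrder (ρ : ℂ) : ℝ)) +
        ∑' ρ : ↑((S : Set RHWave0.riemannZetaNontrivialZeros)ᶜ),
          (riemannZetaZeroOrder ((ρ : RHWave0.riemannZetaNontrivialZeros) : ℂ) : ℝ) *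
            (1 - ((1 - 1 / ((ρ : RHWave0.riemannZetaNontrivialZeros) : ℂ))⁻¹) ^ n).re := by
  have hfs := summable_keiperLiTerm_inv n
  rw [finsum_normZ_eq_sum hr1 S hS, keiperLiCoeff_eq_tsum_zeros_inv hn,
    ← hfs.sum_add_tsum_compl (s := S)]
  have hS' : ∑ ρ ∈ S, (riemannZetaZeroOrder (ρ : ℂ) : ℝ) *
        (1 - ((1 - 1 / (ρ : ℂ))⁻¹) ^ n).re +
      ∑ ρ ∈ S, (riemannZetaZeroOrder (ρ : ℂ) : ℝ) * (((1 - 1 / (ρ : ℂ))⁻¹) ^ n).re =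
      ∑ ρ ∈ S, (riemannZetaZeroOrder (ρ : ℂ) : ℝ) := by
    rw [← Finset.sum_add_distrib]
    refine Finset.sum_congr rfl fun ρ _ ↦ ?_
    rw [Complex.sub_re, Complex.one_re]
    ring
  linarith

/-- **Discharge of `Voros2006_eqDA`** ([Voros2006] eq. (DA) p.4 / (RS) p.6, sign-corrected as in
[Voros2018] fn. 1, eq. (ASF)): for every `0 < r < 1`,
`λ_n + Σ_{‖z_ρ‖ ≤ r} m(ρ) Re z_ρ^{−n} = o(r^{−n})`, `z_ρ = 1 − 1/ρ`.  Route (a shorter road than the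
printed Darboux/Cauchy argument on the generating function, using the tree's absolutely convergent
zero sum instead): write `λ_n = Σ_ρ m(ρ) Re[1 − z_ρ^{−n}]` (reflected Li sum); the finitely many `ρ` with
`‖z_ρ‖ ≤ r` contribute `Σ m(ρ) − Σ m(ρ) Re z_ρ^{−n}`; every other zero has `‖z_ρ‖ ≥ r₂` for some `r₂ > r`
(the moduli `‖z_ρ‖ < 1` do not accumulate below `1`), and its term is `≤ 6n² m(ρ)/(1+γ²)` if
`|ρ − 1| ≥ n` (second-order Taylor bound, as in Bombieri–Lagarias) and `≤ m(ρ)(1 + r₂^{−n}) ≤ 2n²(1 +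
r₂^{−n}) m(ρ)/(1+γ²)` otherwise; summing against `Σ m/(1+γ²) < ∞` gives `O(n² r₂^{−n}) = o(r^{−n})`.
[cite: Voros2006, §3 eq. (DA) p.4; Voros2018, §1.2 fn. 1, eq. (ASF) p.3] -/
theorem Voros2006_eqDA_holds : Voros2006_eqDA := by
  intro r hr0 hr1
  classical
  -- the exceptional finite sets `S = {‖z_ρ‖ ≤ r}` ⊆ `T = {‖z_ρ‖ ≤ (r+1)/2}`
  have hr₁r : r < (r + 1) / 2 := by linarith
  have hr₁1 : (r + 1) / 2 < 1 := by linarith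
  set S : Finset RHWave0.riemannZetaNontrivialZeros :=
    ((finite_normZ_le hr1).preimage Subtype.val_injective.injOn).toFinset with hSdef
  have hS : ∀ ρ, ρ ∈ S ↔ ‖1 - 1 / (ρ : ℂ)‖ ≤ r := fun ρ ↦ by
    simp only [hSdef, Set.Finite.mem_toFinset, Set.mem_preimage, Set.mem_setOf_eq,
      Subtype.coe_prop, true_and]
  set T : Finset RHWave0.riemannZetaNontrivialZeros :=
    ((finite_normZ_le hr₁1).preimage Subtype.val_injective.injOn).toFinset with hTdef
  have hT : ∀ ρ, ρ ∈ T ↔ ‖1 - 1 / (ρ : ℂ)‖ ≤ (r + 1) / 2 := fun ρ ↦ by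
    simp only [hTdef, Set.Finite.mem_toFinset, Set.mem_preimage, Set.mem_setOf_eq,
      Subtype.coe_prop, true_and]
  -- the gap `r₂ ∈ (r, 1)` below all `‖z_ρ‖ > r`
  obtain ⟨r₂, hr₂gt, hr₂1, hgap⟩ : ∃ r₂ : ℝ, r < r₂ ∧ r₂ < 1 ∧
      ∀ ρ, ρ ∉ S → r₂ ≤ ‖1 - 1 / (ρ : ℂ)‖ := by
    let vals : Finset ℝ := insert ((r + 1) / 2)
      ((T \ S).image fun ρ : RHWave0.riemannZetaNontrivialZeros ↦ ‖1 - 1 / (ρ : ℂ)‖)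
    have hne : vals.Nonempty := Finset.insert_nonempty _ _
    refine ⟨vals.min' hne, ?_, ?_, ?_⟩
    · refine (Finset.lt_min'_iff _ _).2 fun y hy ↦ ?_
      rcases Finset.mem_insert.1 hy with rfl | hy
      · exact hr₁r
      · obtain ⟨ρ, hρ, rfl⟩ := Finset.mem_image.1 hy
        have hρS : ρ ∉ S := (Finset.mem_sdiff.1 hρ).2
        rw [hS] at hρS
        exact lt_of_not_ge hρS
    · exact (Finset.min'_le vals _ (Finset.mem_insert_self _ _)).trans_lt hr₁1
    · intro ρ hρS
      by_cases hρT : ρ ∈ T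
      · exact Finset.min'_le vals _ (Finset.mem_insert_of_mem
          (Finset.mem_image.2 ⟨ρ, Finset.mem_sdiff.2 ⟨hρT, hρS⟩, rfl⟩))
      · rw [hT] at hρT
        exact (Finset.min'_le vals _ (Finset.mem_insert_self _ _)).trans (le_of_lt (lt_of_not_ge hρT))
  have hr₂0 : 0 < r₂ := hr0.trans hr₂gt
  have hwle : ∀ ρ, ρ ∉ S → ‖(1 - 1 / (ρ : ℂ))⁻¹‖ ≤ r₂⁻¹ := by
    intro ρ hρ
    rw [norm_inv]
    exact inv_anti₀ hr₂0 (hgap ρ hρ)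
  -- constants
  set Gs : ℝ := ∑' ρ : RHWave0.riemannZetaNontrivialZeros,
    (riemannZetaZeroOrder (ρ : ℂ) : ℝ) / (1 + ((ρ : ℂ).im) ^ 2) with hGs
  have hGs0 : 0 ≤ Gs := tsum_nonneg fun ρ ↦ div_nonneg (FordL33.order_pos ρ).le (by positivity)
  set MS : ℝ := ∑ ρ ∈ S, (riemannZetaZeroOrder (ρ : ℂ) : ℝ) with hMS
  have hMS0 : 0 ≤ MS := Finset.sum_nonneg fun ρ _ ↦ (FordL33.order_pos ρ).le
  -- the bound for `n ≥ 1`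
  have hbound : ∀ n : ℕ, 1 ≤ n →
      |keiperLiCoeff n + ∑ᶠ ρ ∈ {ρ : ℂ | ρ ∈ ZetaZeros.riemannZetaNontrivialZeros ∧ ‖1 - 1 / ρ‖ ≤ r},
          (riemannZetaZeroOrder ρ : ℝ) * (((1 - 1 / ρ)⁻¹) ^ n).re| ≤
        MS + (n : ℝ) ^ 2 * (8 + 2 * r₂⁻¹ ^ n) * Gs := by
    intro n hn
    rw [lhs_eq_sum_add_tsum_compl hr1 S hS hn]
    have h := abs_tsum_compl_le hr₂0 hr₂1 S hwle hn
    calc _ ≤ |MS| + |∑' ρ : ↑((S : Set RHWave0.riemannZetaNontrivialZeros)ᶜ),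
          (riemannZetaZeroOrder ((ρ : RHWave0.riemannZetaNontrivialZeros) : ℂ) : ℝ) *
            (1 - ((1 - 1 / ((ρ : RHWave0.riemannZetaNontrivialZeros) : ℂ))⁻¹) ^ n).re| :=
          abs_add_le _ _
      _ ≤ MS + (n : ℝ) ^ 2 * (8 + 2 * r₂⁻¹ ^ n) * Gs := by rw [abs_of_nonneg hMS0]; linarith
  -- `MS + n²(8 + 2 r₂^{−n}) G = o(r^{−n})`
  have hq0 : 0 ≤ r / r₂ := by positivity
  have hq1 : r / r₂ < 1 := (div_lt_one hr₂0).2 hr₂gt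
  have hlim : Tendsto (fun n : ℕ ↦ MS * r ^ n + (n : ℝ) ^ 2 * (8 * r ^ n + 2 * (r / r₂) ^ n) * Gs)
      atTop (𝓝 0) := by
    have t1 : Tendsto (fun n : ℕ ↦ r ^ n) atTop (𝓝 0) :=
      tendsto_pow_atTop_nhds_zero_of_lt_one hr0.le hr1
    have t2 : Tendsto (fun n : ℕ ↦ (n : ℝ) ^ 2 * r ^ n) atTop (𝓝 0) :=
      tendsto_pow_const_mul_const_pow_of_lt_one 2 hr0.le hr1
    have t3 : Tendsto (fun n : ℕ ↦ (n : ℝ) ^ 2 * (r / r₂) ^ n) atTop (𝓝 0) :=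
      tendsto_pow_const_mul_const_pow_of_lt_one 2 hq0 hq1
    have := ((t1.const_mul MS).add (((t2.const_mul 8).add (t3.const_mul 2)).mul_const Gs))
    simp only [mul_zero, zero_add, zero_mul] at this
    refine this.congr fun n ↦ ?_
    ring
  rw [isLittleO_iff]
  intro c hc
  filter_upwards [hlim.eventually (gt_mem_nhds hc), eventually_ge_atTop 1] with n hn hn1
  have hrn : 0 < r⁻¹ ^ n := pow_pos (inv_pos.2 hr0) n
  rw [Real.norm_eq_abs, Real.norm_eq_abs, abs_of_pos hrn]
  refine (hbound n hn1).trans ?_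
  have e : MS + (n : ℝ) ^ 2 * (8 + 2 * r₂⁻¹ ^ n) * Gs =
      (MS * r ^ n + (n : ℝ) ^ 2 * (8 * r ^ n + 2 * (r / r₂) ^ n) * Gs) * r⁻¹ ^ n := by
    rw [div_pow, inv_pow, inv_pow]
    have hrn0 : r ^ n ≠ 0 := pow_ne_zero _ hr0.ne'
    have hr2n0 : r₂ ^ n ≠ 0 := pow_ne_zero _ hr₂0.ne'
    field_simp
  rw [e]
  exact mul_le_mul_of_nonneg_right hn.le hrn.le

end Darboux

/-! ## Coffey 2008, Prop. 4.2: strict sign alternation of `η_j` -/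

section SignAlternation

/-- `‖1 − ρ‖ > 14` for a non-trivial zero (`|Im ρ| > 14`). [folklore] -/
private theorem fourteen_lt_norm_one_sub (ρ : RHWave0.riemannZetaNontrivialZeros) :
    14 < ‖1 - (ρ : ℂ)‖ := by
  have h := FordL33.fourteen_lt_abs_im ρ
  have h2 : |(1 - (ρ : ℂ)).im| ≤ ‖1 - (ρ : ℂ)‖ := Complex.abs_im_le_norm _
  rw [Complex.sub_im, Complex.one_im, zero_sub, abs_neg] at h2
  linarith

/-- For `‖z‖ > 14` and `k ≥ 2`: `‖z⁻¹ ^ k‖ ≤ 14^{−(k−2)} ‖z‖^{−2}`. [folklore] -/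
private theorem norm_inv_pow_le {z : ℂ} (hz : 14 < ‖z‖) {k : ℕ} (hk : 2 ≤ k) :
    ‖(z⁻¹) ^ k‖ ≤ ((14 : ℝ) ^ (k - 2))⁻¹ * (‖z‖ ^ 2)⁻¹ := by
  obtain ⟨i, rfl⟩ : ∃ i, k = i + 2 := ⟨k - 2, by omega⟩
  simp only [Nat.add_sub_cancel]
  have h0 : 0 < ‖z‖ := by linarith
  rw [norm_pow, norm_inv, pow_add, inv_pow, inv_pow]
  exact mul_le_mul_of_nonneg_right
    (inv_anti₀ (by positivity) (pow_le_pow_left₀ (by norm_num) hz.le i)) (by positivity)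

/-- `Σ_ρ m(ρ)/|1 − ρ|² < ∞` (reflection of `FordL33.summable_order_div_norm_sq`). [folklore] -/
private theorem summable_order_div_norm_one_sub_sq :
    Summable fun ρ : RHWave0.riemannZetaNontrivialZeros ↦
      (riemannZetaZeroOrder (ρ : ℂ) : ℝ) / ‖1 - (ρ : ℂ)‖ ^ 2 := by
  have h := (FordL33.reflEquiv.summable_iff (f := fun ρ : RHWave0.riemannZetaNontrivialZeros ↦
    (riemannZetaZeroOrder (ρ : ℂ) : ℝ) / ‖(ρ : ℂ)‖ ^ 2)).2 FordL33.summable_order_div_norm_sq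
  refine h.congr fun ρ ↦ ?_
  have hco : (FordL33.reflEquiv ρ : RHWave0.riemannZetaNontrivialZeros) = FordL33.refl ρ := rfl
  simp only [Function.comp_apply, hco]
  rw [FordL33.order_refl, FordL33.norm_refl]

/-- **Crude size bound for the zero power sums**: for `k ≥ 2`,
`|σ_k| ≤ ½ Σ_ρ m(ρ)(|ρ|^{−k} + |1−ρ|^{−k}) ≤ 14^{2−k} · ½ (Σ m/|ρ|² + Σ m/|1−ρ|²) ≤ 0.0463 · 14^{2−k}`,
by `|ρ|, |1−ρ| > 14` and Ford's Lemma 3.3 (`tsum_zeroOrder_div_norm_sq_le`).  (In place of the printed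
first-zero asymptotic (4.16) of Matsuoka.) [cite: Coffey2008, eq. (4.16) p.719; Ford2002Millennium, Lemma 3.3] -/
theorem norm_zetaZeroPowerSum_le {k : ℕ} (hk : 2 ≤ k) :
    ‖zetaZeroPowerSum k‖ ≤ 0.0463 * ((14 : ℝ) ^ (k - 2))⁻¹ := by
  set f : ZetaZeros.riemannZetaNontrivialZeros → ℂ := fun ρ ↦
    (riemannZetaZeroOrder (ρ : ℂ) : ℂ) * ((((ρ : ℂ))⁻¹) ^ k + ((1 - (ρ : ℂ))⁻¹) ^ k) with hf
  have hs : Summable f := summable_zetaZeroPowerSum_term (by omega)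
  have h1 : ‖∑' ρ, f ρ‖ ≤ ∑' ρ, ‖f ρ‖ := norm_tsum_le_tsum_norm hs.norm
  set g : RHWave0.riemannZetaNontrivialZeros → ℝ := fun ρ ↦
    ((14 : ℝ) ^ (k - 2))⁻¹ * ((riemannZetaZeroOrder (ρ : ℂ) : ℝ) / ‖(ρ : ℂ)‖ ^ 2 +
      (riemannZetaZeroOrder (ρ : ℂ) : ℝ) / ‖1 - (ρ : ℂ)‖ ^ 2) with hg
  have hgs : Summable g :=
    (FordL33.summable_order_div_norm_sq.add summable_order_div_norm_one_sub_sq).mul_left _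
  have h2 : ∀ ρ : RHWave0.riemannZetaNontrivialZeros, ‖f ρ‖ ≤ g ρ := by
    intro ρ
    have hm := FordL33.order_pos ρ
    simp only [hf, hg]
    rw [norm_mul, Complex.norm_intCast, abs_of_pos hm]
    have ha := norm_inv_pow_le (FordL33.fourteen_lt_norm ρ) hk
    have hb := norm_inv_pow_le (fourteen_lt_norm_one_sub ρ) hk
    calc (riemannZetaZeroOrder (ρ : ℂ) : ℝ) * ‖(((ρ : ℂ))⁻¹) ^ k + ((1 - (ρ : ℂ))⁻¹) ^ k‖
        ≤ (riemannZetaZeroOrder (ρ : ℂ) : ℝ) * (‖(((ρ : ℂ))⁻¹) ^ k‖ + ‖((1 - (ρ : ℂ))⁻¹) ^ k‖) :=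
          mul_le_mul_of_nonneg_left (norm_add_le _ _) hm.le
      _ ≤ (riemannZetaZeroOrder (ρ : ℂ) : ℝ) * (((14 : ℝ) ^ (k - 2))⁻¹ * (‖(ρ : ℂ)‖ ^ 2)⁻¹ +
            ((14 : ℝ) ^ (k - 2))⁻¹ * (‖1 - (ρ : ℂ)‖ ^ 2)⁻¹) := by gcongr
      _ = _ := by ring
  have h3 : ∑' ρ, ‖f ρ‖ ≤ ∑' ρ, g ρ := hs.norm.tsum_le_tsum h2 hgs
  have h4 : ∑' ρ, g ρ ≤ ((14 : ℝ) ^ (k - 2))⁻¹ * (0.0463 + 0.0463) := by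
    rw [hg, tsum_mul_left, FordL33.summable_order_div_norm_sq.tsum_add
      summable_order_div_norm_one_sub_sq]
    exact mul_le_mul_of_nonneg_left
      (add_le_add tsum_zeroOrder_div_norm_sq_le tsum_zeroOrder_div_norm_one_sub_sq_le)
      (by positivity)
  unfold zetaZeroPowerSum
  rw [norm_mul]
  have : ‖(1 / 2 : ℂ)‖ = 1 / 2 := by norm_num
  rw [this]
  have h5 := (h1.trans h3).trans h4
  have h14 : (0 : ℝ) ≤ ((14 : ℝ) ^ (k - 2))⁻¹ := by positivity
  nlinarith

/-- **Discharge of `Coffey2008_prop42`** ([Coffey2008] Prop. 4.2 p.719): strict sign alternation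
`(−1)^{j+1} η_j > 0` for all `j ≥ 0`.  `j = 0`: `η₀ = −γ < 0`.  `j ≥ 1`, `k = j + 1`: by (3.6)
(`re_zetaZeroPowerSum_eq'`) `(−1)^{j+1} η_j = Re σ_k + [(1 − 2^{−k}) ζ(k) − 1] > −|σ_k| + 3^{−k}`
((4.17), `three_pow_inv_lt_oddZeta_sub_one`), and `|σ_k| ≤ 0.0463·14^{2−k} < 3^{−k}`
(`norm_zetaZeroPowerSum_le`; the printed proof invokes Matsuoka's asymptotic (4.16) for the size of
`σ_k` — here the cruder all-zeros bound `|ρ| > 14` with Ford's `Σ m/|ρ|² ≤ 0.0463` suffices for every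
`k ≥ 2`). [cite: Coffey2008, Prop. 4.2 p.719] -/
theorem Coffey2008_prop42_holds : Coffey2008_prop42 := by
  intro j
  rcases Nat.eq_zero_or_pos j with rfl | hj
  · rw [liEta_zero]
    have := Real.one_half_lt_eulerMascheroniConstant
    norm_num
    linarith
  · have hk : 2 ≤ j + 1 := by omega
    have h36 := re_zetaZeroPowerSum_eq' hk
    simp only [Nat.add_sub_cancel] at h36
    have h417 := three_pow_inv_lt_oddZeta_sub_one hk
    have hσ : |(zetaZeroPowerSum (j + 1)).re| ≤ 0.0463 * ((14 : ℝ) ^ (j + 1 - 2))⁻¹ :=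
      (Complex.abs_re_le_norm _).trans (norm_zetaZeroPowerSum_le hk)
    -- `0.0463 · 14^{−(j−1)} < 3^{−(j+1)}`
    obtain ⟨i, rfl⟩ : ∃ i, j = i + 1 := ⟨j - 1, by omega⟩
    simp only [show i + 1 + 1 - 2 = i by omega] at hσ
    have hcmp : 0.0463 * ((14 : ℝ) ^ i)⁻¹ < ((3 : ℝ) ^ (i + 1 + 1))⁻¹ := by
      have h1 : ((14 : ℝ) ^ i)⁻¹ ≤ ((3 : ℝ) ^ i)⁻¹ :=
        inv_anti₀ (by positivity) (pow_le_pow_left₀ (by norm_num) (by norm_num) i)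
      have h2 : ((3 : ℝ) ^ (i + 1 + 1))⁻¹ = 1 / 9 * ((3 : ℝ) ^ i)⁻¹ := by
        rw [pow_add, pow_add, mul_inv, mul_inv]; norm_num; ring
      rw [h2]
      have h3 : (0 : ℝ) < ((3 : ℝ) ^ i)⁻¹ := by positivity
      nlinarith
    have hre := (abs_le.1 hσ).1
    push_cast at h36 h417 ⊢
    nlinarith [hre, hcmp, h36, h417]

end SignAlternation

/-! ## Coffey 2008, eq. (4.10): the functional equation on the Taylor coefficients of `ξ'/ξ` -/

section FunctionalEquation

/-- From `ξ'/ξ(1−s) = −ξ'/ξ(s)` (tree: `logDeriv_riemannXi_one_sub`):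
`(ξ'/ξ)^{(j)}(0) = −(−1)^j (ξ'/ξ)^{(j)}(1)`. [cite: Coffey2008, p.718] -/
theorem iteratedDeriv_logDeriv_riemannXi_zero (j : ℕ) :
    iteratedDeriv j (logDeriv riemannXi) 0 = -(-1) ^ j * iteratedDeriv j (logDeriv riemannXi) 1 := by
  have e : logDeriv riemannXi = fun z ↦ -logDeriv riemannXi (1 - z) := by
    funext z; rw [logDeriv_riemannXi_one_sub, neg_neg]
  conv_lhs => rw [e]
  rw [iteratedDeriv_fun_neg, iteratedDeriv_comp_const_sub]
  simp

/-- `ξ ≠ 0` on the disc `|s − 1| < 2` (all zeros have `|Im| > 14`). [folklore] -/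
private theorem riemannXi_ne_zero_of_mem_ball {s : ℂ} (hs : s ∈ Metric.ball (1 : ℂ) 2) :
    riemannXi s ≠ 0 := by
  intro h0
  obtain ⟨hζ, h0re, h1re⟩ := (riemannXi_eq_zero_iff_holds s).1 h0
  have hmem : s ∈ RHWave0.riemannZetaNontrivialZeros :=
    ZetaZeros.riemannZetaNontrivialZeros.mem_iff'.2 ⟨hζ, h0re, h1re⟩
  have h14 := FordL33.fourteen_lt_abs_im ⟨s, hmem⟩
  have h2 : |s.im| < 2 := by
    have hn : ‖s - 1‖ < 2 := by simpa [dist_eq_norm] using hs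
    have := Complex.abs_im_le_norm (s - 1)
    rw [Complex.sub_im, Complex.one_im, sub_zero] at this
    linarith
  simp only at h14
  linarith

/-- `ξ'/ξ` and all its derivatives are holomorphic on `|s − 1| < 2`. [folklore] -/
private theorem differentiableOn_iteratedDeriv_logDeriv_riemannXi (j : ℕ) :
    DifferentiableOn ℂ (iteratedDeriv j (logDeriv riemannXi)) (Metric.ball (1 : ℂ) 2) := by
  have hF : DifferentiableOn ℂ (logDeriv riemannXi) (Metric.ball (1 : ℂ) 2) := by
    intro s hs
    have hd : DifferentiableAt ℂ (deriv riemannXi) s :=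
      ((differentiable_riemannXi.analyticAt s).deriv).differentiableAt
    have : logDeriv riemannXi = fun z ↦ deriv riemannXi z / riemannXi z := by
      funext z; rw [logDeriv_apply]
    rw [this]
    exact (hd.div (differentiable_riemannXi s) (riemannXi_ne_zero_of_mem_ball hs)).differentiableWithinAt
  have hA : AnalyticOnNhd ℂ (logDeriv riemannXi) (Metric.ball (1 : ℂ) 2) :=
    hF.analyticOnNhd Metric.isOpen_ball
  rw [iteratedDeriv_eq_iterate]
  exact (hA.iterated_deriv j).differentiableOn

/-- `σ_{m+1} = (−1)^m (ξ'/ξ)^{(m)}(1)/m!` ((3.4) read on `ξ'/ξ`). [cite: Coffey2008, eqs. (3.4), (4.9)] -/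
theorem zetaZeroPowerSum_succ_eq (m : ℕ) :
    zetaZeroPowerSum (m + 1) =
      (-1) ^ m * (iteratedDeriv m (logDeriv riemannXi) 1 / (m ! : ℂ)) := by
  rw [Coffey2008_eq34_holds (m + 1) (by omega), Xiao2020.logXiTaylorCoeff,
    iteratedDeriv_succ_log_riemannXi_one m, Nat.factorial_succ]
  push_cast
  have hm : (m ! : ℂ) ≠ 0 := by exact_mod_cast (Nat.factorial_pos m).ne'
  have hm1 : ((m : ℂ) + 1) ≠ 0 := by exact_mod_cast (Nat.succ_ne_zero m)
  field_simp
  ring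

/-- **Discharge of `Coffey2008_eq410`** ([Coffey2008] eq. (4.10) p.718): for every `j ≥ 0`,
`Σ_{i≥0} C(i+j, j) σ_{i+j+1} = (−1)^{j+1} σ_{j+1}`.  Printed route: expand `ξ'/ξ(s) =
Σ_k (−1)^{k+1} σ_k (s−1)^{k−1}` ((4.9)), differentiate the functional equation `ξ'/ξ(s) =
−ξ'/ξ(1−s)` `j` times and put `s = 1`.  Here: `(ξ'/ξ)^{(j)}` is holomorphic on `|s−1| < 2` (no zero of
`ξ` there), so its Taylor series at `1` converges at `s = 0` to `(ξ'/ξ)^{(j)}(0)`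
(`Complex.hasSum_taylorSeries_on_ball`), which equals `−(−1)^j (ξ'/ξ)^{(j)}(1)` by the functional
equation; with `σ_{m+1} = (−1)^m (ξ'/ξ)^{(m)}(1)/m!` (`zetaZeroPowerSum_succ_eq`, from (3.4)).
[cite: Coffey2008, eq. (4.10) p.718] -/
theorem Coffey2008_eq410_holds : Coffey2008_eq410 := by
  intro j
  have h0 : (0 : ℂ) ∈ Metric.ball (1 : ℂ) 2 := by simp
  have hT := Complex.hasSum_taylorSeries_on_ball
    (differentiableOn_iteratedDeriv_logDeriv_riemannXi j) h0
  -- `d^n/ds^n (F^{(j)}) = F^{(n+j)}`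
  have hit : ∀ n, iteratedDeriv n (iteratedDeriv j (logDeriv riemannXi)) =
      iteratedDeriv (n + j) (logDeriv riemannXi) := by
    intro n
    rw [iteratedDeriv_eq_iterate, iteratedDeriv_eq_iterate, iteratedDeriv_eq_iterate,
      Function.iterate_add]
    rfl
  simp only [hit, zero_sub, smul_eq_mul] at hT
  rw [iteratedDeriv_logDeriv_riemannXi_zero j] at hT
  have hj : (j ! : ℂ) ≠ 0 := by exact_mod_cast (Nat.factorial_pos j).ne'
  have h2 := hT.mul_left ((-1) ^ j / (j ! : ℂ))
  have hsum : (-1) ^ j / (j ! : ℂ) * (-(-1) ^ j * iteratedDeriv j (logDeriv riemannXi) 1) =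
      (-1) ^ (j + 1) * zetaZeroPowerSum (j + 1) := by
    rw [zetaZeroPowerSum_succ_eq]
    field_simp
    ring
  rw [hsum] at h2
  refine h2.congr_fun fun i ↦ ?_
  -- termwise: `((−1)^j/j!) · (i!)⁻¹ (−1)^i F^{(i+j)}(1) = C(i+j, j) σ_{i+j+1}`
  rw [zetaZeroPowerSum_succ_eq (i + j)]
  have hi : (i ! : ℂ) ≠ 0 := by exact_mod_cast (Nat.factorial_pos i).ne'
  have hij : (((i + j).choose j : ℕ) : ℂ) = ((i + j)! : ℂ) / ((i ! : ℂ) * (j ! : ℂ)) := by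
    rw [eq_div_iff (mul_ne_zero hi hj)]
    have h := Nat.choose_mul_factorial_mul_factorial (Nat.le_add_left j i)
    rw [Nat.add_sub_cancel] at h
    exact_mod_cast (by rw [← h]; ring : ((i + j).choose j * (i ! * j !) : ℕ) = (i + j)!)
  rw [hij]
  have hij' : ((i + j)! : ℂ) ≠ 0 := by exact_mod_cast (Nat.factorial_pos _).ne'
  field_simp
  ring

end FunctionalEquation

/-! ## Coffey 2008, Prop. 4.1: the summatory relation for the `η_j` -/

section SummatoryRelation

/-- `((n : ℂ) z).re = n · z.re`. [folklore] -/
private theorem re_natCast_mul (n : ℕ) (z : ℂ) : ((n : ℂ) * z).re = (n : ℝ) * z.re := by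
  rw [← Complex.ofReal_natCast, Complex.re_ofReal_mul]

/-- Transport of a `HasSum` along an equality of values. [folklore] -/
private theorem hasSum_congr_val {f : ℕ → ℝ} {a b : ℝ} (h : HasSum f a) (e : a = b) :
    HasSum f b := e ▸ h

/-- `ζ(k) = Σ_{n≥0} (n+1)^{−k}` on the real side, `k ≥ 2`. [folklore] -/
private theorem hasSum_inv_succ_pow {k : ℕ} (hk : 2 ≤ k) :
    HasSum (fun n : ℕ ↦ (((n : ℝ) + 1) ^ k)⁻¹) (riemannZeta (k : ℂ)).re := by
  have hs : Summable (fun n : ℕ ↦ 1 / (n : ℝ) ^ k) := Real.summable_one_div_nat_pow.2 (by omega)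
  have hζ : riemannZeta (k : ℂ) = ((∑' n : ℕ, 1 / (n : ℝ) ^ k : ℝ) : ℂ) := by
    rw [zeta_nat_eq_tsum_of_gt_one (by omega : 1 < k), Complex.ofReal_tsum]
    push_cast
    rfl
  have h0 : HasSum (fun n : ℕ ↦ 1 / (n : ℝ) ^ k) (riemannZeta (k : ℂ)).re := by
    rw [hζ, Complex.ofReal_re]; exact hs.hasSum
  have h1 := (hasSum_nat_add_iff' 1).2 h0
  simp only [Finset.range_one, Finset.sum_singleton, Nat.cast_zero,
    zero_pow (by omega : k ≠ 0), Nat.cast_add, Nat.cast_one, one_div, inv_zero, sub_zero] at h1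
  exact h1

/-- `(1 − 2^{−k}) ζ(k) = Σ_{m≥0} (2m+1)^{−k}` on the real side, `k ≥ 2` (tree:
`Xiao2020.hasSum_inv_odd_pow`). [cite: Coffey2008, eq. (2.6) p.713] -/
private theorem hasSum_inv_odd_pow_re {k : ℕ} (hk : 2 ≤ k) :
    HasSum (fun m : ℕ ↦ (((1 : ℝ) + 2 * (m : ℝ)) ^ k)⁻¹)
      ((1 - ((2 : ℝ) ^ k)⁻¹) * (riemannZeta (k : ℂ)).re) := by
  have h := Xiao2020.hasSum_inv_odd_pow hk
  have hre : HasSum (fun m : ℕ ↦ (((1 : ℝ) + 2 * (m : ℝ)) ^ k)⁻¹)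
      (((1 - 1 / 2 ^ k) * riemannZeta (k : ℂ))).re := by
    have h2 := ((Complex.hasSum_iff _ _).1 h).1
    refine h2.congr_fun fun m ↦ ?_
    show _ = ((((1 : ℂ) + 2 * (m : ℂ)) ^ k)⁻¹).re
    rw [show (((1 : ℂ) + 2 * (m : ℂ)) ^ k)⁻¹ = (((((1 : ℝ) + 2 * (m : ℝ)) ^ k)⁻¹ : ℝ) : ℂ) by
      push_cast; ring, Complex.ofReal_re]
  have hval : (((1 - 1 / 2 ^ k) * riemannZeta (k : ℂ))).re =
      (1 - ((2 : ℝ) ^ k)⁻¹) * (riemannZeta k).re := by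
    rw [show ((1 : ℂ) - 1 / 2 ^ k) = (((1 - ((2 : ℝ) ^ k)⁻¹ : ℝ)) : ℂ) by push_cast; ring,
      Complex.re_ofReal_mul]
  rwa [hval] at hre

/-- Its tail: `Σ_{m≥0} (2m+3)^{−k} = (1 − 2^{−k}) ζ(k) − 1`. [cite: Coffey2008, eq. (4.14) p.719] -/
private theorem hasSum_inv_oddTail_pow {k : ℕ} (hk : 2 ≤ k) :
    HasSum (fun m : ℕ ↦ (((2 * (m : ℝ) + 3)) ^ k)⁻¹)
      ((1 - ((2 : ℝ) ^ k)⁻¹) * (riemannZeta (k : ℂ)).re - 1) := by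
  have h1 := (hasSum_nat_add_iff' 1).2 (hasSum_inv_odd_pow_re hk)
  simp only [Finset.range_one, Finset.sum_singleton, Nat.cast_zero, mul_zero, add_zero, one_pow,
    inv_one, Nat.cast_add, Nat.cast_one] at h1
  refine h1.congr_fun fun m ↦ ?_
  ring_nf

/-- **[Coffey2008] eqs. (4.13)–(4.14) p.719**, in real form: for `j ≥ 1`,
`Σ_{i≥0} C(i+j, j) Σ_{m≥0} (2m+3)^{−(i+j+1)} = Σ_{m≥0} (2m+2)^{−(j+1)} = 2^{−(j+1)} ζ(j+1)`
(interchange of the two non-negative series, `Σ_{i} C(i+j,j) x^i = (1−x)^{−(j+1)}`).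
[cite: Coffey2008, eqs. (4.13)–(4.14) p.719] -/
theorem hasSum_choose_mul_oddTail {j : ℕ} (hj : 1 ≤ j) :
    HasSum (fun i : ℕ ↦ (((i + j).choose j : ℕ) : ℝ) *
        ∑' m : ℕ, (((2 * (m : ℝ) + 3)) ^ (i + j + 1))⁻¹)
      (((2 : ℝ) ^ (j + 1))⁻¹ * (riemannZeta ((j + 1 : ℕ) : ℂ)).re) := by
  -- `g (m, i) = C(i+j, j) (2m+3)^{−(i+j+1)} ≥ 0`, summed `m`-outer first
  set g : ℕ × ℕ → ℝ := fun p ↦ (((p.2 + j).choose j : ℕ) : ℝ) *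
    (((2 * (p.1 : ℝ) + 3)) ^ (p.2 + j + 1))⁻¹ with hg_def
  have hg0 : 0 ≤ g := fun p ↦ by simp only [hg_def]; positivity
  have hrow : ∀ m : ℕ, HasSum (fun i ↦ g (m, i)) ((((2 * (m : ℝ) + 2)) ^ (j + 1))⁻¹) := by
    intro m
    have hm : (0 : ℝ) ≤ m := m.cast_nonneg
    have hx : ‖((2 * (m : ℝ) + 3))⁻¹‖ < 1 := by
      rw [Real.norm_eq_abs, abs_of_pos (by positivity)]
      exact inv_lt_one_of_one_lt₀ (by linarith)
    have h := (hasSum_choose_mul_geometric_of_norm_lt_one j hx).mul_left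
      ((((2 * (m : ℝ) + 3))⁻¹) ^ (j + 1))
    have hv : (((2 * (m : ℝ) + 3))⁻¹) ^ (j + 1) * (1 / (1 - ((2 * (m : ℝ) + 3))⁻¹) ^ (j + 1)) =
        (((2 * (m : ℝ) + 2)) ^ (j + 1))⁻¹ := by
      rw [one_div, ← inv_pow, ← mul_pow, ← inv_pow]
      congr 1
      have h3 : (2 * (m : ℝ) + 3) ≠ 0 := by positivity
      rw [← mul_inv, mul_sub, mul_one, mul_inv_cancel₀ h3]
      ring
    rw [hv] at h
    refine h.congr_fun fun i ↦ ?_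
    simp only [hg_def]
    rw [← inv_pow]
    ring
  have hE : HasSum (fun m : ℕ ↦ (((2 * (m : ℝ) + 2)) ^ (j + 1))⁻¹)
      (((2 : ℝ) ^ (j + 1))⁻¹ * (riemannZeta ((j + 1 : ℕ) : ℂ)).re) := by
    have h := (hasSum_inv_succ_pow (k := j + 1) (by omega)).mul_left (((2 : ℝ) ^ (j + 1))⁻¹)
    refine h.congr_fun fun m ↦ ?_
    rw [← mul_inv, ← mul_pow]
    ring_nf
  have hgs : Summable g := by
    refine (summable_prod_of_nonneg hg0).2 ⟨fun m ↦ (hrow m).summable, ?_⟩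
    simp_rw [fun m ↦ (hrow m).tsum_eq]
    exact hE.summable
  have hgsum : HasSum g (((2 : ℝ) ^ (j + 1))⁻¹ * (riemannZeta ((j + 1 : ℕ) : ℂ)).re) := by
    have h1 := hgs.hasSum.prod_fiberwise hrow
    rw [← h1.unique hE]
    exact hgs.hasSum
  -- swap to `i`-outer
  have hfs : Summable fun p : ℕ × ℕ ↦ g p.swap := hgs.prod_symm
  have hfsum : HasSum (fun p : ℕ × ℕ ↦ g p.swap)
      (((2 : ℝ) ^ (j + 1))⁻¹ * (riemannZeta ((j + 1 : ℕ) : ℂ)).re) := by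
    have e : ∑' p : ℕ × ℕ, g p.swap = ∑' p, g p := (Equiv.prodComm ℕ ℕ).tsum_eq g
    rw [← hgsum.tsum_eq, ← e]
    exact hfs.hasSum
  have hcol : ∀ i : ℕ, HasSum (fun m : ℕ ↦ g (Prod.swap (i, m)))
      ((((i + j).choose j : ℕ) : ℝ) * ∑' m : ℕ, (((2 * (m : ℝ) + 3)) ^ (i + j + 1))⁻¹) := by
    intro i
    have hsi : Summable fun m : ℕ ↦ g (Prod.swap (i, m)) := ((summable_prod_of_nonneg
      (f := fun p : ℕ × ℕ ↦ g p.swap) (fun p : ℕ × ℕ ↦ hg0 p.swap)).1 hfs).1 i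
    have := hsi.hasSum
    simp only [Prod.swap_prod_mk, hg_def] at this ⊢
    rwa [tsum_mul_left] at this
  exact hfsum.prod_fiberwise hcol

/-- **Discharge of `Coffey2008_prop41`** ([Coffey2008] Prop. 4.1 p.718–719, corrected form as typed):
the real part of (4.10) (`Coffey2008_eq410_holds`) with (3.6) (`re_zetaZeroPowerSum_eq'`) inserted on
both sides and the odd-zeta sum (4.13) (`hasSum_choose_mul_oddTail`) subtracted, the `k = j` term moved
to the right. [cite: Coffey2008, Prop. 4.1 eqs. (4.12)–(4.15) p.718–719] -/
theorem Coffey2008_prop41_holds : Coffey2008_prop41 := by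
  intro j hj
  -- real parts of (4.10)
  have hA := Complex.reCLM.hasSum (Coffey2008_eq410_holds j)
  have ec : ((-1 : ℂ) ^ (j + 1)) = (((-1 : ℝ) ^ (j + 1) : ℝ) : ℂ) := by push_cast; ring
  simp only [Complex.reCLM_apply, re_natCast_mul] at hA
  rw [ec, Complex.re_ofReal_mul] at hA
  -- (3.6) for `k = i + j + 1 ≥ 2`
  have h36 : ∀ i : ℕ, (zetaZeroPowerSum (i + j + 1)).re =
      (-1) ^ (i + j + 1) * liEta (i + j) -
        (1 - ((2 : ℝ) ^ (i + j + 1))⁻¹) * (riemannZeta ((i + j + 1 : ℕ) : ℂ)).re + 1 := by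
    intro i
    have := re_zetaZeroPowerSum_eq' (k := i + j + 1) (by omega)
    simpa only [Nat.add_sub_cancel] using this
  -- (4.13): `Σ_i C(i+j,j) (1 − c_{i+j+1}) = −2^{−(j+1)} ζ(j+1)`
  have hB : HasSum (fun i : ℕ ↦ (((i + j).choose j : ℕ) : ℝ) *
      (1 - (1 - ((2 : ℝ) ^ (i + j + 1))⁻¹) * (riemannZeta ((i + j + 1 : ℕ) : ℂ)).re))
      (-(((2 : ℝ) ^ (j + 1))⁻¹ * (riemannZeta ((j + 1 : ℕ) : ℂ)).re)) := by
    refine (hasSum_choose_mul_oddTail hj).neg.congr_fun fun i ↦ ?_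
    rw [(hasSum_inv_oddTail_pow (k := i + j + 1) (by omega)).tsum_eq]
    ring
  -- difference, then drop the `i = 0` term
  have hD := hA.sub hB
  have hD' : HasSum (fun i : ℕ ↦ (((i + j).choose j : ℕ) : ℝ) * ((-1) ^ (i + j + 1) * liEta (i + j)))
      ((-1) ^ (j + 1) * (zetaZeroPowerSum (j + 1)).re +
        ((2 : ℝ) ^ (j + 1))⁻¹ * (riemannZeta ((j + 1 : ℕ) : ℂ)).re) :=
    hasSum_congr_val (hD.congr_fun fun i ↦ by rw [h36 i]; ring) (by ring)
  have hS := (hasSum_nat_add_iff' 1).2 hD'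
  simp only [Finset.range_one, Finset.sum_singleton, zero_add, Nat.choose_self, Nat.cast_one,
    one_mul] at hS
  have h36j : (zetaZeroPowerSum (j + 1)).re =
      (-1) ^ (j + 1) * liEta j - (1 - ((2 : ℝ) ^ (j + 1))⁻¹) * (riemannZeta ((j + 1 : ℕ) : ℂ)).re + 1 := by
    have := re_zetaZeroPowerSum_eq' (k := j + 1) (by omega)
    simpa only [Nat.add_sub_cancel] using this
  rw [h36j] at hS
  have e2 : (-1 : ℝ) ^ j * (-1) ^ j = 1 := by
    rw [← mul_pow]; norm_num
  push_cast at hS ⊢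
  refine hasSum_congr_val (hS.congr_fun fun i ↦ ?_) ?_
  · rw [show i + 1 + j = i + j + 1 by omega]
    ring
  · rw [pow_succ (-1 : ℝ) j]
    linear_combination (liEta j) * e2

end SummatoryRelation

/-! ## Voros 2006, (LZS) and its inverse: the dilated Chebyshev identities -/

section Chebyshev

/-! ### The dilated Chebyshev identity `A^n + A^{−n} = Σ_j (−1)^j [C(n+j,2j) + C(n+j−1,2j)] (2 − A − A^{−1})^j` -/

/-- Pascal twice: `C(N+2,k+2) + C(N,k+2) = 2 C(N+1,k+2) + C(N,k)`. [folklore] -/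
private theorem choose_add_two (N k : ℕ) :
    (N + 2).choose (k + 2) + N.choose (k + 2) = 2 * (N + 1).choose (k + 2) + N.choose k := by
  have h1 : (N + 2).choose (k + 2) = (N + 1).choose (k + 1) + (N + 1).choose (k + 2) :=
    Nat.choose_succ_succ' (N + 1) (k + 1)
  have h2 : (N + 1).choose (k + 1) = N.choose k + N.choose (k + 1) := Nat.choose_succ_succ' N k
  have h3 : (N + 1).choose (k + 2) = N.choose (k + 1) + N.choose (k + 2) :=
    Nat.choose_succ_succ' N (k + 1)
  omega

/-- The three-term recurrence of the coefficients `G(n,j) = C(n+j,2j) + C(n+j−1,2j)`: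
`G(n+2,j+1) + G(n,j+1) = 2 G(n+1,j+1) + G(n+1,j)`. [folklore] -/
private theorem chebCoeff_rec (n j : ℕ) :
    ((n + 2 + (j + 1)).choose (2 * (j + 1)) + (n + 2 + (j + 1) - 1).choose (2 * (j + 1))) +
        ((n + (j + 1)).choose (2 * (j + 1)) + (n + (j + 1) - 1).choose (2 * (j + 1))) =
      2 * ((n + 1 + (j + 1)).choose (2 * (j + 1)) + (n + 1 + (j + 1) - 1).choose (2 * (j + 1))) +
        ((n + 1 + j).choose (2 * j) + (n + 1 + j - 1).choose (2 * j)) := by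
  have h1 : (n + j + 3).choose (2 * j + 2) + (n + j + 1).choose (2 * j + 2) =
      2 * (n + j + 2).choose (2 * j + 2) + (n + j + 1).choose (2 * j) :=
    choose_add_two (n + j + 1) (2 * j)
  have h2 : (n + j + 2).choose (2 * j + 2) + (n + j).choose (2 * j + 2) =
      2 * (n + j + 1).choose (2 * j + 2) + (n + j).choose (2 * j) :=
    choose_add_two (n + j) (2 * j)
  have e1 : n + 2 + (j + 1) = n + j + 3 := by omega
  have e2 : n + 2 + (j + 1) - 1 = n + j + 2 := by omega
  have e3 : 2 * (j + 1) = 2 * j + 2 := by omega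
  have e4 : n + (j + 1) = n + j + 1 := by omega
  have e5 : n + (j + 1) - 1 = n + j := by omega
  have e6 : n + 1 + (j + 1) = n + j + 2 := by omega
  have e7 : n + 1 + (j + 1) - 1 = n + j + 1 := by omega
  have e8 : n + 1 + j = n + j + 1 := by omega
  have e9 : n + 1 + j - 1 = n + j := by omega
  rw [e2, e1, e3, e5, e4, e7, e6, e9, e8]
  omega

/-- `G(n,0) = 2`. [folklore] -/
private theorem chebCoeff_zero (n : ℕ) : (n + 0).choose (2 * 0) + (n + 0 - 1).choose (2 * 0) = 2 := by
  simp

/-- `G(n,j) = 0` for `j > n`. [folklore] -/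
private theorem chebCoeff_eq_zero {n j : ℕ} (h : n < j) :
    (n + j).choose (2 * j) + (n + j - 1).choose (2 * j) = 0 := by
  rw [Nat.choose_eq_zero_of_lt (by omega), Nat.choose_eq_zero_of_lt (by omega)]

/-- `j G(n,j) = n C(n+j−1, 2j−1)` (`1 ≤ j ≤ n`). [folklore] -/
private theorem mul_chebCoeff_eq {n j : ℕ} (hj : 1 ≤ j) (hjn : j ≤ n) :
    j * ((n + j).choose (2 * j) + (n + j - 1).choose (2 * j)) = n * (n + j - 1).choose (2 * j - 1) := by
  have e1 := Nat.add_one_mul_choose_eq (n + j - 1) (2 * j - 1)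
  have e2 := Nat.choose_succ_right_eq (n + j - 1) (2 * j - 1)
  rw [show n + j - 1 + 1 = n + j by omega] at e1
  rw [show 2 * j - 1 + 1 = 2 * j by omega] at e1 e2
  rw [show n + j - 1 - (2 * j - 1) = n - j by omega] at e2
  -- `(n+j) C = C(n+j,2j)·2j`, `C(n+j−1,2j)·2j = C·(n−j)`
  zify [hjn] at e1 e2 ⊢
  linarith

/-- Extension of the range of summation past `n` (the added coefficients vanish). [folklore] -/
private theorem chebSum_extend (y : ℂ) {n N : ℕ} (h : n + 1 ≤ N) :
    ∑ j ∈ Finset.range (n + 1),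
        (-1 : ℂ) ^ j * (((n + j).choose (2 * j) + (n + j - 1).choose (2 * j) : ℕ) : ℂ) * y ^ j =
      ∑ j ∈ Finset.range N,
        (-1 : ℂ) ^ j * (((n + j).choose (2 * j) + (n + j - 1).choose (2 * j) : ℕ) : ℂ) * y ^ j := by
  refine Finset.sum_subset (Finset.range_subset_range.2 h) fun j hj hj' ↦ ?_
  rw [Finset.mem_range] at hj'
  rw [chebCoeff_eq_zero (by omega)]
  simp

/-- The recurrence step on the explicit sums over `range (n+3)`. [folklore] -/
private theorem chebSum_step (y : ℂ) (n : ℕ) :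
    ∑ j ∈ Finset.range (n + 3), (-1 : ℂ) ^ j *
          (((n + 2 + j).choose (2 * j) + (n + 2 + j - 1).choose (2 * j) : ℕ) : ℂ) * y ^ j =
      (2 - y) * ∑ j ∈ Finset.range (n + 3), (-1 : ℂ) ^ j *
          (((n + 1 + j).choose (2 * j) + (n + 1 + j - 1).choose (2 * j) : ℕ) : ℂ) * y ^ j -
        ∑ j ∈ Finset.range (n + 3), (-1 : ℂ) ^ j *
          (((n + j).choose (2 * j) + (n + j - 1).choose (2 * j) : ℕ) : ℂ) * y ^ j := by
  -- abbreviations for the three coefficient rows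
  set a2 : ℕ → ℂ := fun j ↦ (-1 : ℂ) ^ j *
    (((n + 2 + j).choose (2 * j) + (n + 2 + j - 1).choose (2 * j) : ℕ) : ℂ) * y ^ j with ha2
  set a1 : ℕ → ℂ := fun j ↦ (-1 : ℂ) ^ j *
    (((n + 1 + j).choose (2 * j) + (n + 1 + j - 1).choose (2 * j) : ℕ) : ℂ) * y ^ j with ha1
  set a0 : ℕ → ℂ := fun j ↦ (-1 : ℂ) ^ j *
    (((n + j).choose (2 * j) + (n + j - 1).choose (2 * j) : ℕ) : ℂ) * y ^ j with ha0
  -- the shifted termwise identity `a2 (j+1) + a0 (j+1) − 2 a1 (j+1) = −y a1 j`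
  have hk : ∀ j, a2 (j + 1) + a0 (j + 1) - 2 * a1 (j + 1) = -(y * a1 j) := by
    intro j
    have h' : ((((n + 2 + (j + 1)).choose (2 * (j + 1)) +
        (n + 2 + (j + 1) - 1).choose (2 * (j + 1)) : ℕ) : ℂ)) +
        ((((n + (j + 1)).choose (2 * (j + 1)) + (n + (j + 1) - 1).choose (2 * (j + 1)) : ℕ) : ℂ)) =
        2 * ((((n + 1 + (j + 1)).choose (2 * (j + 1)) +
          (n + 1 + (j + 1) - 1).choose (2 * (j + 1)) : ℕ) : ℂ)) +
        ((((n + 1 + j).choose (2 * j) + (n + 1 + j - 1).choose (2 * j) : ℕ) : ℂ)) := by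
      exact_mod_cast chebCoeff_rec n j
    show (-1 : ℂ) ^ (j + 1) * (((n + 2 + (j + 1)).choose (2 * (j + 1)) +
        (n + 2 + (j + 1) - 1).choose (2 * (j + 1)) : ℕ) : ℂ) * y ^ (j + 1) +
      (-1 : ℂ) ^ (j + 1) * (((n + (j + 1)).choose (2 * (j + 1)) +
        (n + (j + 1) - 1).choose (2 * (j + 1)) : ℕ) : ℂ) * y ^ (j + 1) -
      2 * ((-1 : ℂ) ^ (j + 1) * (((n + 1 + (j + 1)).choose (2 * (j + 1)) +
        (n + 1 + (j + 1) - 1).choose (2 * (j + 1)) : ℕ) : ℂ) * y ^ (j + 1)) =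
      -(y * ((-1 : ℂ) ^ j * (((n + 1 + j).choose (2 * j) + (n + 1 + j - 1).choose (2 * j) : ℕ) : ℂ) *
        y ^ j))
    rw [pow_succ, pow_succ]
    linear_combination ((-1) ^ j * (-1)) * (y ^ j * y) * h'
  -- constants: all three rows start with `2`
  have c2 : a2 0 = 2 := by norm_num [ha2]
  have c1 : a1 0 = 2 := by norm_num [ha1]
  have c0 : a0 0 = 2 := by norm_num [ha0]
  -- top term of the middle row vanishes
  have htop : a1 (n + 2) = 0 := by
    simp only [ha1]
    rw [show n + 1 + (n + 2) = (n + 1) + (n + 2) by rfl, chebCoeff_eq_zero (by omega)]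
    simp
  -- assemble
  have hL : ∑ j ∈ Finset.range (n + 3), a2 j + ∑ j ∈ Finset.range (n + 3), a0 j -
      2 * ∑ j ∈ Finset.range (n + 3), a1 j = -(y * ∑ j ∈ Finset.range (n + 2), a1 j) := by
    rw [Finset.mul_sum, ← Finset.sum_add_distrib, ← Finset.sum_sub_distrib,
      Finset.sum_range_succ', c2, c1, c0, Finset.mul_sum, ← Finset.sum_neg_distrib]
    rw [Finset.sum_congr rfl fun j _ ↦ hk j]
    ring
  have hR : y * ∑ j ∈ Finset.range (n + 3), a1 j = y * ∑ j ∈ Finset.range (n + 2), a1 j := by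
    rw [Finset.sum_range_succ, htop, add_zero]
  linear_combination hL + hR

/-- **The dilated Chebyshev identity**: for `A ≠ 0` and `y = 2 − A − A^{−1}`,
`A^n + A^{−n} = Σ_{j=0}^n (−1)^j [C(n+j,2j) + C(n+j−1,2j)] y^j` (i.e. `A^n + A^{−n} = 2 T_n(1 − y/2)`).
[cite: Voros2006, §2 p.3 («2 − 2T_n(1 − 1/(2x_k))»)] -/
theorem pow_add_inv_pow_eq_chebSum (A : ℂ) (hA : A ≠ 0) (n : ℕ) :
    A ^ n + A⁻¹ ^ n = ∑ j ∈ Finset.range (n + 1),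
      (-1 : ℂ) ^ j * (((n + j).choose (2 * j) + (n + j - 1).choose (2 * j) : ℕ) : ℂ) *
        (2 - A - A⁻¹) ^ j := by
  set y : ℂ := 2 - A - A⁻¹ with hy
  have hAA : A * A⁻¹ = 1 := mul_inv_cancel₀ hA
  -- two-step induction
  suffices H : ∀ n : ℕ, (A ^ n + A⁻¹ ^ n = ∑ j ∈ Finset.range (n + 1),
      (-1 : ℂ) ^ j * (((n + j).choose (2 * j) + (n + j - 1).choose (2 * j) : ℕ) : ℂ) * y ^ j) ∧
      (A ^ (n + 1) + A⁻¹ ^ (n + 1) = ∑ j ∈ Finset.range (n + 1 + 1),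
      (-1 : ℂ) ^ j * (((n + 1 + j).choose (2 * j) + (n + 1 + j - 1).choose (2 * j) : ℕ) : ℂ) *
        y ^ j) from (H n).1
  intro n
  induction n with
  | zero =>
    refine ⟨by norm_num, ?_⟩
    simp [Finset.sum_range_succ, hy]
    ring
  | succ n ih =>
    refine ⟨ih.2, ?_⟩
    have hrec : A ^ (n + 1 + 1) + A⁻¹ ^ (n + 1 + 1) =
        (2 - y) * (A ^ (n + 1) + A⁻¹ ^ (n + 1)) - (A ^ n + A⁻¹ ^ n) := by
      rw [hy, pow_succ, pow_succ, pow_succ, pow_succ]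
      linear_combination (-(A ^ n + A⁻¹ ^ n)) * hAA
    rw [hrec, ih.1, ih.2, chebSum_extend y (show n + 1 ≤ n + 3 by omega),
      chebSum_extend y (show n + 1 + 1 ≤ n + 3 by omega), show n + 1 + 1 + 1 = n + 3 by ring,
      show n + 1 + 1 = n + 2 by ring]
    exact (chebSum_step y n).symm

/-- The pair identity behind (LZS): for `ρ ≠ 0, 1` and `n ≥ 0`, with `y = 1/(ρ(1−ρ))`,
`[1 − (1−1/ρ)^n] + [1 − (1−1/(1−ρ))^n] = Σ_{j=1}^n (−1)^{j+1} [C(n+j,2j) + C(n+j−1,2j)] y^j`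
(`(1 − 1/(1−ρ)) = (1 − 1/ρ)^{−1}`, `2 − (1−1/ρ) − (1−1/(1−ρ)) = 1/(ρ(1−ρ))`).
[cite: Voros2006, §2 eq. (LZS) p.3] -/
theorem liPair_eq_chebSum {ρ : ℂ} (h0 : ρ ≠ 0) (h1 : ρ ≠ 1) (n : ℕ) :
    (1 - (1 - 1 / ρ) ^ n) + (1 - (1 - 1 / (1 - ρ)) ^ n) =
      ∑ j ∈ Finset.range n, (-1 : ℂ) ^ (j + 1 + 1) *
        (((n + (j + 1)).choose (2 * (j + 1)) + (n + (j + 1) - 1).choose (2 * (j + 1)) : ℕ) : ℂ) *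
          ((ρ * (1 - ρ))⁻¹) ^ (j + 1) := by
  have h1' : (1 : ℂ) - ρ ≠ 0 := sub_ne_zero.2 (Ne.symm h1)
  have hA : (1 - 1 / ρ : ℂ) ≠ 0 := by
    rw [sub_ne_zero, ne_comm, Ne, div_eq_one_iff_eq h0]; exact Ne.symm h1
  have hinv : (1 - 1 / ρ : ℂ)⁻¹ = 1 - 1 / (1 - ρ) := by
    have hρ1 : (ρ : ℂ) - 1 ≠ 0 := sub_ne_zero.2 h1
    field_simp
    ring
  have hy : (2 : ℂ) - (1 - 1 / ρ) - (1 - 1 / ρ)⁻¹ = (ρ * (1 - ρ))⁻¹ := by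
    rw [hinv]
    field_simp
    ring
  have h := pow_add_inv_pow_eq_chebSum (1 - 1 / ρ) hA n
  rw [hy, Finset.sum_range_succ'] at h
  simp only [pow_zero, mul_one, Nat.mul_zero, Nat.add_zero, Nat.choose_zero_right] at h
  rw [hinv] at h
  have e : ∀ j ∈ Finset.range n, (-1 : ℂ) ^ (j + 1 + 1) *
      (((n + (j + 1)).choose (2 * (j + 1)) + (n + (j + 1) - 1).choose (2 * (j + 1)) : ℕ) : ℂ) *
        ((ρ * (1 - ρ))⁻¹) ^ (j + 1) =
      -((-1 : ℂ) ^ (j + 1) *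
        (((n + (j + 1)).choose (2 * (j + 1)) + (n + (j + 1) - 1).choose (2 * (j + 1)) : ℕ) : ℂ) *
          ((ρ * (1 - ρ))⁻¹) ^ (j + 1)) := fun j _ ↦ by rw [pow_succ]; ring
  rw [Finset.sum_congr rfl e, Finset.sum_neg_distrib]
  have : ((n - 1).choose 0 : ℕ) = 1 := Nat.choose_zero_right _
  push_cast [this] at h ⊢
  linear_combination -h

end Chebyshev

/-! ## Voros 2006, (LZS) and its inverse: `λ_n` versus the secondary zeta values `Z(j)` -/

section ExactForms

/-- `Σ_ρ m(ρ) |ρ(1−ρ)|^{−j} < ∞` for `j ≥ 1` (`|ρ(1−ρ)| ≥ 14² > 1`, comparison with the tree's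
`Σ ‖m(ρ)/(ρ(ρ−1))‖ < ∞`). [folklore] -/
private theorem summable_zeroOrder_mul_inv_pow {j : ℕ} (hj : 1 ≤ j) :
    Summable fun ρ : ZetaZeros.riemannZetaNontrivialZeros ↦
      (riemannZetaZeroOrder (ρ : ℂ) : ℂ) * ((((ρ : ℂ)) * (1 - ρ))⁻¹) ^ j := by
  have hS := ZetaZeroSum.summable_norm_zeroOrder_mul_recipWeight
  refine Summable.of_norm_bounded hS fun ρ ↦ ?_
  have hm := FordL33.order_pos ρ
  have h14 := FordL33.fourteen_lt_norm ρ
  have h14' : 14 < ‖1 - (ρ : ℂ)‖ := by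
    have h := FordL33.fourteen_lt_abs_im ρ
    have h2 : |(1 - (ρ : ℂ)).im| ≤ ‖1 - (ρ : ℂ)‖ := Complex.abs_im_le_norm _
    rw [Complex.sub_im, Complex.one_im, zero_sub, abs_neg] at h2
    linarith
  have hx1 : 1 ≤ ‖(ρ : ℂ)‖ * ‖1 - (ρ : ℂ)‖ := by nlinarith
  rw [norm_mul, Complex.norm_intCast, abs_of_pos hm, norm_mul, Complex.norm_intCast, abs_of_pos hm,
    ZetaZeroSum.norm_recipWeight, norm_pow, norm_inv, norm_mul, ← norm_sub_rev (1 : ℂ) (ρ : ℂ)]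
  refine mul_le_mul_of_nonneg_left ?_ hm.le
  rw [one_div, inv_pow]
  exact inv_anti₀ (by positivity) (le_self_pow₀ hx1 (Nat.one_le_iff_ne_zero.1 hj))

/-- Box sums of `m(ρ)(ρ(1−ρ))^{−j}` converge to `2 Z(j)` (`j ≥ 1`). [cite: Voros2006, §1 eq. (ZDef) p.2] -/
theorem tendsto_finsum_liZeroBox_inv_pow {j : ℕ} (hj : 1 ≤ j) :
    Tendsto (fun T : ℝ ↦ ∑ᶠ ρ ∈ liZeroBox T,
        (riemannZetaZeroOrder ρ : ℂ) * ((ρ * (1 - ρ))⁻¹) ^ j) atTop (𝓝 (2 * vorosZ j)) := by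
  set f : ZetaZeros.riemannZetaNontrivialZeros → ℂ := fun ρ ↦
    (riemannZetaZeroOrder (ρ : ℂ) : ℂ) * ((((ρ : ℂ)) * (1 - ρ))⁻¹) ^ j with hf
  have hs : Summable f := summable_zeroOrder_mul_inv_pow hj
  have h2 : Tendsto (fun T ↦ ∑ ρ ∈ weilZeroFinset T, f ρ) atTop (𝓝 (∑' ρ, f ρ)) :=
    hs.hasSum.comp tendsto_weilZeroFinset
  have h3 : ∀ T, ∑ᶠ ρ ∈ liZeroBox T, (riemannZetaZeroOrder ρ : ℂ) * ((ρ * (1 - ρ))⁻¹) ^ j =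
      ∑ ρ ∈ weilZeroFinset T, f ρ := by
    intro T
    rw [liZeroBox_eq_weilZeroIndex',
      ZetaZeroSum.finsum_mem_weilZeroIndex_eq_sum
        (fun ρ : ℂ ↦ (riemannZetaZeroOrder ρ : ℂ) * ((ρ * (1 - ρ))⁻¹) ^ j) T]
  have h4 : 2 * vorosZ j = ∑' ρ, f ρ := by
    simp only [vorosZ, hf]
    ring
  rw [h4]
  exact h2.congr fun T ↦ (h3 T).symm

/-- **Discharge of `Voros2006_eqLZS`** ([Voros2006] §2 eq. (LZS) p.3): for `n ≥ 1`,
`λ_n = −n Σ_{j=1}^n ((−1)^j/j) C(n+j−1, 2j−1) Z(j)`.  Route: the tree's box-limit zero sum for `λ_n`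
(`keiperLiCoeff_eq_zero_sum_holds`), written over the Hadamard pairs `{ρ, 1−ρ}`
(`IsHadamardSeq.finsum_liZeroBox_eq_sum`); per pair the dilated Chebyshev identity
`[1−(1−1/ρ)^n] + [1−(1−1/(1−ρ))^n] = Σ_{j=1}^n (−1)^{j+1}[C(n+j,2j)+C(n+j−1,2j)] (ρ(1−ρ))^{−j}`
(`liPair_eq_chebSum`), whose box sums converge to the `Z(j)` (`tendsto_finsum_liZeroBox_inv_pow`);
finally `j[C(n+j,2j)+C(n+j−1,2j)] = n C(n+j−1,2j−1)`. [cite: Voros2006, §2 eq. (LZS) p.3] -/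
theorem Voros2006_eqLZS_holds : Voros2006_eqLZS := by
  intro n hn
  classical
  obtain ⟨b, hb⟩ := exists_isHadamardSeq 0
  set K : ℝ → Finset ℕ := fun T ↦ (hb.finite_setOf_abs_im_xiZero_le T).toFinset with hKdef
  have hK : ∀ T k, k ∈ K T ↔ b k ≠ 0 ∧ |(IsHadamardSeq.xiZero b k).im| ≤ T := fun T k ↦ by
    simp [hKdef, Set.Finite.mem_toFinset]
  -- the coefficients `c_j = (−1)^{j+2} G(n, j+1)`, `j < n`
  set c : ℕ → ℂ := fun j ↦ (-1 : ℂ) ^ (j + 1 + 1) *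
    (((n + (j + 1)).choose (2 * (j + 1)) + (n + (j + 1) - 1).choose (2 * (j + 1)) : ℕ) : ℂ) with hc
  have hlam := keiperLiCoeff_eq_zero_sum_holds n hn
  -- the box sums, pair by pair
  have hbox : ∀ T, ∑ᶠ ρ ∈ liZeroBox T, (riemannZetaZeroOrder ρ : ℂ) * (1 - (1 - 1 / ρ) ^ n) =
      ∑ j ∈ Finset.range n, c j * (1 / 2 * ∑ᶠ ρ ∈ liZeroBox T,
        (riemannZetaZeroOrder ρ : ℂ) * ((ρ * (1 - ρ))⁻¹) ^ (j + 1)) := by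
    intro T
    rw [hb.finsum_liZeroBox_eq_sum (fun ρ ↦ 1 - (1 - 1 / ρ) ^ n) T (K T) (hK T)]
    have hp : ∀ k ∈ K T, (1 - (1 - 1 / IsHadamardSeq.xiZero b k) ^ n) +
        (1 - (1 - 1 / (1 - IsHadamardSeq.xiZero b k)) ^ n) =
        ∑ j ∈ Finset.range n, c j * ((IsHadamardSeq.xiZero b k * (1 - IsHadamardSeq.xiZero b k))⁻¹) ^
          (j + 1) := by
      intro k hk
      have hk' := ((hK T k).1 hk).1
      have hz := hb.riemannZeta_xiZero hk'
      have h0 : IsHadamardSeq.xiZero b k ≠ 0 := fun e ↦ by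
        have := hz.2.1; rw [e] at this; simp at this
      have h1 : IsHadamardSeq.xiZero b k ≠ 1 := fun e ↦ by
        have := hz.2.2; rw [e] at this; simp at this
      rw [liPair_eq_chebSum h0 h1 n]
    rw [Finset.sum_congr rfl hp, Finset.sum_comm]
    refine Finset.sum_congr rfl fun j _ ↦ ?_
    rw [hb.finsum_liZeroBox_eq_sum (fun ρ ↦ ((ρ * (1 - ρ))⁻¹) ^ (j + 1)) T (K T) (hK T),
      ← Finset.mul_sum]
    congr 1
    rw [Finset.mul_sum]
    refine Finset.sum_congr rfl fun k _ ↦ ?_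
    have e : (1 - IsHadamardSeq.xiZero b k) * (1 - (1 - IsHadamardSeq.xiZero b k)) =
        IsHadamardSeq.xiZero b k * (1 - IsHadamardSeq.xiZero b k) := by ring
    rw [e]
    ring
  -- the limit of the right-hand side
  have hlim : Tendsto (fun T : ℝ ↦ ∑ j ∈ Finset.range n, c j * (1 / 2 * ∑ᶠ ρ ∈ liZeroBox T,
        (riemannZetaZeroOrder ρ : ℂ) * ((ρ * (1 - ρ))⁻¹) ^ (j + 1))) atTop
      (𝓝 (∑ j ∈ Finset.range n, c j * (1 / 2 * (2 * vorosZ (j + 1))))) :=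
    tendsto_finsetSum (Finset.range n)
      (f := fun j T ↦ c j * (1 / 2 * ∑ᶠ ρ ∈ liZeroBox T,
        (riemannZetaZeroOrder ρ : ℂ) * ((ρ * (1 - ρ))⁻¹) ^ (j + 1)))
      (a := fun j ↦ c j * (1 / 2 * (2 * vorosZ (j + 1)))) fun j _ ↦
      ((tendsto_finsum_liZeroBox_inv_pow (j := j + 1) (by omega)).const_mul (1 / 2)).const_mul (c j)
  have hEq := tendsto_nhds_unique (hlam.congr hbox) hlim
  rw [hEq, ← Finset.Ico_add_one_right_eq_Icc, Finset.sum_Ico_eq_sum_range, Nat.add_sub_cancel,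
    Finset.mul_sum]
  refine Finset.sum_congr rfl fun k hk ↦ ?_
  rw [Finset.mem_range] at hk
  rw [Nat.add_comm 1 k]
  have hq : (((k + 1 : ℕ) : ℂ)) * (((n + k + 1).choose (2 * (k + 1)) +
      (n + k + 1 - 1).choose (2 * (k + 1)) : ℕ) : ℂ) =
      (n : ℂ) * (((n + k + 1 - 1).choose (2 * (k + 1) - 1) : ℕ) : ℂ) := by
    have h := mul_chebCoeff_eq (n := n) (j := k + 1) (by omega) (by omega)
    rw [show n + (k + 1) = n + k + 1 by omega] at h
    exact_mod_cast h
  have hk0 : (((k + 1 : ℕ) : ℂ)) ≠ 0 := by exact_mod_cast Nat.succ_ne_zero k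
  simp only [hc]
  rw [show n + (k + 1) = n + k + 1 by omega, div_eq_mul_inv, pow_succ (-1 : ℂ) (k + 1)]
  field_simp
  linear_combination (-vorosZ (k + 1)) * hq

end ExactForms

section InverseChebyshev

/-- **The inverse dilated Chebyshev identity**: for `A ≠ 0` and `y = 2 − A − A^{−1} = −A^{−1}(A−1)²`,
`y^j = C(2j,j) + Σ_{n=1}^j (−1)^n C(2j, j−n) (A^n + A^{−n})` (binomial expansion of `(A−1)^{2j}`,
terms `k = j ± n` paired). [cite: Voros2006, §2 p.3 (third remark, inverse of (LZS))] -/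
theorem chebArg_pow_eq_sum (A : ℂ) (hA : A ≠ 0) (j : ℕ) :
    (2 - A - A⁻¹) ^ j = (((2 * j).choose j : ℕ) : ℂ) +
      ∑ m ∈ Finset.range j, (-1 : ℂ) ^ (m + 1) * (((2 * j).choose (j - (m + 1)) : ℕ) : ℂ) *
        (A ^ (m + 1) + A⁻¹ ^ (m + 1)) := by
  have hAA : A * A⁻¹ = 1 := mul_inv_cancel₀ hA
  have hy : (2 : ℂ) - A - A⁻¹ = (-1) * (A⁻¹ * (A + (-1)) ^ 2) := by
    field_simp
    ring
  rw [hy, mul_pow, mul_pow, ← pow_mul, add_pow, Finset.mul_sum, Finset.mul_sum,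
    show 2 * j + 1 = j + (j + 1) by ring, Finset.sum_range_add, Finset.sum_range_succ',
    ← Finset.sum_range_reflect]
  -- the three pieces: `k = j−1−m`, `k = j+1+m`, `k = j`
  have hmid : (-1 : ℂ) ^ j * (A⁻¹ ^ j * (A ^ (j + 0) * (-1) ^ (2 * j - (j + 0)) *
      (((2 * j).choose (j + 0) : ℕ) : ℂ))) = (((2 * j).choose j : ℕ) : ℂ) := by
    rw [Nat.add_zero, show 2 * j - j = j by omega]
    have e : (-1 : ℂ) ^ j * (-1) ^ j = 1 := by rw [← mul_pow]; norm_num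
    have e' : A⁻¹ ^ j * A ^ j = 1 := by rw [← mul_pow, inv_mul_cancel₀ hA, one_pow]
    linear_combination (((2 * j).choose j : ℕ) : ℂ) * ((-1 : ℂ) ^ j * (-1) ^ j) * e' +
      (((2 * j).choose j : ℕ) : ℂ) * e
  have hlow : ∀ m ∈ Finset.range j, (-1 : ℂ) ^ j * (A⁻¹ ^ j * (A ^ (j - 1 - m) *
      (-1) ^ (2 * j - (j - 1 - m)) * (((2 * j).choose (j - 1 - m) : ℕ) : ℂ))) =
      (-1 : ℂ) ^ (m + 1) * (((2 * j).choose (j - (m + 1)) : ℕ) : ℂ) * A⁻¹ ^ (m + 1) := by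
    intro m hm
    rw [Finset.mem_range] at hm
    have e1 : 2 * j - (j - 1 - m) = j + 1 + m := by omega
    have e2 : j - 1 - m = j - (m + 1) := by omega
    have e3 : A⁻¹ ^ j = A⁻¹ ^ (j - (m + 1)) * A⁻¹ ^ (m + 1) := by
      rw [← pow_add, show j - (m + 1) + (m + 1) = j by omega]
    have e4 : A⁻¹ ^ (j - (m + 1)) * A ^ (j - (m + 1)) = 1 := by
      rw [← mul_pow, inv_mul_cancel₀ hA, one_pow]
    have e5 : (-1 : ℂ) ^ j * (-1) ^ (j + 1 + m) = (-1) ^ (m + 1) := by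
      rw [← pow_add, show j + (j + 1 + m) = (m + 1) + 2 * j by omega, pow_add, pow_mul]
      norm_num
    rw [e1, e2, e3]
    linear_combination ((-1 : ℂ) ^ (m + 1) * (((2 * j).choose (j - (m + 1)) : ℕ) : ℂ) *
        A⁻¹ ^ (m + 1)) * e4 * 0 +
      (A⁻¹ ^ (j - (m + 1)) * A ^ (j - (m + 1))) * A⁻¹ ^ (m + 1) *
        (((2 * j).choose (j - (m + 1)) : ℕ) : ℂ) * e5 +
      (-1 : ℂ) ^ (m + 1) * (((2 * j).choose (j - (m + 1)) : ℕ) : ℂ) * A⁻¹ ^ (m + 1) * e4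
  have hup : ∀ m ∈ Finset.range j, (-1 : ℂ) ^ j * (A⁻¹ ^ j * (A ^ (j + (m + 1)) *
      (-1) ^ (2 * j - (j + (m + 1))) * (((2 * j).choose (j + (m + 1)) : ℕ) : ℂ))) =
      (-1 : ℂ) ^ (m + 1) * (((2 * j).choose (j - (m + 1)) : ℕ) : ℂ) * A ^ (m + 1) := by
    intro m hm
    rw [Finset.mem_range] at hm
    have e1 : 2 * j - (j + (m + 1)) = j - 1 - m := by omega
    have e2 : (2 * j).choose (j + (m + 1)) = (2 * j).choose (j - (m + 1)) := by
      rw [← Nat.choose_symm (by omega : j + (m + 1) ≤ 2 * j)]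
      congr 1
      omega
    have e4 : A⁻¹ ^ j * A ^ j = 1 := by rw [← mul_pow, inv_mul_cancel₀ hA, one_pow]
    have e5 : (-1 : ℂ) ^ j * (-1) ^ (j - 1 - m) = (-1) ^ (m + 1) := by
      rw [← pow_add, show j + (j - 1 - m) = (m + 1) + 2 * (j - 1 - m) by omega, pow_add, pow_mul]
      norm_num
    rw [e1, e2, pow_add]
    linear_combination (A ^ (m + 1) * (((2 * j).choose (j - (m + 1)) : ℕ) : ℂ)) *
        ((-1 : ℂ) ^ j * (-1) ^ (j - 1 - m)) * e4 +
      (((2 * j).choose (j - (m + 1)) : ℕ) : ℂ) * A ^ (m + 1) * e5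
  rw [hmid, Finset.sum_congr rfl hlow, Finset.sum_congr rfl hup]
  rw [show ∑ m ∈ Finset.range j, (-1 : ℂ) ^ (m + 1) * (((2 * j).choose (j - (m + 1)) : ℕ) : ℂ) *
      (A ^ (m + 1) + A⁻¹ ^ (m + 1)) =
      ∑ m ∈ Finset.range j, (-1 : ℂ) ^ (m + 1) * (((2 * j).choose (j - (m + 1)) : ℕ) : ℂ) *
        A ^ (m + 1) +
      ∑ m ∈ Finset.range j, (-1 : ℂ) ^ (m + 1) * (((2 * j).choose (j - (m + 1)) : ℕ) : ℂ) *
        A⁻¹ ^ (m + 1) from by rw [← Finset.sum_add_distrib]; exact Finset.sum_congr rfl fun _ _ ↦ by ring]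
  ring

/-- The pair identity behind the inverse relation: for `ρ ≠ 0, 1`, `j ≥ 1`, `y = 1/(ρ(1−ρ))`,
`y^j = Σ_{n=1}^j (−1)^{n+1} C(2j, j−n) ([1 − (1−1/ρ)^n] + [1 − (1−1/(1−ρ))^n])` (the constant
`C(2j,j)` is absorbed by the same identity at `A = 1`, where `y = 0`).
[cite: Voros2006, §2 p.3 (third remark, inverse of (LZS))] -/
theorem chebArg_pow_eq_liPairSum {ρ : ℂ} (h0 : ρ ≠ 0) (h1 : ρ ≠ 1) {j : ℕ} (hj : 1 ≤ j) :
    ((ρ * (1 - ρ))⁻¹) ^ j = ∑ m ∈ Finset.range j,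
      (-1 : ℂ) ^ (m + 1 + 1) * (((2 * j).choose (j - (m + 1)) : ℕ) : ℂ) *
        ((1 - (1 - 1 / ρ) ^ (m + 1)) + (1 - (1 - 1 / (1 - ρ)) ^ (m + 1))) := by
  have h1' : (1 : ℂ) - ρ ≠ 0 := sub_ne_zero.2 (Ne.symm h1)
  have hA : (1 - 1 / ρ : ℂ) ≠ 0 := by
    rw [sub_ne_zero, ne_comm, Ne, div_eq_one_iff_eq h0]; exact Ne.symm h1
  have hinv : (1 - 1 / ρ : ℂ)⁻¹ = 1 - 1 / (1 - ρ) := by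
    have hρ1 : (ρ : ℂ) - 1 ≠ 0 := sub_ne_zero.2 h1
    field_simp
    ring
  have hy : (2 : ℂ) - (1 - 1 / ρ) - (1 - 1 / ρ)⁻¹ = (ρ * (1 - ρ))⁻¹ := by
    rw [hinv]
    field_simp
    ring
  have h := chebArg_pow_eq_sum (1 - 1 / ρ) hA j
  rw [hy, hinv] at h
  -- the same identity at `A = 1` kills the constant
  have hone := chebArg_pow_eq_sum 1 one_ne_zero j
  simp only [inv_one, one_pow, show (2 : ℂ) - 1 - 1 = 0 by norm_num,
    zero_pow (by omega : j ≠ 0)] at hone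
  rw [h]
  have e : ∀ m ∈ Finset.range j, (-1 : ℂ) ^ (m + 1 + 1) * (((2 * j).choose (j - (m + 1)) : ℕ) : ℂ) *
      ((1 - (1 - 1 / ρ) ^ (m + 1)) + (1 - (1 - 1 / (1 - ρ)) ^ (m + 1))) =
      (-1 : ℂ) ^ (m + 1) * (((2 * j).choose (j - (m + 1)) : ℕ) : ℂ) *
        ((1 - 1 / ρ) ^ (m + 1) + (1 - 1 / (1 - ρ)) ^ (m + 1)) -
      (-1 : ℂ) ^ (m + 1) * (((2 * j).choose (j - (m + 1)) : ℕ) : ℂ) * (1 + 1) := by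
    intro m _
    rw [pow_succ (-1 : ℂ) (m + 1)]
    ring
  rw [Finset.sum_congr rfl e, Finset.sum_sub_distrib]
  linear_combination -hone

/-- **Discharge of `Voros2006_eqZinv`** ([Voros2006] §2, third remark p.3: «conversely,
`Z(j) = Σ_{n=1}^j (−1)^{n+1} C(2j, j−n) λ_n`»).  Route: `2 Z(j) = lim_T Σ_{box} m(ρ)(ρ(1−ρ))^{−j}`
(`tendsto_finsum_liZeroBox_inv_pow`); over the Hadamard pairs the summand is
`Σ_n (−1)^{n+1} C(2j,j−n) ([1−(1−1/ρ)^n] + [1−(1−1/(1−ρ))^n])` (`chebArg_pow_eq_liPairSum`), and the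
box sums of the latter converge to `λ_n` (`keiperLiCoeff_eq_zero_sum_holds`).
[cite: Voros2006, §2 p.3 (third remark, inverse of (LZS))] -/
theorem Voros2006_eqZinv_holds : Voros2006_eqZinv := by
  intro j hj
  classical
  obtain ⟨b, hb⟩ := exists_isHadamardSeq 0
  set K : ℝ → Finset ℕ := fun T ↦ (hb.finite_setOf_abs_im_xiZero_le T).toFinset with hKdef
  have hK : ∀ T k, k ∈ K T ↔ b k ≠ 0 ∧ |(IsHadamardSeq.xiZero b k).im| ≤ T := fun T k ↦ by
    simp [hKdef, Set.Finite.mem_toFinset]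
  set c : ℕ → ℂ := fun m ↦ (-1 : ℂ) ^ (m + 1 + 1) * (((2 * j).choose (j - (m + 1)) : ℕ) : ℂ)
    with hc
  have hZ := tendsto_finsum_liZeroBox_inv_pow hj
  -- the box sums, pair by pair
  have hbox : ∀ T, ∑ᶠ ρ ∈ liZeroBox T, (riemannZetaZeroOrder ρ : ℂ) * ((ρ * (1 - ρ))⁻¹) ^ j =
      ∑ m ∈ Finset.range j, (2 * c m) * ∑ᶠ ρ ∈ liZeroBox T,
        (riemannZetaZeroOrder ρ : ℂ) * (1 - (1 - 1 / ρ) ^ (m + 1)) := by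
    intro T
    rw [hb.finsum_liZeroBox_eq_sum (fun ρ ↦ ((ρ * (1 - ρ))⁻¹) ^ j) T (K T) (hK T)]
    have hp : ∀ k ∈ K T, ((IsHadamardSeq.xiZero b k * (1 - IsHadamardSeq.xiZero b k))⁻¹) ^ j +
        (((1 - IsHadamardSeq.xiZero b k) * (1 - (1 - IsHadamardSeq.xiZero b k)))⁻¹) ^ j =
        ∑ m ∈ Finset.range j, (2 * c m) *
          ((1 - (1 - 1 / IsHadamardSeq.xiZero b k) ^ (m + 1)) +
            (1 - (1 - 1 / (1 - IsHadamardSeq.xiZero b k)) ^ (m + 1))) := by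
      intro k hk
      have hk' := ((hK T k).1 hk).1
      have hz := hb.riemannZeta_xiZero hk'
      have h0 : IsHadamardSeq.xiZero b k ≠ 0 := fun e ↦ by
        have := hz.2.1; rw [e] at this; simp at this
      have h1 : IsHadamardSeq.xiZero b k ≠ 1 := fun e ↦ by
        have := hz.2.2; rw [e] at this; simp at this
      have e : (1 - IsHadamardSeq.xiZero b k) * (1 - (1 - IsHadamardSeq.xiZero b k)) =
          IsHadamardSeq.xiZero b k * (1 - IsHadamardSeq.xiZero b k) := by ring
      rw [e, chebArg_pow_eq_liPairSum h0 h1 hj, ← two_mul, Finset.mul_sum]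
      refine Finset.sum_congr rfl fun m _ ↦ ?_
      simp only [hc]
      ring
    rw [Finset.sum_congr rfl hp, Finset.sum_comm]
    refine Finset.sum_congr rfl fun m _ ↦ ?_
    rw [hb.finsum_liZeroBox_eq_sum (fun ρ ↦ 1 - (1 - 1 / ρ) ^ (m + 1)) T (K T) (hK T),
      Finset.mul_sum]
  have hlim : Tendsto (fun T : ℝ ↦ ∑ m ∈ Finset.range j, (2 * c m) * ∑ᶠ ρ ∈ liZeroBox T,
        (riemannZetaZeroOrder ρ : ℂ) * (1 - (1 - 1 / ρ) ^ (m + 1))) atTop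
      (𝓝 (∑ m ∈ Finset.range j, (2 * c m) * (keiperLiCoeff (m + 1) : ℂ))) :=
    tendsto_finsetSum (Finset.range j)
      (f := fun m T ↦ (2 * c m) * ∑ᶠ ρ ∈ liZeroBox T,
        (riemannZetaZeroOrder ρ : ℂ) * (1 - (1 - 1 / ρ) ^ (m + 1)))
      (a := fun m ↦ (2 * c m) * (keiperLiCoeff (m + 1) : ℂ)) fun m _ ↦
      (keiperLiCoeff_eq_zero_sum_holds (m + 1) (by omega)).const_mul (2 * c m)
  have hEq := tendsto_nhds_unique (hZ.congr hbox) hlim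
  have hZj : vorosZ j = ∑ m ∈ Finset.range j, c m * (keiperLiCoeff (m + 1) : ℂ) := by
    have h2 : (2 : ℂ) * vorosZ j = 2 * ∑ m ∈ Finset.range j, c m * (keiperLiCoeff (m + 1) : ℂ) := by
      rw [hEq, Finset.mul_sum]
      exact Finset.sum_congr rfl fun _ _ ↦ by ring
    exact mul_left_cancel₀ two_ne_zero h2
  rw [hZj, ← Finset.Ico_add_one_right_eq_Icc, Finset.sum_Ico_eq_sum_range, Nat.add_sub_cancel]
  refine Finset.sum_congr rfl fun m _ ↦ ?_
  rw [Nat.add_comm 1 m]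

end InverseChebyshev

/-! ## Coffey 2008, eq. (3.1): the Stieltjes constants are the Laurent coefficients of `ζ` at `1` -/

section Stieltjes

/-! ### The Abel kernel and its regularity (verbatim from `BombieriLagariasEtaIdentification.lean`,
where these lemmas are private) -/

/-- The Abel kernel `w_N(u) = (N+1)^{−u} − (N+2)^{−u}`. [folklore] -/
private theorem kernel_nonnegSt {u : ℝ} (hu : 0 ≤ u) (N : ℕ) :
    0 ≤ ((N : ℝ) + 1) ^ (-u) - ((N : ℝ) + 2) ^ (-u) := by
  rw [Real.rpow_neg (by positivity), Real.rpow_neg (by positivity), sub_nonneg]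
  exact inv_anti₀ (Real.rpow_pos_of_pos (by positivity) _)
    (Real.rpow_le_rpow (by positivity) (by linarith) hu)

/-- Partial sums of the kernel telescope: `Σ_{N<M} w_N(u) = 1 − (M+1)^{−u}`. [folklore] -/
private theorem sum_kernelSt (u : ℝ) (M : ℕ) :
    ∑ N ∈ Finset.range M, (((N : ℝ) + 1) ^ (-u) - ((N : ℝ) + 2) ^ (-u)) = 1 - ((M : ℝ) + 1) ^ (-u) := by
  induction M with
  | zero => simp
  | succ M ih =>
    rw [Finset.sum_range_succ, ih]
    push_cast
    ring

/-- The kernel sums to `1` for `u > 0`. [folklore] -/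
private theorem hasSum_kernelSt {u : ℝ} (hu : 0 < u) :
    HasSum (fun N : ℕ ↦ ((N : ℝ) + 1) ^ (-u) - ((N : ℝ) + 2) ^ (-u)) 1 := by
  rw [hasSum_iff_tendsto_nat_of_nonneg (kernel_nonnegSt hu.le)]
  simp_rw [sum_kernelSt]
  have h : Tendsto (fun M : ℕ ↦ ((M : ℝ) + 1) ^ (-u)) atTop (𝓝 0) := by
    have h1 : Tendsto (fun x : ℝ ↦ x ^ (-u)) atTop (𝓝 0) := tendsto_rpow_neg_atTop hu
    have h2 : Tendsto (fun M : ℕ ↦ (M : ℝ) + 1) atTop atTop :=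
      tendsto_atTop_add_const_right _ 1 tendsto_natCast_atTop_atTop
    exact h1.comp h2
  simpa using (tendsto_const_nhds (x := (1 : ℝ))).sub h

/-- **Abelian step (Toeplitz for the kernel `w_N(u)`)**: if `G(N) → L` then
`Σ_N G(N+1) w_N(u) → L` as `u → 0⁺`. [folklore] -/
private theorem tendsto_tsum_kernel_mulSt {G : ℕ → ℝ} {L : ℝ} (hG : Tendsto G atTop (𝓝 L)) :
    Tendsto (fun u : ℝ ↦ ∑' N : ℕ, (((N : ℝ) + 1) ^ (-u) - ((N : ℝ) + 2) ^ (-u)) * G (N + 1))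
      (𝓝[>] 0) (𝓝 L) := by
  -- `G` is bounded
  obtain ⟨B, hB⟩ : ∃ B, ∀ N, |G N - L| ≤ B := by
    obtain ⟨B, hBev⟩ : ∃ b, ∀ᶠ N in atTop, |G N - L| ≤ b := ((hG.sub_const L).abs).isBoundedUnder_le
    obtain ⟨N₀, hN₀⟩ := Filter.eventually_atTop.1 hBev
    refine ⟨max B (Finset.sup' (Finset.range (N₀ + 1)) ⟨0, by simp⟩ fun N ↦ |G N - L|), fun N ↦ ?_⟩
    rcases le_or_gt N₀ N with h | h
    · exact (hN₀ N h).trans (le_max_left _ _)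
    · refine le_trans ?_ (le_max_right _ _)
      exact Finset.le_sup' (fun N ↦ |G N - L|) (Finset.mem_range.2 (by omega))
  have hB0 : 0 ≤ B := (abs_nonneg _).trans (hB 0)
  rw [Metric.tendsto_nhdsWithin_nhds]
  intro ε hε
  -- `N₀` with `|G(N+1) − L| ≤ ε/2` for `N ≥ N₀`
  have hε2 : 0 < ε / 2 := by linarith
  obtain ⟨N₀, hN₀⟩ := Filter.eventually_atTop.1 (Metric.tendsto_nhds.1 hG (ε / 2) hε2)
  -- `δ` with `(B+1)(1 − (N₀+1)^{−u}) < ε/2` for `0 < u < δ`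
  have hcont : ContinuousAt (fun u : ℝ ↦ (B + 1) * (1 - ((N₀ : ℝ) + 1) ^ (-u))) 0 := by
    have : ContinuousAt (fun u : ℝ ↦ ((N₀ : ℝ) + 1) ^ (-u)) 0 :=
      ContinuousAt.rpow continuousAt_const (continuousAt_neg) (Or.inl (by positivity))
    exact continuousAt_const.mul (continuousAt_const.sub this)
  obtain ⟨δ, hδ, hδε⟩ := Metric.continuousAt_iff.1 hcont (ε / 2) hε2
  refine ⟨δ, hδ, fun u hu hdist ↦ ?_⟩
  have hu : 0 < u := hu
  have hsmall : (B + 1) * (1 - ((N₀ : ℝ) + 1) ^ (-u)) < ε / 2 := by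
    have := hδε hdist
    rw [neg_zero, Real.rpow_zero, sub_self, mul_zero, Real.dist_eq, sub_zero] at this
    exact lt_of_abs_lt this
  -- summability
  set w : ℕ → ℝ := fun N ↦ ((N : ℝ) + 1) ^ (-u) - ((N : ℝ) + 2) ^ (-u) with hw
  have hwsum : HasSum w 1 := hasSum_kernelSt hu
  have hw0 : ∀ N, 0 ≤ w N := kernel_nonnegSt hu.le
  have hsumm : Summable fun N ↦ w N * (G (N + 1) - L) := by
    refine Summable.of_norm_bounded (g := fun N ↦ B * w N) (hwsum.summable.mul_left B) fun N ↦ ?_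
    rw [Real.norm_eq_abs, abs_mul, abs_of_nonneg (hw0 N), mul_comm]
    exact mul_le_mul_of_nonneg_right (hB _) (hw0 N)
  have hsplit : ∑' N, w N * G (N + 1) = L + ∑' N, w N * (G (N + 1) - L) := by
    have h1 : ∑' N, w N * G (N + 1) = ∑' N, (w N * (G (N + 1) - L) + L * w N) := by
      congr 1; funext N; ring
    rw [h1, (hsumm.hasSum.add (hwsum.mul_left L)).tsum_eq]
    ring
  rw [Real.dist_eq, hsplit, add_sub_cancel_left]
  -- split the error sum at `N₀`
  have htail : ∑' N, w N * (G (N + 1) - L) =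
      ∑ N ∈ Finset.range N₀, w N * (G (N + 1) - L) + ∑' N, w (N + N₀) * (G (N + N₀ + 1) - L) := by
    rw [← Summable.sum_add_tsum_nat_add N₀ hsumm]
  rw [htail]
  have h1 : |∑ N ∈ Finset.range N₀, w N * (G (N + 1) - L)| ≤ B * (1 - ((N₀ : ℝ) + 1) ^ (-u)) := by
    calc |∑ N ∈ Finset.range N₀, w N * (G (N + 1) - L)|
        ≤ ∑ N ∈ Finset.range N₀, |w N * (G (N + 1) - L)| := Finset.abs_sum_le_sum_abs _ _
      _ ≤ ∑ N ∈ Finset.range N₀, w N * B := Finset.sum_le_sum fun N _ ↦ by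
          rw [abs_mul, abs_of_nonneg (hw0 N)]
          exact mul_le_mul_of_nonneg_left (hB _) (hw0 N)
      _ = B * (1 - ((N₀ : ℝ) + 1) ^ (-u)) := by
          rw [← Finset.sum_mul, mul_comm, hw, sum_kernelSt]
  have h2 : |∑' N, w (N + N₀) * (G (N + N₀ + 1) - L)| ≤ ε / 2 := by
    have hs2 : Summable fun N ↦ w (N + N₀) * (G (N + N₀ + 1) - L) :=
      (summable_nat_add_iff N₀).2 hsumm
    have hws : Summable fun N ↦ w (N + N₀) := (summable_nat_add_iff N₀).2 hwsum.summable
    calc |∑' N, w (N + N₀) * (G (N + N₀ + 1) - L)|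
        ≤ ∑' N, |w (N + N₀) * (G (N + N₀ + 1) - L)| := by
          have hn : Summable fun N ↦ ‖w (N + N₀) * (G (N + N₀ + 1) - L)‖ := by
            simpa only [Real.norm_eq_abs] using Summable.abs hs2
          have h := norm_tsum_le_tsum_norm hn
          simpa only [Real.norm_eq_abs] using h
      _ ≤ ∑' N, w (N + N₀) * (ε / 2) := by
          refine Summable.tsum_le_tsum (fun N ↦ ?_) (Summable.abs hs2) (hws.mul_right (ε / 2))
          rw [abs_mul, abs_of_nonneg (hw0 _)]
          refine mul_le_mul_of_nonneg_left ?_ (hw0 _)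
          have := hN₀ (N + N₀ + 1) (by omega)
          rw [Real.dist_eq] at this
          exact this.le
      _ = (∑' N, w (N + N₀)) * (ε / 2) := by rw [tsum_mul_right]
      _ ≤ 1 * (ε / 2) := by
          refine mul_le_mul_of_nonneg_right ?_ hε2.le
          have hst := Summable.sum_add_tsum_nat_add N₀ hwsum.summable
          rw [hwsum.tsum_eq, hw, sum_kernelSt] at hst
          have hle : ((N₀ : ℝ) + 1) ^ (-u) ≤ 1 :=
            Real.rpow_le_one_of_one_le_of_nonpos (by linarith) (by linarith)
          linarith
      _ = ε / 2 := one_mul _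
  calc |∑ N ∈ Finset.range N₀, w N * (G (N + 1) - L) + ∑' N, w (N + N₀) * (G (N + N₀ + 1) - L)|
      ≤ |∑ N ∈ Finset.range N₀, w N * (G (N + 1) - L)| + |∑' N, w (N + N₀) * (G (N + N₀ + 1) - L)| :=
        abs_add_le _ _
    _ ≤ B * (1 - ((N₀ : ℝ) + 1) ^ (-u)) + ε / 2 := add_le_add h1 h2
    _ < ε := by
        have : 0 ≤ 1 - ((N₀ : ℝ) + 1) ^ (-u) := by
          have := sum_kernelSt u N₀ ▸ Finset.sum_nonneg fun N _ ↦ hw0 N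
          simpa [hw] using this
        nlinarith

/-- `(log(M+1) + 1)^p · (M+1)^{−u} → 0`. [folklore] -/
private theorem tendsto_logpow_mul_rpow_negSt (p : ℕ) {u : ℝ} (hu : 0 < u) :
    Tendsto (fun M : ℕ ↦ (Real.log ((M : ℝ) + 1) + 1) ^ p * ((M : ℝ) + 1) ^ (-u)) atTop (𝓝 0) := by
  -- `(log x + 1)^p x^{-u} = ((log x + 1) / x^{u/p'})^p`-type argument via `log x = o(x^r)`
  have h1 : Tendsto (fun x : ℝ ↦ (Real.log x + 1) / x ^ (u / (p + 1))) atTop (𝓝 0) := by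
    have hr : 0 < u / (p + 1) := by positivity
    have hlog : Tendsto (fun x : ℝ ↦ Real.log x / x ^ (u / (p + 1))) atTop (𝓝 0) :=
      (isLittleO_log_rpow_atTop hr).tendsto_div_nhds_zero
    have hone : Tendsto (fun x : ℝ ↦ 1 / x ^ (u / (p + 1))) atTop (𝓝 0) := by
      have := tendsto_rpow_neg_atTop hr
      refine this.congr' ?_
      filter_upwards [Filter.eventually_gt_atTop 0] with x hx
      rw [Real.rpow_neg hx.le, one_div]
    simpa [add_div] using hlog.add hone
  -- raise to the power `p+1` ... we only need: (log x + 1)^p * x^{-u} ≤ ((log x + 1)/x^{u/(p+1)})^{p+1} when log x + 1 ≥ 1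
  have h2 : Tendsto (fun x : ℝ ↦ ((Real.log x + 1) / x ^ (u / (p + 1))) ^ (p + 1)) atTop (𝓝 0) := by
    simpa using h1.pow (p + 1)
  have h3 : Tendsto (fun M : ℕ ↦ ((Real.log ((M : ℝ) + 1) + 1) / ((M : ℝ) + 1) ^ (u / (p + 1))) ^ (p + 1))
      atTop (𝓝 0) :=
    h2.comp (tendsto_atTop_add_const_right _ 1 tendsto_natCast_atTop_atTop)
  refine squeeze_zero_norm' ?_ h3
  filter_upwards [Filter.eventually_ge_atTop 2] with M hM
  have hM1 : (1 : ℝ) ≤ (M : ℝ) + 1 := by have := M.cast_nonneg (α := ℝ); linarith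
  have hx0 : (0 : ℝ) < (M : ℝ) + 1 := by linarith
  have hlog1 : 1 ≤ Real.log ((M : ℝ) + 1) + 1 := by linarith [Real.log_nonneg hM1]
  rw [Real.norm_eq_abs, abs_of_nonneg (by positivity), div_pow,
    ← Real.rpow_natCast (((M : ℝ) + 1) ^ (u / (p + 1))) (p + 1), ← Real.rpow_mul hx0.le]
  have e : u / ((p : ℝ) + 1) * ((p + 1 : ℕ) : ℝ) = u := by push_cast; field_simp
  rw [e, Real.rpow_neg hx0.le, ← div_eq_mul_inv]
  apply div_le_div_of_nonneg_right _ (by positivity)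
  rw [pow_succ]
  exact le_mul_of_one_le_right (by positivity) hlog1

/-- **Abel summation for a Dirichlet series with non-negative coefficients**: for `u > 0`, `a_m ≥ 0`
(term `m` sits at the integer `m+1`) with `Σ_{m<N} a_m ≤ C (log(N+1)+1)^p` and `Σ a_m (m+1)^{−u}`
summable: `Σ_m a_m (m+1)^{−u} = Σ_N ((N+1)^{−u} − (N+2)^{−u}) · Σ_{m ≤ N} a_m`. [folklore] -/
private theorem hasSum_kernel_mul_partialSumSt {u : ℝ} (hu : 0 < u) {a : ℕ → ℝ} (ha : ∀ m, 0 ≤ a m)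
    {C : ℝ} {p : ℕ} (hA : ∀ N : ℕ, ∑ m ∈ Finset.range N, a m ≤ C * (Real.log ((N : ℝ) + 1) + 1) ^ p)
    (hS : Summable fun m : ℕ ↦ a m * ((m : ℝ) + 1) ^ (-u)) :
    HasSum (fun N : ℕ ↦ (((N : ℝ) + 1) ^ (-u) - ((N : ℝ) + 2) ^ (-u)) * ∑ m ∈ Finset.range (N + 1), a m)
      (∑' m : ℕ, a m * ((m : ℝ) + 1) ^ (-u)) := by
  set f : ℕ → ℝ := fun m ↦ ((m : ℝ) + 1) ^ (-u) with hf
  set A : ℕ → ℝ := fun N ↦ ∑ m ∈ Finset.range N, a m with hAdef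
  -- finite Abel summation
  have hparts : ∀ M : ℕ, ∑ m ∈ Finset.range M, a m * f m =
      f (M - 1) * A M - ∑ m ∈ Finset.range (M - 1), (f (m + 1) - f m) * A (m + 1) := by
    intro M
    have h := Finset.sum_range_by_parts f a M
    simp only [smul_eq_mul] at h
    rw [show ∑ m ∈ Finset.range M, a m * f m = ∑ m ∈ Finset.range M, f m * a m by
      refine Finset.sum_congr rfl fun m _ ↦ mul_comm _ _]
    exact h
  -- the boundary term tends to `0`
  have hC0 : 0 ≤ C := by
    have := hA 0
    simp at this
    exact this
  have hbd : Tendsto (fun M : ℕ ↦ f (M - 1) * A M) atTop (𝓝 0) := by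
    have hz := (tendsto_logpow_mul_rpow_negSt p hu).const_mul (2 ^ u * C)
    rw [mul_zero] at hz
    refine squeeze_zero_norm' ?_ hz
    filter_upwards [Filter.eventually_ge_atTop 1] with M hM
    have hcast : (((M - 1 : ℕ) : ℝ) + 1) = M := by rw [Nat.cast_sub hM]; push_cast; ring
    have hMpos : (0 : ℝ) < M := by exact_mod_cast hM
    have hA0 : 0 ≤ A M := Finset.sum_nonneg fun m _ ↦ ha m
    have hfM : f (M - 1) = (M : ℝ) ^ (-u) := by simp only [hf]; rw [hcast]
    rw [Real.norm_eq_abs, hfM, abs_of_nonneg (mul_nonneg (by positivity) hA0)]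
    -- `M^{-u} ≤ 2^u (M+1)^{-u}`
    have hcmp : (M : ℝ) ^ (-u) ≤ 2 ^ u * ((M : ℝ) + 1) ^ (-u) := by
      rw [Real.rpow_neg hMpos.le, Real.rpow_neg (by positivity), ← Real.inv_rpow hMpos.le,
        ← Real.inv_rpow (by positivity), ← Real.mul_rpow (by positivity) (by positivity)]
      apply Real.rpow_le_rpow (by positivity) _ hu.le
      have : (1 : ℝ) ≤ M := by exact_mod_cast hM
      rw [inv_le_iff_one_le_mul₀ hMpos]
      field_simp
      linarith
    have h1 := hA M
    calc (M : ℝ) ^ (-u) * A M ≤ (2 ^ u * ((M : ℝ) + 1) ^ (-u)) * (C * (Real.log ((M : ℝ) + 1) + 1) ^ p) :=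
          mul_le_mul hcmp h1 hA0 (by positivity)
      _ = 2 ^ u * C * ((Real.log ((M : ℝ) + 1) + 1) ^ p * ((M : ℝ) + 1) ^ (-u)) := by ring
  -- partial sums of the kernel series
  have hw : ∀ N : ℕ, ((N : ℝ) + 1) ^ (-u) - ((N : ℝ) + 2) ^ (-u) = -(f (N + 1) - f N) := by
    intro N; simp only [hf]; push_cast; ring
  have hpartial : ∀ K : ℕ, ∑ N ∈ Finset.range K, (((N : ℝ) + 1) ^ (-u) - ((N : ℝ) + 2) ^ (-u)) * A (N + 1) =
      ∑ m ∈ Finset.range (K + 1), a m * f m - f K * A (K + 1) := by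
    intro K
    rw [hparts (K + 1), Nat.add_sub_cancel]
    simp only [hw, neg_mul, Finset.sum_neg_distrib]
    ring
  have hnonneg : ∀ N : ℕ, 0 ≤ (((N : ℝ) + 1) ^ (-u) - ((N : ℝ) + 2) ^ (-u)) * A (N + 1) := fun N ↦
    mul_nonneg (kernel_nonnegSt hu.le N) (Finset.sum_nonneg fun m _ ↦ ha m)
  rw [hasSum_iff_tendsto_nat_of_nonneg hnonneg]
  have hlim : Tendsto (fun K : ℕ ↦ ∑ m ∈ Finset.range (K + 1), a m * f m - f K * A (K + 1)) atTop
      (𝓝 (∑' m, a m * f m - 0)) :=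
    (hS.hasSum.tendsto_sum_nat.comp (tendsto_add_atTop_nat 1)).sub
      ((hbd.comp (tendsto_add_atTop_nat 1)).congr fun K ↦ by
        simp only [Function.comp, Nat.add_sub_cancel])
  rw [sub_zero] at hlim
  exact hlim.congr fun K ↦ (hpartial K).symm

/-! ### Step (III): the main term `Σ_N w_N(u) F(N+1)` versus `k!/u^{k+1}` -/

/-- The kernel as an integral: `∫_{t_N}^{t_{N+1}} u e^{−uτ} dτ = (N+1)^{−u} − (N+2)^{−u}`,
`t_N = log(N+1)`. [folklore] -/
private theorem integral_kernelSt (u : ℝ) (N : ℕ) :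
    ∫ τ in Real.log ((N : ℝ) + 1)..Real.log ((N : ℝ) + 2), u * Real.exp (-(u * τ)) =
      ((N : ℝ) + 1) ^ (-u) - ((N : ℝ) + 2) ^ (-u) := by
  have hderiv : ∀ τ ∈ Set.uIcc (Real.log ((N : ℝ) + 1)) (Real.log ((N : ℝ) + 2)),
      HasDerivAt (fun τ : ℝ ↦ -Real.exp (-(u * τ))) (u * Real.exp (-(u * τ))) τ := by
    intro τ _
    have h1 : HasDerivAt (fun τ : ℝ ↦ -(u * τ)) (-(u * 1)) τ := ((hasDerivAt_id τ).const_mul u).neg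
    have h2 := h1.exp.neg
    refine h2.congr_deriv ?_
    ring
  rw [intervalIntegral.integral_eq_sub_of_hasDerivAt hderiv
    ((by fun_prop : Continuous fun τ : ℝ ↦ u * Real.exp (-(u * τ))).intervalIntegrable _ _)]
  rw [Real.rpow_def_of_pos (by positivity), Real.rpow_def_of_pos (by positivity)]
  ring_nf

/-- The pieces `∫_{t_N}^{t_{N+1}} (τ^{k+1}/(k+1)) u e^{−uτ} dτ` are squeezed between
`F(N+1) w_N(u)` and `F(N+2) w_N(u)`, `F(M) = (log M)^{k+1}/(k+1)`. [folklore] -/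
private theorem piece_boundsSt (k : ℕ) {u : ℝ} (hu : 0 < u) (N : ℕ) :
    Real.log ((N : ℝ) + 1) ^ (k + 1) / ((k : ℝ) + 1) * (((N : ℝ) + 1) ^ (-u) - ((N : ℝ) + 2) ^ (-u)) ≤
      ∫ τ in Real.log ((N : ℝ) + 1)..Real.log ((N : ℝ) + 2),
        τ ^ (k + 1) / ((k : ℝ) + 1) * (u * Real.exp (-(u * τ))) ∧
    ∫ τ in Real.log ((N : ℝ) + 1)..Real.log ((N : ℝ) + 2),
        τ ^ (k + 1) / ((k : ℝ) + 1) * (u * Real.exp (-(u * τ))) ≤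
      Real.log ((N : ℝ) + 2) ^ (k + 1) / ((k : ℝ) + 1) * (((N : ℝ) + 1) ^ (-u) - ((N : ℝ) + 2) ^ (-u)) := by
  set t₀ := Real.log ((N : ℝ) + 1) with ht₀
  set t₁ := Real.log ((N : ℝ) + 2) with ht₁
  have h01 : t₀ ≤ t₁ := Real.log_le_log (by positivity) (by linarith)
  have ht0 : 0 ≤ t₀ := Real.log_nonneg (by have := N.cast_nonneg (α := ℝ); linarith)
  have hcont : Continuous fun τ : ℝ ↦ τ ^ (k + 1) / ((k : ℝ) + 1) * (u * Real.exp (-(u * τ))) := by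
    fun_prop
  have hker : Continuous fun τ : ℝ ↦ u * Real.exp (-(u * τ)) := by fun_prop
  rw [← integral_kernelSt u N, ← ht₀, ← ht₁, ← intervalIntegral.integral_const_mul,
    ← intervalIntegral.integral_const_mul]
  constructor
  · refine intervalIntegral.integral_mono_on h01 ((hker.const_mul _).intervalIntegrable _ _)
      (hcont.intervalIntegrable _ _) fun τ hτ ↦ ?_
    have hτ0 : 0 ≤ τ := ht0.trans hτ.1
    exact mul_le_mul_of_nonneg_right (div_le_div_of_nonneg_right (pow_le_pow_left₀ ht0 hτ.1 _) (by positivity))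
      (by positivity)
  · refine intervalIntegral.integral_mono_on h01 (hcont.intervalIntegrable _ _)
      ((hker.const_mul _).intervalIntegrable _ _) fun τ hτ ↦ ?_
    have hτ0 : 0 ≤ τ := ht0.trans hτ.1
    exact mul_le_mul_of_nonneg_right (div_le_div_of_nonneg_right (pow_le_pow_left₀ hτ0 hτ.2 _) (by positivity))
      (by positivity)

/-- The pieces sum to the Gamma integral: `Σ_N ∫_{t_N}^{t_{N+1}} (τ^{k+1}/(k+1)) u e^{−uτ} dτ = k!/u^{k+1}`. [folklore] -/
private theorem hasSum_piecesSt (k : ℕ) {u : ℝ} (hu : 0 < u) :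
    HasSum (fun N : ℕ ↦ ∫ τ in Real.log ((N : ℝ) + 1)..Real.log ((N : ℝ) + 2),
        τ ^ (k + 1) / ((k : ℝ) + 1) * (u * Real.exp (-(u * τ))))
      ((k.factorial : ℝ) / u ^ (k + 1)) := by
  set h : ℝ → ℝ := fun τ ↦ τ ^ (k + 1) / ((k : ℝ) + 1) * (u * Real.exp (-(u * τ))) with hh
  set t : ℕ → ℝ := fun N ↦ Real.log ((N : ℝ) + 1) with ht
  have ht_succ : ∀ N : ℕ, Real.log ((N : ℝ) + 2) = t (N + 1) := fun N ↦ by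
    simp only [ht]; push_cast; ring_nf
  have hcont : Continuous h := by simp only [hh]; fun_prop
  -- nonnegativity of the pieces
  have hnonneg : ∀ N, 0 ≤ ∫ τ in t N..t (N + 1), h τ := by
    intro N
    refine intervalIntegral.integral_nonneg (Real.log_le_log (by positivity) (by push_cast; linarith)) fun τ hτ ↦ ?_
    have : 0 ≤ τ := (Real.log_nonneg (by have := N.cast_nonneg (α := ℝ); linarith)).trans hτ.1
    simp only [hh]; positivity
  -- integrability on `(0, ∞)` and the value of the improper integral
  have hint : MeasureTheory.IntegrableOn h (Set.Ioi 0) := by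
    have h1 := integrableOn_rpow_mul_exp_neg_mul_rpow (s := (k + 1 : ℕ)) (p := 1) (b := u)
      (by have := (k + 1).cast_nonneg (α := ℝ); push_cast at this ⊢; linarith) le_rfl hu
    have h2 : MeasureTheory.IntegrableOn
        (fun x : ℝ ↦ u / ((k : ℝ) + 1) * (x ^ ((k + 1 : ℕ) : ℝ) * Real.exp (-u * x ^ (1 : ℝ)))) (Set.Ioi 0) :=
      h1.const_mul (u / ((k : ℝ) + 1))
    refine MeasureTheory.IntegrableOn.congr_fun h2 (fun τ hτ ↦ ?_) measurableSet_Ioi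
    simp only [hh, Real.rpow_natCast, Real.rpow_one]
    ring_nf
  have hval : ∫ τ in Set.Ioi 0, h τ = (k.factorial : ℝ) / u ^ (k + 1) := by
    have hG := Real.integral_rpow_mul_exp_neg_mul_Ioi (a := (k : ℝ) + 2) (r := u) (by positivity) hu
    have e : ∀ τ : ℝ, τ ∈ Set.Ioi (0 : ℝ) →
        h τ = u / ((k : ℝ) + 1) * (τ ^ ((k : ℝ) + 2 - 1) * Real.exp (-(u * τ))) := by
      intro τ hτ
      simp only [hh]
      rw [show (k : ℝ) + 2 - 1 = ((k + 1 : ℕ) : ℝ) by push_cast; ring, Real.rpow_natCast]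
      ring
    rw [MeasureTheory.setIntegral_congr_fun measurableSet_Ioi e, MeasureTheory.integral_const_mul, hG,
      show (k : ℝ) + 2 = ((k + 1 : ℕ) : ℝ) + 1 by push_cast; ring, Real.Gamma_nat_eq_factorial,
      show ((k + 1 : ℕ) : ℝ) + 1 = ((k + 2 : ℕ) : ℝ) by push_cast; ring, Real.rpow_natCast,
      Nat.factorial_succ]
    push_cast
    have hu0 : u ≠ 0 := hu.ne'
    have hk : ((k : ℝ) + 1) ≠ 0 := by positivity
    rw [one_div, inv_pow]
    field_simp
    ring
  -- partial sums = integral up to `t M`, which tends to the improper integral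
  have hpartial : ∀ M : ℕ, ∑ N ∈ Finset.range M, ∫ τ in t N..t (N + 1), h τ = ∫ τ in (0 : ℝ)..t M, h τ := by
    intro M
    rw [intervalIntegral.sum_integral_adjacent_intervals fun N _ ↦ hcont.intervalIntegrable _ _]
    simp [ht]
  have htend : Tendsto (fun M : ℕ ↦ t M) atTop atTop :=
    Real.tendsto_log_atTop.comp (tendsto_atTop_add_const_right _ 1 tendsto_natCast_atTop_atTop)
  have hlim := MeasureTheory.intervalIntegral_tendsto_integral_Ioi 0 hint htend
  rw [hval] at hlim
  have key : HasSum (fun N : ℕ ↦ ∫ τ in t N..t (N + 1), h τ) ((k.factorial : ℝ) / u ^ (k + 1)) := by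
    rw [hasSum_iff_tendsto_nat_of_nonneg hnonneg]
    exact hlim.congr fun M ↦ (hpartial M).symm
  refine key.congr_fun fun N ↦ ?_
  rw [ht_succ]

/-- `logMul^[k] f = (log ·)^k · f`. [folklore] -/
private theorem logMul_iterateSt (f : ℕ → ℂ) (k : ℕ) :
    LSeries.logMul^[k] f = fun n : ℕ ↦ (Complex.log (n : ℂ)) ^ k * f n := by
  induction k with
  | zero => funext n; simp
  | succ k ih =>
    funext n
    rw [Function.iterate_succ_apply', ih]
    simp only [LSeries.logMul]
    ring

/-- Reindexing `Icc 1 N` by `range N`. [folklore] -/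
private theorem sum_Icc_eq_sum_rangeSt (g : ℕ → ℝ) (N : ℕ) :
    ∑ m ∈ Finset.Icc 1 N, g m = ∑ i ∈ Finset.range N, g (i + 1) := by
  rw [← Finset.Ico_add_one_right_eq_Icc, Finset.sum_Ico_eq_sum_range]
  simp only [Nat.add_sub_cancel, add_comm 1]

/-- The increments of `F(N) = (log N)^{k+1}/(k+1)` tend to `0`. [folklore] -/
private theorem tendsto_logPow_succ_subSt (k : ℕ) :
    Tendsto (fun N : ℕ ↦ Real.log ((N : ℝ) + 1) ^ (k + 1) / ((k : ℝ) + 1) -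
      Real.log (N : ℝ) ^ (k + 1) / ((k : ℝ) + 1)) atTop (𝓝 0) := by
  -- `0 ≤ x^{k+1} − y^{k+1} ≤ (k+1) x^k (x − y)` for `0 ≤ y ≤ x`, with `x − y = log(1 + 1/N) ≤ 1/N`
  have hbound : Tendsto (fun N : ℕ ↦ 2 * ((Real.log ((N : ℝ) + 1) + 1) ^ k * ((N : ℝ) + 1) ^ (-(1 : ℝ))))
      atTop (𝓝 0) := by
    simpa using (tendsto_logpow_mul_rpow_negSt k one_pos).const_mul 2
  refine squeeze_zero_norm' ?_ hbound
  filter_upwards [Filter.eventually_ge_atTop 1] with N hN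
  have hN1 : (1 : ℝ) ≤ N := by exact_mod_cast hN
  have hN0 : (0 : ℝ) < N := by linarith
  set x := Real.log ((N : ℝ) + 1) with hx
  set y := Real.log (N : ℝ) with hy
  have hy0 : 0 ≤ y := Real.log_nonneg hN1
  have hxy : y ≤ x := Real.log_le_log hN0 (by linarith)
  have hx0 : 0 ≤ x := hy0.trans hxy
  have hdiff : x - y ≤ 1 / N := by
    rw [hx, hy, ← Real.log_div (by linarith) hN0.ne']
    have := Real.log_le_sub_one_of_pos (x := ((N : ℝ) + 1) / N) (by positivity)
    have e : ((N : ℝ) + 1) / N - 1 = 1 / N := by field_simp; ring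
    linarith
  have hgeom : x ^ (k + 1) - y ^ (k + 1) = (∑ i ∈ Finset.range (k + 1), x ^ i * y ^ (k + 1 - 1 - i)) * (x - y) :=
    (geom_sum₂_mul x y (k + 1)).symm
  have hsum_le : ∑ i ∈ Finset.range (k + 1), x ^ i * y ^ (k + 1 - 1 - i) ≤ ((k : ℝ) + 1) * x ^ k := by
    calc ∑ i ∈ Finset.range (k + 1), x ^ i * y ^ (k + 1 - 1 - i)
        ≤ ∑ i ∈ Finset.range (k + 1), x ^ k := Finset.sum_le_sum fun i hi ↦ by
          have hi' : i ≤ k := Nat.lt_succ_iff.1 (Finset.mem_range.1 hi)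
          calc x ^ i * y ^ (k + 1 - 1 - i) ≤ x ^ i * x ^ (k + 1 - 1 - i) :=
                mul_le_mul_of_nonneg_left (pow_le_pow_left₀ hy0 hxy _) (pow_nonneg hx0 _)
            _ = x ^ k := by rw [← pow_add]; congr 1; omega
      _ = ((k : ℝ) + 1) * x ^ k := by simp [Finset.sum_const]
  have hk1 : (0 : ℝ) < (k : ℝ) + 1 := by positivity
  have hnum : 0 ≤ x ^ (k + 1) - y ^ (k + 1) := by
    rw [hgeom]; exact mul_nonneg (Finset.sum_nonneg fun i _ ↦ by positivity) (by linarith)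
  rw [Real.norm_eq_abs, ← sub_div, abs_of_nonneg (div_nonneg hnum hk1.le), div_le_iff₀ hk1]
  have h1 : x ^ (k + 1) - y ^ (k + 1) ≤ ((k : ℝ) + 1) * x ^ k * (1 / N) := by
    rw [hgeom]
    exact mul_le_mul hsum_le hdiff (by linarith) (by positivity)
  have h2 : x ^ k ≤ (x + 1) ^ k := pow_le_pow_left₀ hx0 (by linarith) k
  have h3 : 1 / (N : ℝ) ≤ 2 * ((N : ℝ) + 1) ^ (-(1 : ℝ)) := by
    rw [Real.rpow_neg (by positivity), Real.rpow_one, div_le_iff₀ hN0]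
    rw [show 2 * ((N : ℝ) + 1)⁻¹ * N = 2 * N / (N + 1) by field_simp]
    rw [le_div_iff₀ (by positivity)]
    linarith
  calc x ^ (k + 1) - y ^ (k + 1) ≤ ((k : ℝ) + 1) * x ^ k * (1 / N) := h1
    _ ≤ ((k : ℝ) + 1) * (x + 1) ^ k * (2 * ((N : ℝ) + 1) ^ (-(1 : ℝ))) :=
        mul_le_mul (mul_le_mul_of_nonneg_left h2 hk1.le) h3 (by positivity) (by positivity)
    _ = 2 * ((x + 1) ^ k * ((N : ℝ) + 1) ^ (-(1 : ℝ))) * ((k : ℝ) + 1) := by ring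


/-! ### The analytic side: `Σ_n (log n)^k n^{−s} − k!/(s−1)^{k+1} → (−1)^k ζ₀^{(k)}(1)` -/

open scoped LSeries.notation

/-- **The derivatives of `ζ₀ = ζ − 1/(s−1)` on `Re s > 1`**:
`ζ₀^{(k)}(s) = (−1)^k Σ_n (log n)^k n^{−s} − (−1)^k k!/(s−1)^{k+1}` (termwise differentiation of the
Dirichlet series). [cite: Coffey2008, eq. (3.1) p.714] -/
theorem iteratedDeriv_riemannZeta₀_eq {s : ℂ} (hs : 1 < s.re) (k : ℕ) :
    iteratedDeriv k riemannZeta₀ s =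
      (-1) ^ k * LSeries (fun n ↦ (Complex.log n) ^ k * (1 : ℕ → ℂ) n) s -
        (-1) ^ k * (k ! : ℂ) * ((s - 1) ^ (k + 1))⁻¹ := by
  have hopen : IsOpen {z : ℂ | 1 < z.re} := isOpen_lt continuous_const Complex.continuous_re
  have hev : riemannZeta₀ =ᶠ[𝓝 s] fun z ↦ L 1 z - (z - 1)⁻¹ := by
    filter_upwards [hopen.mem_nhds hs] with z hz
    have hz1 : z ≠ 1 := fun h ↦ by rw [h] at hz; simp at hz
    have h := riemannZeta_eq_inv_sub_add hz1
    rw [LSeries_one_eq_riemannZeta hz, h]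
    ring
  have hs1 : s ≠ 1 := fun h ↦ by rw [h] at hs; simp at hs
  have habs : LSeries.abscissaOfAbsConv (1 : ℕ → ℂ) < s.re := by
    rw [LSeries.abscissaOfAbsConv_one]; exact_mod_cast hs
  have h1 : ContDiffAt ℂ k (fun z : ℂ ↦ (z - 1)⁻¹) s := (contDiffAt_id.sub contDiffAt_const).inv
    (sub_ne_zero.2 hs1)
  have h2 : ContDiffAt ℂ k (LSeries 1) s :=
    ((LSeries_differentiableOn 1).analyticAt ((isOpen_re_gt_EReal _).mem_nhds habs)).contDiffAt
  rw [hev.iteratedDeriv_eq, iteratedDeriv_fun_sub h2 h1,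
    Literature.Analysis.Complex.iteratedDeriv_inv_sub_const 1 k s, LSeries_iteratedDeriv k habs,
    logMul_iterateSt]

/-- The iterated derivative of a function analytic at a point is analytic there. [folklore] -/
private theorem analyticAt_iteratedDeriv' {f : ℂ → ℂ} {z : ℂ} (hf : AnalyticAt ℂ f z) (k : ℕ) :
    AnalyticAt ℂ (iteratedDeriv k f) z := by
  induction k with
  | zero => simpa using hf
  | succ k ih => rw [iteratedDeriv_succ]; exact ih.deriv

/-- `Σ_n (log n)^k n^{−s} − k!/(s−1)^{k+1} → (−1)^k ζ₀^{(k)}(1)` as `s → 1` in `Re s > 1`.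
[cite: Coffey2008, eq. (3.1) p.714] -/
theorem tendsto_LSeries_logPow_one_sub (k : ℕ) :
    Tendsto (fun s : ℂ ↦ LSeries (fun n ↦ (Complex.log n) ^ k * (1 : ℕ → ℂ) n) s -
        (k ! : ℂ) * ((s - 1) ^ (k + 1))⁻¹)
      (𝓝[{s : ℂ | 1 < s.re}] 1) (𝓝 ((-1) ^ k * iteratedDeriv k riemannZeta₀ 1)) := by
  have han := analyticAt_iteratedDeriv' (differentiable_riemannZeta₀.analyticAt 1) k
  have hcont : Tendsto (fun s ↦ (-1) ^ k * iteratedDeriv k riemannZeta₀ s)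
      (𝓝[{s : ℂ | 1 < s.re}] 1) (𝓝 ((-1) ^ k * iteratedDeriv k riemannZeta₀ 1)) :=
    ((han.continuousAt.tendsto).const_mul _).mono_left nhdsWithin_le_nhds
  refine hcont.congr' ?_
  filter_upwards [self_mem_nhdsWithin] with s hs
  rw [iteratedDeriv_riemannZeta₀_eq hs]
  have h : (-1 : ℂ) ^ k * (-1) ^ k = 1 := by rw [← mul_pow]; norm_num
  linear_combination (LSeries (fun n ↦ (Complex.log n) ^ k * (1 : ℕ → ℂ) n) s -
    (k ! : ℂ) * ((s - 1) ^ (k + 1))⁻¹) * h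

/-- The same along the real axis. [cite: Coffey2008, eq. (3.1) p.714] -/
private theorem tendsto_LSeries_logPow_one_sub_real (k : ℕ) :
    Tendsto (fun σ : ℝ ↦ LSeries (fun n ↦ (Complex.log n) ^ k * (1 : ℕ → ℂ) n) σ -
        (k ! : ℂ) * (((σ : ℂ) - 1) ^ (k + 1))⁻¹)
      (𝓝[>] 1) (𝓝 ((-1) ^ k * iteratedDeriv k riemannZeta₀ 1)) := by
  have hmap : Tendsto ((↑) : ℝ → ℂ) (𝓝[>] (1 : ℝ)) (𝓝[{s : ℂ | 1 < s.re}] 1) := by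
    have h := (Complex.continuous_ofReal.continuousWithinAt (s := Set.Ioi (1 : ℝ)) (x := 1)).tendsto_nhdsWithin
      (t := {s : ℂ | 1 < s.re}) (fun x hx ↦ by simpa using hx)
    simpa using h
  exact (tendsto_LSeries_logPow_one_sub k).comp hmap

/-- The Dirichlet series `Σ (log n)^k n^{−(1+u)}` as a real series over `m ↦ m+1`. [folklore] -/
private theorem re_LSeries_logPow_one (k : ℕ) {u : ℝ} (hu : 0 < u) :
    Summable (fun m : ℕ ↦ Real.log ((m : ℝ) + 1) ^ k / ((m : ℝ) + 1) * ((m : ℝ) + 1) ^ (-u)) ∧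
    (LSeries (fun n ↦ (Complex.log n) ^ k * (1 : ℕ → ℂ) n) ((1 + u : ℝ) : ℂ)).re =
      ∑' m : ℕ, Real.log ((m : ℝ) + 1) ^ k / ((m : ℝ) + 1) * ((m : ℝ) + 1) ^ (-u) := by
  set f : ℕ → ℂ := fun n ↦ (Complex.log n) ^ k * (1 : ℕ → ℂ) n with hf
  set s : ℂ := ((1 + u : ℝ) : ℂ) with hs
  set r : ℕ → ℝ := fun n ↦ Real.log (n : ℝ) ^ k / (n : ℝ) ^ (1 + u) with hr
  -- the terms are real
  have hterm : ∀ n : ℕ, LSeries.term f s n = ((r n : ℝ) : ℂ) := by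
    intro n
    rcases Nat.eq_zero_or_pos n with rfl | hn
    · simp [LSeries.term_zero, hr, Real.zero_rpow (by linarith : (1 + u) ≠ 0)]
    · rw [LSeries.term_of_ne_zero hn.ne', hf, hr, hs]
      simp only [Pi.one_apply, mul_one]
      rw [show (n : ℂ) = ((n : ℝ) : ℂ) by norm_cast, ← Complex.ofReal_cpow (Nat.cast_nonneg n),
        ← Complex.ofReal_log (Nat.cast_nonneg n)]
      push_cast
      ring
  have habs : LSeries.abscissaOfAbsConv f < s.re := by
    rw [hf, ← logMul_iterateSt, LSeries.absicssaOfAbsConv_logPowMul, LSeries.abscissaOfAbsConv_one, hs]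
    simp only [Complex.ofReal_re]
    exact_mod_cast (by linarith : (1 : ℝ) < 1 + u)
  have hsum : LSeriesSummable f s := LSeriesSummable_of_abscissaOfAbsConv_lt_re habs
  have hsumr : Summable r := by
    have : Summable fun n ↦ ((r n : ℝ) : ℂ) := hsum.congr hterm
    exact Complex.summable_ofReal.1 this
  have hshift : ∀ m : ℕ, r (m + 1) =
      Real.log ((m : ℝ) + 1) ^ k / ((m : ℝ) + 1) * ((m : ℝ) + 1) ^ (-u) := by
    intro m
    simp only [hr]
    have hm : (0 : ℝ) < (m : ℝ) + 1 := by positivity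
    push_cast
    rw [Real.rpow_add hm, Real.rpow_one, Real.rpow_neg hm.le]
    field_simp
  refine ⟨((summable_nat_add_iff 1).2 hsumr).congr hshift, ?_⟩
  rw [LSeries, tsum_congr hterm, ← Complex.ofReal_tsum, Complex.ofReal_re, hsumr.tsum_eq_zero_add]
  have h0 : r 0 = 0 := by simp [hr, Real.zero_rpow (by linarith : (1 + u) ≠ 0)]
  rw [h0, zero_add]
  exact tsum_congr hshift

/-! ### Assembly: `γ_k = (−1)^k Re ζ₀^{(k)}(1)` -/

/-- `A(N) = Σ_{m<N} (log(m+1))^k/(m+1) = stieltjesGammaSeq k N + (log N)^{k+1}/(k+1)`. [folklore] -/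
private theorem partialSum_eq_stieltjesGammaSeq (k N : ℕ) :
    ∑ m ∈ Finset.range N, Real.log ((m : ℝ) + 1) ^ k / ((m : ℝ) + 1) =
      stieltjesGammaSeq k N + Real.log N ^ (k + 1) / (k + 1) := by
  rw [stieltjesGammaSeq, sum_Icc_eq_sum_rangeSt]
  push_cast
  ring

/-- **The Stieltjes constants identified** (Stieltjes 1905 / Briggs 1955; [Coffey2008] (3.1)–(3.2)):
`γ_k = lim_N (Σ_{m≤N}(log m)^k/m − (log N)^{k+1}/(k+1)) = (−1)^k Re ζ₀^{(k)}(1)`, `ζ₀ = ζ − 1/(s−1)`.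
Abelian route of `BombieriLagariasEtaIdentification.tendsto_liEtaSeq` with the weights `Λ(m)` replaced
by `1`. [cite: Coffey2008, eqs. (3.1)–(3.2) p.714] -/
theorem stieltjesGamma_eq_re_iteratedDeriv (k : ℕ) :
    stieltjesGamma k = (-1) ^ k * (iteratedDeriv k riemannZeta₀ 1).re := by
  have hG := tendsto_stieltjesGammaSeq k
  set Lk : ℝ := stieltjesGamma k with hLk
  set G : ℕ → ℝ := stieltjesGammaSeq k with hGdef
  set a : ℕ → ℝ := fun m ↦ Real.log ((m : ℝ) + 1) ^ k / ((m : ℝ) + 1) with ha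
  set Fk : ℕ → ℝ := fun M ↦ Real.log (M : ℝ) ^ (k + 1) / ((k : ℝ) + 1) with hFk
  have ha0 : ∀ m, 0 ≤ a m := fun m ↦ by
    simp only [ha]
    exact div_nonneg (pow_nonneg (Real.log_nonneg (by have := m.cast_nonneg (α := ℝ); linarith)) _)
      (by positivity)
  have hA : ∀ N, ∑ m ∈ Finset.range N, a m = G N + Fk N := fun N ↦ by
    rw [partialSum_eq_stieltjesGammaSeq]
  -- `G` is bounded
  obtain ⟨B, hB0, hB⟩ : ∃ B : ℝ, 0 ≤ B ∧ ∀ N, |G N| ≤ B := by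
    obtain ⟨b, hb⟩ : ∃ b, ∀ᶠ N in atTop, |G N| ≤ b := (hG.abs).isBoundedUnder_le
    obtain ⟨N₀, hN₀⟩ := Filter.eventually_atTop.1 hb
    refine ⟨max b (Finset.sup' (Finset.range (N₀ + 1)) ⟨0, by simp⟩ fun N ↦ |G N|), ?_, fun N ↦ ?_⟩
    · exact le_trans (abs_nonneg (G 0)) ((Finset.le_sup' (fun N ↦ |G N|) (by simp)).trans (le_max_right _ _))
    rcases le_or_gt N₀ N with h | h
    · exact (hN₀ N h).trans (le_max_left _ _)
    · exact (Finset.le_sup' (fun N ↦ |G N|) (Finset.mem_range.2 (by omega))).trans (le_max_right _ _)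
  -- growth of the partial sums
  have hgrowth : ∀ N : ℕ, ∑ m ∈ Finset.range N, a m ≤ (B + 1) * (Real.log ((N : ℝ) + 1) + 1) ^ (k + 1) := by
    intro N
    rw [hA N]
    have hl0 : 0 ≤ Real.log ((N : ℝ) + 1) := Real.log_nonneg (by have := N.cast_nonneg (α := ℝ); linarith)
    have h1 : 1 ≤ (Real.log ((N : ℝ) + 1) + 1) ^ (k + 1) := one_le_pow₀ (by linarith)
    have hlogN : Real.log (N : ℝ) ≤ Real.log ((N : ℝ) + 1) + 1 := by
      rcases Nat.eq_zero_or_pos N with rfl | hN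
      · simp
      · have := Real.log_le_log (by exact_mod_cast hN : (0 : ℝ) < N) (by linarith : (N : ℝ) ≤ N + 1)
        linarith
    have hlogN0 : 0 ≤ Real.log (N : ℝ) := Real.log_natCast_nonneg N
    have h2 : Fk N ≤ (Real.log ((N : ℝ) + 1) + 1) ^ (k + 1) := by
      simp only [hFk]
      rw [div_le_iff₀ (by positivity)]
      calc Real.log (N : ℝ) ^ (k + 1) ≤ (Real.log ((N : ℝ) + 1) + 1) ^ (k + 1) := pow_le_pow_left₀ hlogN0 hlogN _
        _ ≤ (Real.log ((N : ℝ) + 1) + 1) ^ (k + 1) * ((k : ℝ) + 1) :=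
            le_mul_of_one_le_right (by positivity) (by have := k.cast_nonneg (α := ℝ); linarith)
    have h3 : G N ≤ B := (le_abs_self _).trans (hB N)
    nlinarith
  -- the Abelian limit along `u → 0⁺`
  have key : Tendsto (fun u : ℝ ↦ (∑' m : ℕ, a m * ((m : ℝ) + 1) ^ (-u)) - (k.factorial : ℝ) / u ^ (k + 1))
      (𝓝[>] 0) (𝓝 Lk) := by
    have hII := tendsto_tsum_kernel_mulSt hG
    have hincr : Tendsto (fun N : ℕ ↦ Fk (N + 1) - Fk N) atTop (𝓝 0) := by
      have := tendsto_logPow_succ_subSt k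
      refine this.congr fun N ↦ ?_
      simp only [hFk]; push_cast; ring_nf
    have hIIb := tendsto_tsum_kernel_mulSt hincr
    obtain ⟨B', hB'⟩ : ∃ B' : ℝ, ∀ N, |Fk (N + 1 + 1) - Fk (N + 1)| ≤ B' := by
      have h0 : Tendsto (fun N : ℕ ↦ Fk (N + 1 + 1) - Fk (N + 1)) atTop (𝓝 0) :=
        hincr.comp (tendsto_add_atTop_nat 1)
      obtain ⟨b, hb⟩ : ∃ b, ∀ᶠ N in atTop, |Fk (N + 1 + 1) - Fk (N + 1)| ≤ b := (h0.abs).isBoundedUnder_le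
      obtain ⟨N₀, hN₀⟩ := Filter.eventually_atTop.1 hb
      refine ⟨max b (Finset.sup' (Finset.range (N₀ + 1)) ⟨0, by simp⟩ fun N ↦ |Fk (N + 1 + 1) - Fk (N + 1)|),
        fun N ↦ ?_⟩
      rcases le_or_gt N₀ N with h | h
      · exact (hN₀ N h).trans (le_max_left _ _)
      · exact (Finset.le_sup' (fun N ↦ |Fk (N + 1 + 1) - Fk (N + 1)|) (Finset.mem_range.2 (by omega))).trans
          (le_max_right _ _)
    have hsand : ∀ u : ℝ, 0 < u →
        |(∑' m : ℕ, a m * ((m : ℝ) + 1) ^ (-u)) - (k.factorial : ℝ) / u ^ (k + 1) -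
          ∑' N : ℕ, (((N : ℝ) + 1) ^ (-u) - ((N : ℝ) + 2) ^ (-u)) * G (N + 1)| ≤
        ∑' N : ℕ, (((N : ℝ) + 1) ^ (-u) - ((N : ℝ) + 2) ^ (-u)) * (Fk (N + 1 + 1) - Fk (N + 1)) := by
      intro u hu
      set w : ℕ → ℝ := fun N ↦ ((N : ℝ) + 1) ^ (-u) - ((N : ℝ) + 2) ^ (-u) with hw
      have hw0 : ∀ N, 0 ≤ w N := kernel_nonnegSt hu.le
      have hwsum : HasSum w 1 := hasSum_kernelSt hu
      obtain ⟨hsa, -⟩ := re_LSeries_logPow_one k hu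
      have h5 := hasSum_kernel_mul_partialSumSt hu ha0 hgrowth hsa
      simp only [hA] at h5
      have hP := hasSum_piecesSt k hu
      have hPb := fun N ↦ piece_boundsSt k hu N
      have hFk1 : ∀ N : ℕ, Fk (N + 1) = Real.log ((N : ℝ) + 1) ^ (k + 1) / ((k : ℝ) + 1) := fun N ↦ by
        simp only [hFk]; push_cast; ring_nf
      have hFk2 : ∀ N : ℕ, Fk (N + 1 + 1) = Real.log ((N : ℝ) + 2) ^ (k + 1) / ((k : ℝ) + 1) := fun N ↦ by
        simp only [hFk]; push_cast; ring_nf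
      have hwG : Summable fun N ↦ w N * G (N + 1) := by
        refine Summable.of_norm_bounded (g := fun N ↦ B * w N) (hwsum.summable.mul_left B) fun N ↦ ?_
        rw [Real.norm_eq_abs, abs_mul, abs_of_nonneg (hw0 N), mul_comm]
        exact mul_le_mul_of_nonneg_right (hB _) (hw0 N)
      have hwF1 : Summable fun N ↦ w N * Fk (N + 1) := by
        refine Summable.of_nonneg_of_le (fun N ↦ mul_nonneg (hw0 N) ?_) (fun N ↦ ?_) hP.summable
        · rw [hFk1]; exact div_nonneg (pow_nonneg (Real.log_nonneg (by
            have := N.cast_nonneg (α := ℝ); linarith)) _) (by positivity)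
        · rw [hFk1, mul_comm]; exact (hPb N).1
      have hwΔ : Summable fun N ↦ w N * (Fk (N + 1 + 1) - Fk (N + 1)) := by
        refine Summable.of_norm_bounded (g := fun N ↦ B' * w N) (hwsum.summable.mul_left B') fun N ↦ ?_
        rw [Real.norm_eq_abs, abs_mul, abs_of_nonneg (hw0 N), mul_comm]
        exact mul_le_mul_of_nonneg_right (hB' _) (hw0 N)
      have hD : ∑' m : ℕ, a m * ((m : ℝ) + 1) ^ (-u) = ∑' N, w N * G (N + 1) + ∑' N, w N * Fk (N + 1) := by
        rw [← h5.tsum_eq, ← (hwG.hasSum.add hwF1.hasSum).tsum_eq]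
        exact tsum_congr fun N ↦ by ring
      have hS1 : ∑' N, w N * Fk (N + 1) ≤ (k.factorial : ℝ) / u ^ (k + 1) :=
        hasSum_le (fun N ↦ by rw [hFk1, mul_comm]; exact (hPb N).1) hwF1.hasSum hP
      have hS2 : (k.factorial : ℝ) / u ^ (k + 1) ≤
          ∑' N, w N * Fk (N + 1) + ∑' N, w N * (Fk (N + 1 + 1) - Fk (N + 1)) := by
        have hsum2 : HasSum (fun N ↦ w N * Fk (N + 1 + 1))
            (∑' N, w N * Fk (N + 1) + ∑' N, w N * (Fk (N + 1 + 1) - Fk (N + 1))) :=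
          (hwF1.hasSum.add hwΔ.hasSum).congr_fun fun N ↦ by ring
        exact hasSum_le (fun N ↦ by rw [hFk2, mul_comm]; exact (hPb N).2) hP hsum2
      rw [hD]
      have e : ∑' N, w N * G (N + 1) + ∑' N, w N * Fk (N + 1) - (k.factorial : ℝ) / u ^ (k + 1) -
          ∑' N, w N * G (N + 1) = ∑' N, w N * Fk (N + 1) - (k.factorial : ℝ) / u ^ (k + 1) := by ring
      rw [e, abs_le]
      constructor <;> linarith
    have hE : Tendsto (fun u : ℝ ↦ ∑' N : ℕ, (((N : ℝ) + 1) ^ (-u) - ((N : ℝ) + 2) ^ (-u)) *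
        (Fk (N + 1 + 1) - Fk (N + 1))) (𝓝[>] 0) (𝓝 0) := hIIb
    have hdiff : Tendsto (fun u : ℝ ↦ (∑' m : ℕ, a m * ((m : ℝ) + 1) ^ (-u)) - (k.factorial : ℝ) / u ^ (k + 1) -
        ∑' N : ℕ, (((N : ℝ) + 1) ^ (-u) - ((N : ℝ) + 2) ^ (-u)) * G (N + 1)) (𝓝[>] 0) (𝓝 0) := by
      refine squeeze_zero_norm' ?_ hE
      filter_upwards [self_mem_nhdsWithin] with u hu
      rw [Real.norm_eq_abs]
      exact hsand u hu
    have := hII.add hdiff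
    rw [add_zero] at this
    exact this.congr fun u ↦ by ring
  -- the same limit from the analytic side
  have key2 : Tendsto (fun u : ℝ ↦ (∑' m : ℕ, a m * ((m : ℝ) + 1) ^ (-u)) - (k.factorial : ℝ) / u ^ (k + 1))
      (𝓝[>] 0) (𝓝 ((-1) ^ k * (iteratedDeriv k riemannZeta₀ 1).re)) := by
    have hmap : Tendsto (fun u : ℝ ↦ 1 + u) (𝓝[>] (0 : ℝ)) (𝓝[>] 1) := by
      have hc : ContinuousWithinAt (fun u : ℝ ↦ 1 + u) (Set.Ioi 0) 0 :=
        (continuous_const.add continuous_id).continuousWithinAt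
      have h := hc.tendsto_nhdsWithin (t := Set.Ioi (1 : ℝ)) (fun x hx ↦ by
          simp only [Set.mem_Ioi] at hx ⊢; linarith)
      simpa using h
    have hC := ((Complex.continuous_re.tendsto _).comp
      ((tendsto_LSeries_logPow_one_sub_real k).comp hmap))
    have hval : (((-1 : ℂ) ^ k * iteratedDeriv k riemannZeta₀ 1)).re =
        (-1) ^ k * (iteratedDeriv k riemannZeta₀ 1).re := by
      rw [show ((-1 : ℂ) ^ k) = ((((-1 : ℝ) ^ k : ℝ)) : ℂ) by push_cast; ring, Complex.re_ofReal_mul]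
    rw [hval] at hC
    refine hC.congr' ?_
    filter_upwards [self_mem_nhdsWithin] with u hu
    have hu : 0 < u := hu
    obtain ⟨-, hre⟩ := re_LSeries_logPow_one k hu
    simp only [Function.comp, Complex.sub_re]
    rw [hre]
    congr 1
    rw [show (((1 + u : ℝ) : ℂ) - 1) = ((u : ℝ) : ℂ) by push_cast; ring, ← Complex.ofReal_pow,
      ← Complex.ofReal_inv, ← Complex.ofReal_natCast, ← Complex.ofReal_mul, Complex.ofReal_re]
    rw [div_eq_mul_inv]
  exact tendsto_nhds_unique key key2

/-- Leibniz for `(s−1)·f(s)`: `D^{n+1}[(s−1)f] = (s−1) f^{(n+1)} + (n+1) f^{(n)}` for `f` with all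
iterated derivatives differentiable. [folklore] -/
private theorem iteratedDeriv_sub_one_mul {f : ℂ → ℂ} (hf : ∀ m, Differentiable ℂ (iteratedDeriv m f))
    (n : ℕ) : iteratedDeriv (n + 1) (fun s ↦ (s - 1) * f s) =
      fun s ↦ (s - 1) * iteratedDeriv (n + 1) f s + (n + 1) * iteratedDeriv n f s := by
  induction n with
  | zero =>
    funext s
    rw [iteratedDeriv_one, iteratedDeriv_one, iteratedDeriv_zero]
    have hd : DifferentiableAt ℂ f s := by simpa using hf 0 s
    have h : HasDerivAt (fun s : ℂ ↦ (s - 1) * f s) (1 * f s + (s - 1) * deriv f s) s :=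
      ((hasDerivAt_id' s).sub_const 1).mul hd.hasDerivAt
    rw [h.deriv]
    push_cast
    ring
  | succ n ih =>
    funext s
    rw [iteratedDeriv_succ, ih]
    have h1 : HasDerivAt (iteratedDeriv (n + 1) f) (iteratedDeriv (n + 1 + 1) f s) s := by
      have := (hf (n + 1) s).hasDerivAt
      rwa [← iteratedDeriv_succ] at this
    have h0 : HasDerivAt (iteratedDeriv n f) (iteratedDeriv (n + 1) f s) s := by
      rw [iteratedDeriv_succ]; exact (hf n s).hasDerivAt
    have h : HasDerivAt (fun s : ℂ ↦ (s - 1) * iteratedDeriv (n + 1) f s + (n + 1) * iteratedDeriv n f s)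
        (1 * iteratedDeriv (n + 1) f s + (s - 1) * iteratedDeriv (n + 1 + 1) f s +
          (n + 1) * iteratedDeriv (n + 1) f s) s :=
      (((hasDerivAt_id' s).sub_const 1).mul h1).add (h0.const_mul _)
    rw [h.deriv]
    push_cast
    ring

/-- All iterated derivatives of the entire function `ζ₀` are differentiable. [folklore] -/
private theorem differentiable_iteratedDeriv_riemannZeta₀ (m : ℕ) :
    Differentiable ℂ (iteratedDeriv m riemannZeta₀) := by
  have hA : AnalyticOnNhd ℂ riemannZeta₀ Set.univ :=
    differentiable_riemannZeta₀.differentiableOn.analyticOnNhd isOpen_univ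
  rw [iteratedDeriv_eq_iterate]
  exact differentiableOn_univ.1 (hA.iterated_deriv m).differentiableOn

/-- `ζ₁^{(n+1)}(1) = (n+1) ζ₀^{(n)}(1)` (`ζ₁(s) = 1 + (s−1)ζ₀(s)`). [folklore] -/
private theorem iteratedDeriv_riemannZeta₁_one (n : ℕ) :
    iteratedDeriv (n + 1) riemannZeta₁ 1 = ((n : ℂ) + 1) * iteratedDeriv n riemannZeta₀ 1 := by
  have e : riemannZeta₁ = fun s ↦ 1 + (s - 1) * riemannZeta₀ s := rfl
  rw [e, iteratedDeriv_succ', show deriv (fun s ↦ 1 + (s - 1) * riemannZeta₀ s) =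
      deriv (fun s ↦ (s - 1) * riemannZeta₀ s) from by funext s; rw [deriv_const_add],
    ← iteratedDeriv_succ', iteratedDeriv_sub_one_mul differentiable_iteratedDeriv_riemannZeta₀ n]
  simp

/-- **Discharge of `Coffey2008_eq31`** ([Coffey2008] eq. (3.1) with (3.2) p.714; Stieltjes, Briggs): the
Taylor coefficients of `ζ₁(s) = (s−1)ζ(s)` at `1` are `u_{n+1} = (−1)^n γ_n/n!`, i.e.
`ζ(s) = 1/(s−1) + Σ_n ((−1)^n/n!) γ_n (s−1)^n`.  From `stieltjesGamma_eq_re_iteratedDeriv`,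
`ζ₁^{(n+1)}(1) = (n+1) ζ₀^{(n)}(1)` and the reality of the `u_i` (`Xiao2020.zetaOneTaylorCoeff_im`).
[cite: Coffey2008, eqs. (3.1)–(3.2) p.714] -/
theorem Coffey2008_eq31_holds : Coffey2008_eq31 := by
  intro n
  have hγ := stieltjesGamma_eq_re_iteratedDeriv n
  have him := Xiao2020.zetaOneTaylorCoeff_im (n + 1)
  have hu : Xiao2020.zetaOneTaylorCoeff (n + 1) = iteratedDeriv n riemannZeta₀ 1 / (n ! : ℂ) := by
    unfold Xiao2020.zetaOneTaylorCoeff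
    rw [iteratedDeriv_riemannZeta₁_one, Nat.factorial_succ]
    push_cast
    have h1 : ((n : ℂ) + 1) ≠ 0 := by exact_mod_cast Nat.succ_ne_zero n
    have h2 : (n ! : ℂ) ≠ 0 := by exact_mod_cast (Nat.factorial_pos n).ne'
    field_simp
  rw [hu] at him ⊢
  have hfac : (n ! : ℂ) = ((n ! : ℝ) : ℂ) := by push_cast; rfl
  -- real and imaginary parts
  have hre : (iteratedDeriv n riemannZeta₀ 1 / (n ! : ℂ)).re =
      (iteratedDeriv n riemannZeta₀ 1).re / (n ! : ℝ) := by
    rw [hfac, Complex.div_ofReal_re]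
  have him' : (iteratedDeriv n riemannZeta₀ 1 / (n ! : ℂ)).im =
      (iteratedDeriv n riemannZeta₀ 1).im / (n ! : ℝ) := by
    rw [hfac, Complex.div_ofReal_im]
  have e2 : (-1 : ℝ) ^ n * (-1) ^ n = 1 := by rw [← mul_pow]; norm_num
  have hre' : (iteratedDeriv n riemannZeta₀ 1).re = (-1) ^ n * stieltjesGamma n := by
    rw [hγ, ← mul_assoc, e2, one_mul]
  apply Complex.ext
  · rw [hre, Complex.ofReal_re, hre', mul_div_assoc]
  · rw [Complex.ofReal_im, him]

end Stieltjes

/-! ## Coffey 2008, Prop. 3.2: the `η_j` from the Stieltjes constants (power-series algebra) -/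

section LogDerivCoefficients

open PowerSeries

/-- **Coefficients of a logarithmic derivative.**  For power series `G`, `Q` over `ℂ` with `G(0) = 0` and
`(1 + G) Q = (1 + G)'`: for `n < M`, `[X^n] Q = (n+1) Σ_{h ≤ M} ((−1)^{h+1}/h) [X^{n+1}] G^h`
(the derivative of the truncated logarithm `Σ_{h≤M} ((−1)^{h+1}/h) G^h`). [folklore] -/
private theorem coeff_logDeriv_eq {G Q : PowerSeries ℂ} (hG : constantCoeff G = 0)
    (hQ : (1 + G) * Q = derivative ℂ (1 + G)) {M n : ℕ} (hn : n < M) :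
    coeff n Q = ((n : ℂ) + 1) * ∑ h ∈ Finset.range (M + 1),
      ((-1 : ℂ) ^ (h + 1) / h) * coeff (n + 1) (G ^ h) := by
  set D := derivative ℂ with hDdef
  set Lg : PowerSeries ℂ := ∑ h ∈ Finset.range (M + 1), C ((-1 : ℂ) ^ (h + 1) / h) * G ^ h with hLg
  -- derivative of the truncated logarithm
  have hterm : ∀ h : ℕ, D (C ((-1 : ℂ) ^ (h + 1) / h) * G ^ h) =
      C ((-1 : ℂ) ^ (h + 1) / h) * ((h : PowerSeries ℂ) * (G ^ (h - 1) * D G)) := by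
    intro h
    rw [Derivation.leibniz, derivative_C, smul_zero, add_zero, Derivation.leibniz_pow, smul_eq_mul,
      smul_eq_mul, nsmul_eq_mul]
  have hD : D Lg = D G * ∑ j ∈ Finset.range M, (-G) ^ j := by
    simp only [hLg, map_sum, hterm]
    rw [Finset.sum_range_succ', Finset.mul_sum]
    simp only [Nat.cast_zero, zero_mul, mul_zero, add_zero, Nat.add_sub_cancel]
    refine Finset.sum_congr rfl fun h _ ↦ ?_
    rw [neg_pow G h]
    have hc : ((-1 : ℂ) ^ (h + 1 + 1) / ((h + 1 : ℕ) : ℂ)) * ((h + 1 : ℕ) : ℂ) = (-1) ^ h := by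
      have : ((h + 1 : ℕ) : ℂ) ≠ 0 := by exact_mod_cast Nat.succ_ne_zero h
      field_simp
      ring
    calc C ((-1 : ℂ) ^ (h + 1 + 1) / ((h + 1 : ℕ) : ℂ)) * ((((h + 1 : ℕ) : ℕ) : PowerSeries ℂ) *
          (G ^ h * D G))
        = C (((-1 : ℂ) ^ (h + 1 + 1) / ((h + 1 : ℕ) : ℂ)) * ((h + 1 : ℕ) : ℂ)) * (G ^ h * D G) := by
          rw [map_mul, map_natCast]; ring
      _ = D G * ((-1) ^ h * G ^ h) := by
          rw [hc, map_pow, map_neg, map_one]; ring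
  -- `(1 + G) · (D Lg) = D G · (1 − (−G)^M)`
  have hgeom : (1 + G) * ∑ j ∈ Finset.range M, (-G) ^ j = 1 - (-G) ^ M := by
    have := mul_neg_geom_sum (-G) M
    rwa [sub_neg_eq_add] at this
  have hDG : D (1 + G) = D G := by rw [map_add, Derivation.map_one_eq_zero, zero_add]
  have hkey : (1 + G) * (D Lg - Q) = -(D G * (-G) ^ M) := by
    rw [mul_sub, hQ, hDG, hD, ← mul_assoc, mul_comm (1 + G), mul_assoc, hgeom]
    ring
  -- divisibility by `X^M`
  have hXG : (X : PowerSeries ℂ) ^ M ∣ (-G) ^ M :=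
    pow_dvd_pow_of_dvd (X_dvd_iff.2 (by rw [map_neg, hG, neg_zero])) M
  have hunit : IsUnit (1 + G) := by
    rw [isUnit_iff_constantCoeff, map_add, map_one, hG, add_zero]
    exact isUnit_one
  have hdvd : (X : PowerSeries ℂ) ^ M ∣ D Lg - Q := by
    rw [← hunit.dvd_mul_left, hkey]
    exact (hXG.mul_left (D G)).neg_right
  have hcoeff := (X_pow_dvd_iff.1 hdvd) n hn
  rw [map_sub, sub_eq_zero] at hcoeff
  rw [← hcoeff, hDdef, coeff_derivative, hLg, map_sum]
  simp only [coeff_C_mul]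
  ring

/-- The `N`-th coefficient of `G^h` as a sum over `h`-tuples summing to `N`. [folklore] -/
private theorem coeff_pow_eq_sum_antidiagonalTuple (G : PowerSeries ℂ) (h N : ℕ) :
    coeff N (G ^ h) = ∑ x ∈ Finset.Nat.antidiagonalTuple h N, ∏ b, coeff (x b) G := by
  induction h generalizing N with
  | zero =>
    rcases Nat.eq_zero_or_pos N with rfl | hN
    · simp [Finset.Nat.antidiagonalTuple_zero_right]
    · obtain ⟨N', rfl⟩ : ∃ N', N = N' + 1 := ⟨N - 1, by omega⟩
      simp [pow_zero, coeff_one]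
  | succ h ih =>
    rw [pow_succ', coeff_mul]
    simp_rw [ih, Finset.mul_sum]
    -- reindex the tuples `z = Fin.cons a x`
    classical
    rw [Finset.sum_sigma']
    refine Finset.sum_nbij' (fun p ↦ Fin.cons p.1.1 p.2) (fun z ↦ ⟨(z 0, ∑ i, Fin.tail z i), Fin.tail z⟩)
      ?_ ?_ ?_ ?_ ?_
    · rintro ⟨⟨a, b⟩, x⟩ hp
      simp only [Finset.mem_sigma, Finset.HasAntidiagonal.mem_antidiagonal,
        Finset.Nat.mem_antidiagonalTuple] at hp
      simp only [Finset.Nat.mem_antidiagonalTuple, Fin.sum_univ_succ, Fin.cons_zero, Fin.cons_succ]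
      omega
    · intro z hz
      simp only [Finset.Nat.mem_antidiagonalTuple, Fin.sum_univ_succ] at hz
      simp only [Finset.mem_sigma, Finset.HasAntidiagonal.mem_antidiagonal,
        Finset.Nat.mem_antidiagonalTuple, Fin.tail]
      exact ⟨hz, trivial⟩
    · rintro ⟨⟨a, b⟩, x⟩ hp
      simp only [Finset.mem_sigma, Finset.HasAntidiagonal.mem_antidiagonal,
        Finset.Nat.mem_antidiagonalTuple] at hp
      simp only [Fin.cons_zero, Fin.tail_cons, hp.2]
    · intro z _
      simp only [Fin.cons_self_tail]
    · rintro ⟨⟨a, b⟩, x⟩ _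
      simp only [Fin.prod_univ_succ, Fin.cons_zero, Fin.cons_succ]

/-- Shift of the tuples when the constant coefficient vanishes: for `g 0 = 0`,
`Σ_{x ∈ T(h,N)} Π_b g(x_b) = Σ_{y ∈ T(h,N−h)} Π_b g(y_b + 1)` if `h ≤ N`, and `= 0` if `N < h`.
[folklore] -/
private theorem sum_antidiagonalTuple_shift (g : ℕ → ℂ) (hg : g 0 = 0) (h N : ℕ) :
    ∑ x ∈ Finset.Nat.antidiagonalTuple h N, ∏ b, g (x b) =
      if h ≤ N then ∑ y ∈ Finset.Nat.antidiagonalTuple h (N - h), ∏ b, g (y b + 1) else 0 := by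
  classical
  -- a tuple with a zero entry contributes nothing
  have hzero : ∀ x : Fin h → ℕ, (∃ b, x b = 0) → ∏ b, g (x b) = 0 := by
    rintro x ⟨b, hb⟩
    exact Finset.prod_eq_zero (Finset.mem_univ b) (by rw [hb, hg])
  split_ifs with hhN
  · -- the image of the shift `y ↦ y + 1`
    set e : (Fin h → ℕ) ↪ (Fin h → ℕ) :=
      ⟨fun y b ↦ y b + 1, fun y y' hyy' ↦ by funext b; simpa using congrFun hyy' b⟩ with he
    have himg : ∑ y ∈ Finset.Nat.antidiagonalTuple h (N - h), ∏ b, g (y b + 1) =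
        ∑ x ∈ (Finset.Nat.antidiagonalTuple h (N - h)).map e, ∏ b, g (x b) := by
      rw [Finset.sum_map]
      rfl
    rw [himg]
    symm
    refine Finset.sum_subset ?_ ?_
    · intro x hx
      rw [Finset.mem_map] at hx
      obtain ⟨y, hy, rfl⟩ := hx
      rw [Finset.Nat.mem_antidiagonalTuple] at hy ⊢
      show ∑ b, (y b + 1) = N
      rw [Finset.sum_add_distrib, hy]
      simp only [Finset.sum_const, Finset.card_univ, Fintype.card_fin, smul_eq_mul, mul_one]
      omega
    · intro x hx hx'
      apply hzero
      rcases em (∃ b, x b = 0) with hex | hne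
      · exact hex
      · exfalso
        have hne' : ∀ b, x b ≠ 0 := fun b hb ↦ hne ⟨b, hb⟩
        apply hx'
        rw [Finset.mem_map]
        refine ⟨fun b ↦ x b - 1, ?_, ?_⟩
        · rw [Finset.Nat.mem_antidiagonalTuple] at hx ⊢
          have e1 : ∑ b, x b = ∑ b, (x b - 1) + h := by
            have : ∑ b : Fin h, x b = ∑ b : Fin h, ((x b - 1) + 1) :=
              Finset.sum_congr rfl fun b _ ↦
                (Nat.sub_add_cancel (Nat.one_le_iff_ne_zero.2 (hne' b))).symm
            rw [this, Finset.sum_add_distrib]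
            simp
          omega
        · funext b
          exact Nat.sub_add_cancel (Nat.one_le_iff_ne_zero.2 (hne' b))
  · rw [not_le] at hhN
    refine Finset.sum_eq_zero fun x hx ↦ hzero x ?_
    rcases em (∃ b, x b = 0) with hex | hne
    · exact hex
    · exfalso
      have hne' : ∀ b, x b ≠ 0 := fun b hb ↦ hne ⟨b, hb⟩
      rw [Finset.Nat.mem_antidiagonalTuple] at hx
      have : h ≤ ∑ b : Fin h, x b := by
        calc h = ∑ _b : Fin h, 1 := by simp
          _ ≤ ∑ b : Fin h, x b := Finset.sum_le_sum fun b _ ↦ Nat.one_le_iff_ne_zero.2 (hne' b)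
      omega


/-- Reindexing `Icc 1 (n+1)` by `range (n+1)`. [folklore] -/
private theorem sum_Icc_one_succ_eq_sum_range {M : Type*} [AddCommMonoid M] (f : ℕ → M) (n : ℕ) :
    ∑ h ∈ Finset.Icc 1 (n + 1), f h = ∑ j ∈ Finset.range (n + 1), f (j + 1) := by
  rw [← Finset.Ico_add_one_right_eq_Icc, Finset.sum_Ico_eq_sum_range]
  simp only [Nat.add_sub_cancel, add_comm 1]

/-- **Discharge of `Coffey2008_prop32`** ([Coffey2008] Prop. 3.2, eq. (3.12) p.715; Matsuoka): for `k ≥ 2`,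
`η_{k−1} = (−1)^k k Σ_{h=1}^k (1/h) Σ_{j₁+⋯+j_h = k−h} Π_b γ_{j_b}/j_b!`.  Route (power-series algebra, as
printed: «(3.6) and (3.9)», i.e. `log ζ₁` expanded in the `(s−1)^{n+1} (−1)^n γ_n/n!`): with
`F = Σ u_i X^i` (`u_i = ζ₁^{(i)}(1)/i!`, `u_0 = 1`), `G = F − 1` and `Q = Σ q_m X^m` (`q_m = (ζ₁'/ζ₁)^{(m)}(1)/m!`),
the convolution `F Q = F'` (`Xiao2020.sum_zetaOneTaylorCoeff_mul`) makes `Q` the derivative of the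
truncated logarithm `Σ_h ((−1)^{h+1}/h) G^h` up to high order (`coeff_logDeriv_eq`); the coefficients of
`G^h` are sums over compositions (`coeff_pow_eq_sum_antidiagonalTuple`, `sum_antidiagonalTuple_shift`);
finally `u_{j+1} = (−1)^j γ_j/j!` (`Coffey2008_eq31_holds`) and `η_m = −Re q_m`.
[cite: Coffey2008, Prop. 3.2 eq. (3.12) p.715] -/
theorem Coffey2008_prop32_holds : Coffey2008_prop32 := by
  intro k hk
  obtain ⟨n, rfl⟩ : ∃ n, k = n + 1 := ⟨k - 1, by omega⟩
  simp only [Nat.add_sub_cancel]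
  -- the power series
  set u : ℕ → ℂ := fun i ↦ Xiao2020.zetaOneTaylorCoeff i with hu
  set F : PowerSeries ℂ := PowerSeries.mk u with hF
  set G : PowerSeries ℂ := F - 1 with hG
  set Q : PowerSeries ℂ := PowerSeries.mk fun m ↦ Xiao2020.zetaOneLogDerivCoeff m with hQ
  have hu0 : u 0 = 1 := by simp [hu, Xiao2020.zetaOneTaylorCoeff, riemannZeta₁_one]
  have hG0 : PowerSeries.constantCoeff G = 0 := by
    simp [hG, hF, hu0]
  have hFG : 1 + G = F := by rw [hG]; ring
  have hconv : (1 + G) * Q = PowerSeries.derivative ℂ (1 + G) := by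
    rw [hFG]
    ext m
    rw [PowerSeries.coeff_mul, PowerSeries.coeff_derivative,
      Finset.Nat.sum_antidiagonal_eq_sum_range_succ_mk]
    simp only [hF, hQ, PowerSeries.coeff_mk, hu]
    rw [Xiao2020.sum_zetaOneTaylorCoeff_mul m]
    ring
  have hcoef := coeff_logDeriv_eq hG0 hconv (M := n + 1) (n := n) (by omega)
  have hqn : PowerSeries.coeff n Q = Xiao2020.zetaOneLogDerivCoeff n := by simp [hQ]
  -- coefficients of `G`
  have hg : ∀ i, PowerSeries.coeff i G = if i = 0 then 0 else u i := by
    intro i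
    simp only [hG, hF, map_sub, PowerSeries.coeff_mk, PowerSeries.coeff_one]
    split_ifs with h
    · simp [h, hu0]
    · simp
  -- coefficients of `G^h`
  have hpow : ∀ h, PowerSeries.coeff (n + 1) (G ^ h) = if h ≤ n + 1 then
      ∑ y ∈ Finset.Nat.antidiagonalTuple h (n + 1 - h), ∏ b, u (y b + 1) else 0 := by
    intro h
    rw [coeff_pow_eq_sum_antidiagonalTuple]
    simp_rw [hg]
    rw [sum_antidiagonalTuple_shift (fun i ↦ if i = 0 then 0 else u i) (by simp)]
    simp
  -- `q_n` as an explicit sum over `h = 1..n+1`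
  have hq : Xiao2020.zetaOneLogDerivCoeff n = ((n : ℂ) + 1) * ∑ j ∈ Finset.range (n + 1),
      ((-1 : ℂ) ^ (j + 1 + 1) / ((j + 1 : ℕ) : ℂ)) *
        ∑ y ∈ Finset.Nat.antidiagonalTuple (j + 1) (n + 1 - (j + 1)), ∏ b, u (y b + 1) := by
    rw [← hqn, hcoef]
    congr 1
    rw [Finset.sum_range_succ']
    simp only [Nat.cast_zero, div_zero, zero_mul, add_zero]
    refine Finset.sum_congr rfl fun j hj ↦ ?_
    rw [Finset.mem_range] at hj
    rw [hpow (j + 1), if_pos (by omega)]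
  -- the values `u (j+1) = (−1)^j γ_j / j!`
  have hu' : ∀ j, u (j + 1) = (((-1 : ℝ) ^ j * stieltjesGamma j / (j.factorial : ℝ) : ℝ) : ℂ) :=
    fun j ↦ Coffey2008_eq31_holds j
  -- assemble: `η_n = −Re q_n`
  rw [liEta_eq_neg_re_zetaOneLogDerivCoeff, hq, sum_Icc_one_succ_eq_sum_range]
  -- everything is real: rewrite the complex expression as a real cast
  -- the inner sums in terms of the `γ_j`
  have hS : ∀ j, j ≤ n → ∑ y ∈ Finset.Nat.antidiagonalTuple (j + 1) (n - j), ∏ b, u (y b + 1) =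
      (-1 : ℂ) ^ (n - j) * ∑ c ∈ Finset.Nat.antidiagonalTuple (j + 1) (n - j),
        ∏ b, ((stieltjesGamma (c b) : ℂ) / ((c b).factorial : ℂ)) := by
    intro j hj
    rw [Finset.mul_sum]
    refine Finset.sum_congr rfl fun c hc ↦ ?_
    rw [Finset.Nat.mem_antidiagonalTuple] at hc
    simp_rw [hu']
    push_cast
    rw [← hc, ← Finset.prod_pow_eq_pow_sum, ← Finset.prod_mul_distrib]
    exact Finset.prod_congr rfl fun b _ ↦ by ring
  have hreal : ((n : ℂ) + 1) * ∑ j ∈ Finset.range (n + 1),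
      ((-1 : ℂ) ^ (j + 1 + 1) / ((j + 1 : ℕ) : ℂ)) *
        ∑ y ∈ Finset.Nat.antidiagonalTuple (j + 1) (n + 1 - (j + 1)), ∏ b, u (y b + 1) =
      ((-((-1 : ℝ) ^ (n + 1) * ((n + 1 : ℕ) : ℝ) * ∑ j ∈ Finset.range (n + 1),
        (1 / ((j + 1 : ℕ) : ℝ)) * ∑ c ∈ Finset.Nat.antidiagonalTuple (j + 1) (n + 1 - (j + 1)),
          ∏ b, stieltjesGamma (c b) / ((c b).factorial : ℝ)) : ℝ) : ℂ) := by
    push_cast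
    calc ((n : ℂ) + 1) * ∑ j ∈ Finset.range (n + 1), ((-1 : ℂ) ^ (j + 1 + 1) / ((j : ℂ) + 1)) *
          ∑ y ∈ Finset.Nat.antidiagonalTuple (j + 1) (n - j), ∏ b, u (y b + 1)
        = ∑ j ∈ Finset.range (n + 1), ((n : ℂ) + 1) * (((-1 : ℂ) ^ (j + 1 + 1) / ((j : ℂ) + 1)) *
          ∑ y ∈ Finset.Nat.antidiagonalTuple (j + 1) (n - j), ∏ b, u (y b + 1)) := Finset.mul_sum _ _ _
      _ = ∑ j ∈ Finset.range (n + 1), -((-1 : ℂ) ^ (n + 1) * ((n : ℂ) + 1) * (1 / ((j : ℂ) + 1) *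
          ∑ c ∈ Finset.Nat.antidiagonalTuple (j + 1) (n - j),
            ∏ b, ((stieltjesGamma (c b) : ℂ) / ((c b).factorial : ℂ)))) := by
          refine Finset.sum_congr rfl fun j hj ↦ ?_
          rw [Finset.mem_range] at hj
          rw [hS j (by omega)]
          have hj0 : ((j : ℂ) + 1) ≠ 0 := by exact_mod_cast Nat.succ_ne_zero j
          obtain ⟨d, rfl⟩ := Nat.exists_eq_add_of_le (show j ≤ n by omega)
          simp only [Nat.add_sub_cancel_left]
          field_simp
          ring
      _ = -((-1 : ℂ) ^ (n + 1) * ((n : ℂ) + 1) * ∑ j ∈ Finset.range (n + 1), (1 / ((j : ℂ) + 1) *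
          ∑ c ∈ Finset.Nat.antidiagonalTuple (j + 1) (n - j),
            ∏ b, ((stieltjesGamma (c b) : ℂ) / ((c b).factorial : ℂ)))) := by
          rw [Finset.mul_sum, Finset.sum_neg_distrib]
  rw [hreal, Complex.ofReal_re]
  push_cast
  ring

end LogDerivCoefficients

/-- **Discharge of `Coffey2008_prop31`** ([Coffey2008] Prop. 3.1, eq. (3.10) p.715): `λ_n` in terms of the
Stieltjes constants, from Prop. 3.2 (`Coffey2008_prop32_holds`) and the landed reduction
`Coffey2008_prop31_of_prop32` (arithmetic formula `λ_n = λ̄_n + λ̃_n`, `η₀ = −γ`).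
[cite: Coffey2008, Prop. 3.1 eq. (3.10) p.715] -/
theorem Coffey2008_prop31_holds : Coffey2008_prop31 :=
  Coffey2008_prop31_of_prop32 Coffey2008_prop32_holds


/-! ## Voros 2018, eq. (AID): the partial-fraction identities for the coefficients `A_{nm}` -/

section PartialFractions

open Polynomial

/-- `P_n(2m) · 2^n (m+n)! (2m)! = (2m+2n)! m!`, where `P_n(x) = Π_{m'=1}^n (x + 2m' − 1)`. [folklore] -/
private theorem prod_odd_shift (m n : ℕ) :
    (∏ i ∈ Finset.range n, (2 * (m : ℝ) + 2 * (i : ℝ) + 1)) * (2 : ℝ) ^ n * ((m + n).factorial : ℝ) *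
        ((2 * m).factorial : ℝ) = ((2 * m + 2 * n).factorial : ℝ) * (m.factorial : ℝ) := by
  induction n with
  | zero => simp [mul_comm]
  | succ n ih =>
    rw [Finset.prod_range_succ, show m + (n + 1) = (m + n) + 1 by ring,
      show 2 * m + 2 * (n + 1) = (2 * m + 2 * n + 1) + 1 by ring, Nat.factorial_succ,
      Nat.factorial_succ (2 * m + 2 * n + 1), Nat.factorial_succ (2 * m + 2 * n)]
    push_cast
    linear_combination (2 * ((m : ℝ) + n + 1) * (2 * (m : ℝ) + 2 * n + 1)) * ih

/-- `P_n(1) = Π_{m'=1}^n 2m' = 2^n n!`. [folklore] -/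
private theorem prod_even (n : ℕ) :
    ∏ i ∈ Finset.range n, ((1 : ℝ) + 2 * (i : ℝ) + 1) = (2 : ℝ) ^ n * (n.factorial : ℝ) := by
  induction n with
  | zero => simp
  | succ n ih =>
    rw [Finset.prod_range_succ, ih, Nat.factorial_succ]
    push_cast
    ring

/-- `Π_{j=0}^{n} (1 − 2j) · 2^n n! = (−1)^n (2n)!`. [folklore] -/
private theorem prod_one_sub_even (n : ℕ) :
    (∏ j ∈ Finset.range (n + 1), ((1 : ℝ) - 2 * (j : ℝ))) * (2 : ℝ) ^ n * (n.factorial : ℝ) =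
      (-1) ^ n * ((2 * n).factorial : ℝ) := by
  induction n with
  | zero => simp
  | succ n ih =>
    rw [Finset.prod_range_succ, show 2 * (n + 1) = (2 * n + 1) + 1 by ring, Nat.factorial_succ,
      Nat.factorial_succ (2 * n + 1), Nat.factorial_succ (2 * n)]
    push_cast
    linear_combination (-(2 * ((n : ℝ) + 1)) * (2 * n + 1)) * ih

/-- `Π_{j ≤ n, j ≠ m} (2m − 2j) = 2^n (−1)^{n−m} m! (n−m)!` for `m ≤ n`. [folklore] -/
private theorem prod_erase_even_diff {m n : ℕ} (hmn : m ≤ n) :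
    ∏ j ∈ (Finset.range (n + 1)).erase m, (2 * (m : ℝ) - 2 * (j : ℝ)) =
      (2 : ℝ) ^ n * (-1) ^ (n - m) * (m.factorial : ℝ) * ((n - m).factorial : ℝ) := by
  induction n with
  | zero =>
    obtain rfl : m = 0 := by omega
    simp
  | succ n ih =>
    rcases Nat.lt_or_ge m (n + 1) with hlt | hge
    · -- `m ≤ n`: add the factor `j = n+1`
      have h1 : (Finset.range (n + 1 + 1)).erase m = insert (n + 1) ((Finset.range (n + 1)).erase m) := by
        rw [Finset.range_add_one (n := n + 1), Finset.erase_insert_of_ne (by omega)]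
      have h2 : (n + 1) ∉ (Finset.range (n + 1)).erase m := by simp
      rw [h1, Finset.prod_insert h2, ih (by omega), show n + 1 - m = (n - m) + 1 by omega,
        Nat.factorial_succ, pow_succ, pow_succ]
      push_cast
      rw [Nat.cast_sub (by omega : m ≤ n)]
      ring
    · -- `m = n+1`: the product over `j < n+1`
      obtain rfl : m = n + 1 := by omega
      have h1 : (Finset.range (n + 1 + 1)).erase (n + 1) = Finset.range (n + 1) := by
        rw [Finset.range_add_one (n := n + 1), Finset.erase_insert (by simp)]
      rw [h1, Nat.sub_self, pow_zero, Nat.factorial_zero, Nat.cast_one, mul_one, mul_one]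
      -- `Π_{j ≤ n} (2(n+1) − 2j) = 2^{n+1} (n+1)!`
      clear ih hmn hge h1
      induction n with
      | zero => simp
      | succ k ihk =>
        rw [Finset.prod_range_succ']
        have e : ∀ j ∈ Finset.range (k + 1), (2 * (((k + 1 + 1 : ℕ) : ℝ)) - 2 * (((j + 1 : ℕ) : ℝ))) =
            (2 * (((k + 1 : ℕ) : ℝ)) - 2 * ((j : ℕ) : ℝ)) := by intro j _; push_cast; ring
        rw [Finset.prod_congr rfl e, ihk, Nat.factorial_succ (k + 1), pow_succ]
        push_cast
        ring


/-- Reindexing `Icc 1 n` by `range n`. [folklore] -/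
private theorem sum_Icc_one_eq_sum_range' {M : Type*} [AddCommMonoid M] (f : ℕ → M) (n : ℕ) :
    ∑ h ∈ Finset.Icc 1 n, f h = ∑ j ∈ Finset.range n, f (j + 1) := by
  rw [← Finset.Ico_add_one_right_eq_Icc, Finset.sum_Ico_eq_sum_range]
  simp only [Nat.add_sub_cancel, add_comm 1]

/-- **Discharge of `Voros2018_eqAID`** ([Voros2018] §2.1 eq. (AID) p.5): `Σ_{m=0}^n (−1)^m A_{nm} =
1/A_{n0}` and `2 Σ_{m=1}^n (−1)^m m A_{nm} = (−1)^n + 1/A_{n0}`.  Printed route: the partial-fraction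
decomposition (PFD) of `f_n(x) = Π_{m=1}^n (x+2m−1) / (x(x−1)Π_{m=1}^n (x−2m))` against `f_n ∼ 1/x²`.
Realised as the two divided-difference identities of Lagrange interpolation (`Lagrange.coeff_eq_sum`)
for `P_n(x) = Π_{m=1}^n (x + 2m − 1)` at the `n+2` nodes `0, 2, …, 2n, 1`: `[x^{n+1}] P_n = 0` and
`[x^{n+1}] (x P_n) = 1`, the weights being `P_n(2m)/((2m−1)Π_{m'≠m}(2m−2m')) = (−1)^{n+m} A_{nm}` and
`P_n(1)/Π_{m'}(1−2m') = −(−1)^n/A_{n0}` (the residues of (PFD)). [cite: Voros2018, §2.1 eq. (AID) p.5] -/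
theorem Voros2018_eqAID_holds : Voros2018_eqAID := by
  intro n hn
  classical
  -- nodes `v i = 2i` (`i ≤ n`), `v (n+1) = 1`
  set v : ℕ → ℝ := fun i ↦ if i = n + 1 then 1 else 2 * (i : ℝ) with hv
  have hv1 : v (n + 1) = 1 := by simp [hv]
  have hv2 : ∀ i, i ≠ n + 1 → v i = 2 * (i : ℝ) := fun i hi ↦ by simp [hv, hi]
  have hvs : Set.InjOn v ↑(Finset.range (n + 2)) := by
    intro i hi j hj hij
    rw [Finset.coe_range, Set.mem_Iio] at hi hj
    by_cases h1 : i = n + 1 <;> by_cases h2 : j = n + 1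
    · omega
    · exfalso
      rw [h1, hv1, hv2 j h2] at hij
      have h' : (1 : ℤ) = 2 * (j : ℤ) := by exact_mod_cast hij
      omega
    · exfalso
      rw [h2, hv1, hv2 i h1] at hij
      have h' : 2 * (i : ℤ) = 1 := by exact_mod_cast hij
      omega
    · rw [hv2 i h1, hv2 j h2] at hij
      have : (i : ℝ) = j := by linarith
      exact_mod_cast this
  -- the polynomial `P = Π_{i<n} (X + (2i+1))`
  set P : ℝ[X] := ∏ i ∈ Finset.range n, (X + C (2 * (i : ℝ) + 1)) with hP
  have hPmonic : P.Monic := monic_prod_of_monic _ _ fun i _ ↦ monic_X_add_C _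
  have hPdeg : P.natDegree = n := by
    rw [hP, natDegree_prod_of_monic _ _ fun i _ ↦ monic_X_add_C _,
      Finset.sum_congr rfl fun (i : ℕ) _ ↦ natDegree_X_add_C (2 * (i : ℝ) + 1)]
    simp
  have hPeval : ∀ x : ℝ, P.eval x = ∏ i ∈ Finset.range n, (x + 2 * (i : ℝ) + 1) := by
    intro x
    simp only [hP, eval_prod, eval_add, eval_X, eval_C]
    exact Finset.prod_congr rfl fun i _ ↦ by ring
  have hcard : (Finset.range (n + 2)).card = n + 2 := Finset.card_range _
  have hP0 : P ≠ 0 := hPmonic.ne_zero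
  have hdegP : P.degree < ((Finset.range (n + 2)).card : WithBot ℕ) := by
    rw [hcard, degree_eq_natDegree hP0, hPdeg]; exact_mod_cast (by omega : n < n + 2)
  have hdegXP : (X * P).degree < ((Finset.range (n + 2)).card : WithBot ℕ) := by
    rw [hcard, degree_eq_natDegree (mul_ne_zero X_ne_zero hP0), natDegree_X_mul hP0, hPdeg]
    exact_mod_cast (by omega : n + 1 < n + 2)
  have h1 := Lagrange.coeff_eq_sum hvs hdegP
  have h2 := Lagrange.coeff_eq_sum hvs hdegXP
  rw [hcard, show n + 2 - 1 = n + 1 by omega,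
    coeff_eq_zero_of_natDegree_lt (by rw [hPdeg]; omega)] at h1
  rw [hcard, show n + 2 - 1 = n + 1 by omega, coeff_X_mul, ← hPdeg, hPmonic.coeff_natDegree,
    hPdeg] at h2
  -- the denominators
  have hD1 : ∀ i, i < n + 1 → ∏ j ∈ (Finset.range (n + 2)).erase i, (v i - v j) =
      (2 * (i : ℝ) - 1) * ((2 : ℝ) ^ n * (-1) ^ (n - i) * (i.factorial : ℝ) * ((n - i).factorial : ℝ)) := by
    intro i hi
    have he : (Finset.range (n + 2)).erase i = insert (n + 1) ((Finset.range (n + 1)).erase i) := by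
      rw [Finset.range_add_one (n := n + 1), Finset.erase_insert_of_ne (by omega)]
    rw [he, Finset.prod_insert (by simp), hv2 i (by omega), hv1, ← prod_erase_even_diff (by omega)]
    congr 1
    refine Finset.prod_congr rfl fun j hj ↦ ?_
    rw [hv2 j (by have := Finset.mem_range.1 (Finset.mem_of_mem_erase hj); omega)]
  have hD2 : ∏ j ∈ (Finset.range (n + 2)).erase (n + 1), (v (n + 1) - v j) =
      ∏ j ∈ Finset.range (n + 1), ((1 : ℝ) - 2 * (j : ℝ)) := by
    have he : (Finset.range (n + 2)).erase (n + 1) = Finset.range (n + 1) := by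
      rw [Finset.range_add_one (n := n + 1), Finset.erase_insert (by simp)]
    rw [he]
    refine Finset.prod_congr rfl fun j hj ↦ ?_
    rw [hv1, hv2 j (by have := Finset.mem_range.1 hj; omega)]
  -- the weights
  have hfact : ∀ k : ℕ, ((k.factorial : ℝ)) ≠ 0 := fun k ↦ by exact_mod_cast k.factorial_ne_zero
  have hterm : ∀ i, i < n + 1 → P.eval (v i) / ∏ j ∈ (Finset.range (n + 2)).erase i, (v i - v j) =
      (-1) ^ (n + i) * vorosA n i := by
    intro i hi
    rw [hD1 i hi, hv2 i (by omega), hPeval]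
    have hodd : (2 * (i : ℝ) - 1) ≠ 0 := by
      intro h
      have h' : 2 * (i : ℤ) - 1 = 0 := by exact_mod_cast h
      omega
    have hf1 := hfact (i + n)
    have hf2 := hfact (2 * i)
    have hf3 := hfact i
    have hf4 := hfact (n - i)
    have hPi : ∏ x ∈ Finset.range n, (2 * (i : ℝ) + 2 * (x : ℝ) + 1) =
        ((2 * i + 2 * n).factorial : ℝ) * (i.factorial : ℝ) /
          ((2 : ℝ) ^ n * ((i + n).factorial : ℝ) * ((2 * i).factorial : ℝ)) := by
      rw [eq_div_iff (by positivity)]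
      have hp := prod_odd_shift i n
      linear_combination hp
    have hs1 : ((-1 : ℝ) ^ (n - i)) * (-1) ^ (n + i) = 1 := by
      rw [← pow_add, show n - i + (n + i) = 2 * n by omega, pow_mul]; norm_num
    have h4 : (4 : ℝ) ^ n = 2 ^ n * 2 ^ n := by rw [← mul_pow]; norm_num
    have hε : ((-1 : ℝ) ^ (n - i)) ≠ 0 := pow_ne_zero _ (by norm_num)
    rw [hPi]
    unfold vorosA
    rw [show 2 * n + 2 * i = 2 * i + 2 * n by ring, show n + i = i + n by ring, h4]
    rw [show n + i = i + n by ring] at hs1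
    field_simp
    linear_combination (-1 : ℝ) * hs1
  have hlast : P.eval (v (n + 1)) / ∏ j ∈ (Finset.range (n + 2)).erase (n + 1), (v (n + 1) - v j) =
      -(-1) ^ n / vorosA n 0 := by
    rw [hD2, hv1, hPeval, prod_even]
    have hq := prod_one_sub_even n
    have hf1 := hfact n
    have hf2 := hfact (2 * n)
    have hprod : ∏ j ∈ Finset.range (n + 1), ((1 : ℝ) - 2 * (j : ℝ)) ≠ 0 := by
      rw [Finset.prod_ne_zero_iff]
      intro j _ h
      have h' : (1 : ℤ) - 2 * (j : ℤ) = 0 := by exact_mod_cast h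
      omega
    have hPi : ∏ j ∈ Finset.range (n + 1), ((1 : ℝ) - 2 * (j : ℝ)) =
        (-1) ^ n * ((2 * n).factorial : ℝ) / ((2 : ℝ) ^ n * (n.factorial : ℝ)) := by
      rw [eq_div_iff (by positivity)]
      linear_combination hq
    have hs1 : ((-1 : ℝ) ^ n) * (-1) ^ n = 1 := by rw [← mul_pow]; norm_num
    have hε : ((-1 : ℝ) ^ n) ≠ 0 := pow_ne_zero _ (by norm_num)
    have h4 : (4 : ℝ) ^ n = 2 ^ n * 2 ^ n := by rw [← mul_pow]; norm_num
    rw [hPi]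
    unfold vorosA
    simp only [Nat.cast_zero, mul_zero, zero_sub, Nat.sub_zero, add_zero, Nat.factorial_zero,
      Nat.cast_one, mul_one]
    rw [h4]
    field_simp
    linear_combination (-1 : ℝ) * hs1
  -- assemble the two identities
  rw [Finset.sum_range_succ] at h1 h2
  rw [Finset.sum_congr rfl fun i hi ↦ hterm i (Finset.mem_range.1 hi), hlast] at h1
  have hXterm : ∀ i ∈ Finset.range (n + 1), (X * P).eval (v i) /
      ∏ j ∈ (Finset.range (n + 2)).erase i, (v i - v j) = 2 * (i : ℝ) * ((-1) ^ (n + i) * vorosA n i) := by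
    intro i hi
    have hi' := Finset.mem_range.1 hi
    rw [eval_mul, eval_X, mul_div_assoc, hterm i hi', hv2 i (by omega)]
  have hXlast : (X * P).eval (v (n + 1)) /
      ∏ j ∈ (Finset.range (n + 2)).erase (n + 1), (v (n + 1) - v j) = -(-1) ^ n / vorosA n 0 := by
    rw [eval_mul, eval_X, mul_div_assoc, hlast, hv1, one_mul]
  rw [Finset.sum_congr rfl hXterm, hXlast] at h2
  have hs1 : ((-1 : ℝ) ^ n) * (-1) ^ n = 1 := by rw [← mul_pow]; norm_num
  have hA0 : vorosA n 0 ≠ 0 := by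
    unfold vorosA
    simp only [Nat.cast_zero, mul_zero, zero_sub, Nat.sub_zero, add_zero, Nat.factorial_zero,
      Nat.cast_one, mul_one]
    have := hfact (2 * n); have := hfact n
    apply div_ne_zero (hfact _)
    simp [hfact n]
  -- factor `(−1)^n` out of the sums
  have e1 : ∑ i ∈ Finset.range (n + 1), (-1 : ℝ) ^ (n + i) * vorosA n i =
      (-1) ^ n * ∑ m ∈ Finset.range (n + 1), (-1 : ℝ) ^ m * vorosA n m := by
    rw [Finset.mul_sum]
    exact Finset.sum_congr rfl fun i _ ↦ by rw [pow_add]; ring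
  have e2 : ∑ i ∈ Finset.range (n + 1), 2 * (i : ℝ) * ((-1) ^ (n + i) * vorosA n i) =
      (-1) ^ n * (2 * ∑ m ∈ Finset.Icc 1 n, (-1 : ℝ) ^ m * vorosA n m * m) := by
    rw [sum_Icc_one_eq_sum_range', Finset.mul_sum, Finset.mul_sum, Finset.sum_range_succ']
    simp only [Nat.cast_zero, mul_zero, zero_mul, add_zero]
    exact Finset.sum_congr rfl fun i _ ↦ by rw [pow_add]; push_cast; ring
  rw [e1] at h1
  rw [e2] at h2
  constructor
  · -- (AID-1)
    have : (-1 : ℝ) ^ n * (∑ m ∈ Finset.range (n + 1), (-1 : ℝ) ^ m * vorosA n m - 1 / vorosA n 0) = 0 := by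
      have e : -(-1 : ℝ) ^ n / vorosA n 0 = (-1) ^ n * (-(1 / vorosA n 0)) := by ring
      rw [e] at h1
      linear_combination -h1
    rcases mul_eq_zero.1 this with h | h
    · exact absurd h (pow_ne_zero _ (by norm_num))
    · linarith
  · -- (AID-2)
    have : (-1 : ℝ) ^ n * (2 * ∑ m ∈ Finset.Icc 1 n, (-1 : ℝ) ^ m * vorosA n m * m -
        ((-1) ^ n + 1 / vorosA n 0)) = 0 := by
      have e : -(-1 : ℝ) ^ n / vorosA n 0 = (-1) ^ n * (-(1 / vorosA n 0)) := by ring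
      rw [e] at h2
      linear_combination -h2 - hs1
    rcases mul_eq_zero.1 this with h | h
    · exact absurd h (pow_ne_zero _ (by norm_num))
    · linarith

end PartialFractions

end Literature.NumberTheory.LFunctions
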